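import Mathlib.Analysis.SpecialFunctions.Log.NegMulLog
import Literature.Geometry.Riemannian.ShrinkerEntropyAllScalesProofs
import Literature.Geometry.Riemannian.BakryEmeryCompleteLogSobolevHolds
import HarnessLib
/-!
# The energy-class weighted heat flow of a complete gradient shrinker and Li–Wang 2020, Thm. 1.1: the logarithmic Sobolev
# constant of a complete gradient Ricci shrinker at ALL scales — the named fact `LiWang2020_shrinkerLSI_allScales` HOLDS
# (weak maximum principle, two-sided bounds, shrinker cut-offs, linear heat equation with compactly supported forcing, flow
# existence, gradient decay, energy estimate, mass conservation; Li–Wang 2020, Carrillo–Ni 2009, Grigor'yan 2009, Trèves 1975)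

**Y. Li, B. Wang, *Heat kernel on Ricci shrinkers*, Calc. Var. PDE 59 (2020) no. 194, Thm. 1.1 = Prop. 5.9 [LiWang2020]: on a
complete connected normalised gradient shrinker `Ric + Hess f = g/2`, `R + |∇f|² = f`, the logarithmic Sobolev inequality
`log((4π)^{-n/2} ∫ e^{-f}) ≤ 𝒲(g, ψ, τ)` holds at EVERY scale `τ > 0`.**  The tree REDUCES this named fact
(`Literature.Geometry.Riemannian.LiWang2020_shrinkerLSI_allScales`, file `ShrinkerEntropyAllScales.lean`) to the existence of the
global energy-class weighted heat flow `∂ₜu = Δu − g⁻¹(df, du)` from smooth data constant outside a compact set with its linear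
a-priori package (`LiWang2020_shrinkerLSI_allScales_of_heatFlow`, `ShrinkerEntropyAllScalesProofs.lean`); this file supplies that
flow and closes the fact: the integrated weak maximum principle and two-sided bounds for energy-class solutions on a complete
weighted manifold (A. Grigor'yan, *Heat Kernel and Analysis on Manifolds* (2009) §11.4, §12.1 [Grigoryan2009]), the `H¹`
shrinker cut-offs `|Δη_k|, |⟨∇f, ∇η_k⟩| ≤ C` (Haslhofer–Müller 2011 Lemma 2.1 [HaslhoferMuller2011]; Carrillo–Ni 2009 §4
[CarrilloNi2009]), Lions' very weak solutions and the linear heat equation with compactly supported forcing continuous up to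
`s = 0` (F. Trèves, *Basic Linear Partial Differential Equations* (1975) §§40–41 [Treves1975]), energy uniqueness, existence of
the weighted heat flow on `[0, T]` given the flat corrector and the Cauchy solver, gradient decay `|∇u(t)|² ≤ e^{-2Kt} C` under
`Ric + Hess V ≥ K g` (Carrillo–Ni 2009 §3), the energy estimate, conservation of mass, Carrillo–Ni's clauses (i)/(iii)
(`R ≥ 0`, proper potential, `e^{-f} ∈ L¹`), uniqueness of the energy-class flow, the global shrinker flow `shrinker_heatFlow`
glued along `T = k + 1`, and — last Part — the EXACT discharge `Literature.Geometry.Riemannian.LiWang2020_shrinkerLSI_allScales_holds`.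
RE-HOMED into `Literature/` by the Hodge foundations lane (`lit-hodgefound`, seat p20, generation 41): verbatim DECLARATION-LEVEL
ports, in dependency order and each under its original module docstring, of the theorems of the theorem-only modules
`Summits/SmoothPoincare4/SmoothPoincare4/Theorems/EntropyRungNoncompactShrinkerGap{HeatMaxPrinciple, HeatTwoSidedBound,
HeatCutoffToolkit, LiWangAllScalesAux, StubCompactSupportLSIMixture, HeatShrinkerCutoff, HeatVeryWeakNoncompact, HeatEnergyVanishing,
HeatLinearHeat, HeatFlowExistence, HeatGradientDecay, HeatEnergyEstimate, HeatMassConservation, CarrilloNiClauses, LiWangAllScales}.lean`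
(cell of the route `EntropyRung` of the smooth Poincaré 4 summit, crux "non-compact shrinker gap", where they certify classical
heat-flow analysis on a complete gradient shrinker independent of that route's topological target), namespaces
`Summit.SmoothPoincare4.SmoothPoincare4.Theorems.{NoncompactShrinkerGapHeat, NoncompactShrinkerGapCompactSupportLSI,
NoncompactShrinkerGapCarrilloNiClauses, NoncompactShrinkerGapLiWang}` re-rooted under `Literature.Geometry.Riemannian.`; the
`helper_…` names of the source are kept.  The theorems of the same cone that are already in `Literature/` (the re-homes
`Geometry/Riemannian/{WeightedHeatCutoffCalculus, WeightedHeatFlowNoncompact, LinearHeatVeryWeakNoncompact,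
LinearHeatWeakRegularityNoncompact, LinearHeatCauchyNoncompact}` by other seats, and this seat's `BakryEmeryCompleteGaffneyEnergy`,
`BakryEmeryCompleteLogSobolevHolds`) are IMPORTED, not duplicated.  Theorem-only file: no definition, no named fact (D-0026);
imports Mathlib/Literature only; every declaration carries the citation of the printed step it formalises or serves.  The Summits
originals stay in place (transitional duplication; twins = same short names under `Summit.SmoothPoincare4.SmoothPoincare4.Theorems.…`).
Nothing here bears on any summit statement.
-/

noncomputable section

/-!
## Part 1 — port of `Summits/SmoothPoincare4/SmoothPoincare4/Theorems/EntropyRungNoncompactShrinkerGapHeatMaxPrinciple.lean` (1 declarations kept)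

# Weak maximum principle for the weighted heat equation on a complete weighted manifold
#

`helper_weightedMaxPrinciple`. Setting: `M` modelled on `ℝⁿ` (Hausdorff, second
countable, T3, Borel), `g` Riemannian with its Levi-Civita connection, `V` smooth,
`L u = Δ_g u − g⁻¹(dV, du)`, weighted measure `e^{-V} dV_g`; cut-offs `η_k` (smooth, compactly
supported, `0 ≤ η_k ≤ 1`, `η_k ≤ η_{k+1}`, eventually `= 1` near every point, `|Lη_k| ≤ C`).
**Theorem.** If `z` is smooth on `M × O` (`O ⊇ [0, T]` open), `∂ₛz ≤ L z(s,·)` on `[0,T] × M`,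
`z(0,·) ≤ 0` and `z₊ e^{-V} ∈ L¹(M × (0,T))`, then `z ≤ 0` on `[0, T] × M`.

Proof (energy method with cut-offs, as in Grigor'yan 2009, §11.4 / §12.1). With the smooth convex
test function `Φ` of `exists_convexTest` (`Φ = ∫₀ smoothTransition`: `Φ = 0` on `(−∞,0]`,
`0 ≤ Φ' ≤ 1`, `Φ'' ≥ 0`, `0 ≤ Φ(t) ≤ t₊`, `Φ(t) = 0 ⇒ t ≤ 0`) put `E_k(s) = ∫ Φ(z(s,·)) η_k e^{-V}`.
By the Leibniz rule with the compactly supported weight `η_k e^{-V}`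
(`WeightedParametricIntegral.lean`) and the dissipation inequality `integral_test_dissipation_le`
(two weighted Green identities with compact support), `E_k' ≤ a_k := ∫ |Lη_k| Φ(z) e^{-V}` on
`[0, T]`; hence (FTC, `E_k(0) = 0`)
`E_k(s) ≤ ∫₀ᵀ a_k = ∫∫_{M×(0,T)} |Lη_k| Φ(z) e^{-V}` (Fubini; `g.riemVolume` is σ-finite), which
tends to `0` by dominated convergence (`|Lη_k| Φ(z) ≤ C z₊`, `Lη_k → 0` pointwise). Since `E_k(s)`
is nondecreasing in `k` and nonnegative, every `E_k(s)` vanishes; the integrand being continuous and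
nonnegative and `g.riemVolume` positive on open sets, `Φ(z(s,x)) η_k(x) = 0` for all `k, x`, and at
any `x` some `η_k(x) = 1`, so `Φ(z(s,x)) = 0`, i.e. `z(s,x) ≤ 0`.
-/

section Part1

open scoped _root_.Manifold _root_.ContDiff _root_.ENNReal _root_.NNReal _root_.Topology
open _root_.MeasureTheory _root_.Set _root_.Filter
open Literature.Geometry.Lorentzian Literature.Geometry.Riemannian

namespace Literature.Geometry.Riemannian.NoncompactShrinkerGapHeat

/-! ### A smooth convex nondecreasing test function vanishing on `(-∞, 0]` -/

/-- **Weak maximum principle for subsolutions of the weighted heat equation on a complete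
weighted manifold, in the class `z₊ e^{-V} ∈ L¹(M × (0,T))`** (`helper_weightedMaxPrinciple`). Energy method with cut-offs: for the
convex test function `Φ` of `exists_convexTest` and `E_k(s) = ∫ Φ(z(s,·)) η_k e^{-V}`, the Leibniz
rule (compactly supported weight) and the dissipation inequality `integral_test_dissipation_le` give
`E_k' ≤ ∫ |Lη_k| Φ(z) e^{-V}` on `[0, T]`, whence `0 ≤ E_k(s) ≤ ∫∫_{M×(0,T)} |Lη_k| Φ(z) e^{-V} → 0`
(`E_k(0) = 0`, `|Lη_k| ≤ C`, `Lη_k → 0` pointwise, `Φ(z) ≤ z₊`, dominated convergence); as `E_k` is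
nondecreasing in `k`, every `E_k(s)` vanishes, so `Φ(z(s,·)) η_k = 0` and `z(s, x) ≤ 0` wherever
some `η_k(x) = 1`. [cite: Grigoryan2009, §11.4 and §12.1 (uniqueness class and integrated maximum
principle for the Cauchy problem on complete weighted manifolds, energy estimates with cut-offs)] -/
theorem helper_weightedMaxPrinciple : ∀ (n : ℕ) (M : Type*) [TopologicalSpace M] [T2Space M] [SecondCountableTopology M] [ChartedSpace (EuclideanSpace ℝ (Fin n)) M] [IsManifold (𝓡 n) ∞ M] [T3Space M] [MeasurableSpace M] [BorelSpace M] (g : PseudoRiemannianMetric (𝓡 n) ∞ (EuclideanSpace ℝ (Fin n)) (TangentSpace (𝓡 n) : M → Type _)) [g.HasLeviCivita] (V : M → ℝ), g.IsRiemannian → ContMDiff (𝓡 n) 𝓘(ℝ, ℝ) ∞ V → ∀ (η : ℕ → M → ℝ) (C : ℝ), (∀ k, ContMDiff (𝓡 n) 𝓘(ℝ, ℝ) ∞ (η k)) → (∀ k, HasCompactSupport (η k)) → (∀ k x, 0 ≤ η k x ∧ η k x ≤ 1) → (∀ k x, η k x ≤ η (k + 1) x) → (∀ x, ∀ᶠ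 k in atTop, ∀ᶠ y in 𝓝 x, η k y = 1) → (∀ k x, |g.dalembertian (η k) x - g.innerDual x (mvfderiv (𝓡 n) V x).toLinearMap (mvfderiv (𝓡 n) (η k) x).toLinearMap| ≤ C) → ∀ (T : ℝ) (O : Set ℝ) (z : ℝ → M → ℝ), 0 < T → IsOpen O → Icc 0 T ⊆ O → ContMDiffOn ((𝓡 n).prod 𝓘(ℝ, ℝ)) 𝓘(ℝ, ℝ) ∞ (fun p : M × ℝ ↦ z p.2 p.1) (univ ×ˢ O) → (∀ s ∈ Icc 0 T, ∀ x, deriv (fun r ↦ z r x) s ≤ g.dalembertian (z s) x - g.innerDual x (mvfderiv (𝓡 n) V x).toLinearMap (mvfderiv (𝓡 n) (z s) x).toLinearMap) → (∀ x, z 0 x ≤ 0) → Integrable (fun p : M × ℝ ↦ max (z p.2 p.1) 0 * Real.exp (-V p.1)) ((g.riemVolume.prod (volume : Measure ℝ)).restrict (univ ×ˢ Ioo 0 T)) → ∀ s ∈ Icc 0 T, ∀ x, z s x ≤ 0 := by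
  intro n M _ _ _ _ _ _ _ _ g _ V hg hV η C hηs hηc hη01 hηmono hη1 hLη T O z hT hO hTO hz hsub
    hz0 hint s₀ hs₀ x₀
  -- topology and measure
  haveI : LocallyCompactSpace M := Manifold.locallyCompact_of_finiteDimensional (M := M) (𝓡 n)
  haveI : IsFiniteMeasureOnCompacts g.riemVolume :=
    CarrilloNi2009_shrinkerLSI.isFiniteMeasureOnCompacts_riemVolume hg
  haveI : IsLocallyFiniteMeasure g.riemVolume := isLocallyFiniteMeasure_of_isFiniteMeasureOnCompacts
  haveI : g.riemVolume.IsOpenPosMeasure := by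
    rw [PseudoRiemannianMetric.riemVolume_eq hg]; exact isOpenPosMeasure_riemannianMeasure _
  set μ : Measure M := g.riemVolume with hμ
  -- the test function
  obtain ⟨Φ, hΦs, hΦneg, hΦ', hΦ'', hΦbd, hΦzero⟩ := exists_convexTest
  have hΦd : ∀ t, HasDerivAt Φ (deriv Φ t) t := fun t ↦ (hΦs.differentiable (by simp) t).hasDerivAt
  have hΦc : Continuous Φ := hΦs.continuous
  have hΦ'c : Continuous (deriv Φ) := hΦs.continuous_deriv (by simp)
  -- the weighted Laplacians `ℓ k = Lη_k` of the cut-offs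
  set ℓ : ℕ → M → ℝ := fun k x ↦ g.dalembertian (η k) x -
    g.innerDual x (mvfderiv (𝓡 n) V x).toLinearMap (mvfderiv (𝓡 n) (η k) x).toLinearMap with hℓ
  have hℓc : ∀ k, Continuous (ℓ k) := fun k ↦
    (continuous_hasCompactSupport_weightedLaplacian (g := g) (hηs k) (hηc k) hV).1
  have hℓs : ∀ k, HasCompactSupport (ℓ k) := fun k ↦
    (continuous_hasCompactSupport_weightedLaplacian (g := g) (hηs k) (hηc k) hV).2
  have hC0 : 0 ≤ C := (abs_nonneg _).trans (hLη 0 x₀)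
  have hℓ0 : ∀ x, ∀ᶠ k in atTop, ℓ k x = 0 := fun x ↦ (hη1 x).mono fun k hk ↦
    weightedLaplacian_eq_zero_of_eventuallyEq_one (g := g) (V := V) (hηs k) hk
  -- regularity of `z`: slices, joint continuity, time derivative
  have hexpc : Continuous fun x ↦ Real.exp (-V x) := Real.continuous_exp.comp hV.continuous.neg
  have hzs : ∀ s ∈ O, ContMDiff (𝓡 n) 𝓘(ℝ, ℝ) ∞ (z s) := fun s hs ↦
    contMDiff_slice_of_contMDiffOn hz hs
  have hswap : ∀ p ∈ O ×ˢ (univ : Set M), (Prod.swap p) ∈ (univ : Set M) ×ˢ O :=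
    fun p hp ↦ ⟨mem_univ _, hp.1⟩
  have hzc : ContinuousOn (fun p : ℝ × M ↦ z p.1 p.2) (O ×ˢ univ) :=
    hz.continuousOn.comp continuous_swap.continuousOn hswap
  have hdz : ContMDiffOn ((𝓡 n).prod 𝓘(ℝ, ℝ)) 𝓘(ℝ, ℝ) ∞
      (fun p : M × ℝ ↦ deriv (fun r ↦ z r p.1) p.2) (univ ×ˢ O) := by
    have h := contMDiffOn_derivWithin_time_of_uniqueDiffOn (I := 𝓡 n) (u := z) hO.uniqueDiffOn hz
    exact h.congr fun p hp ↦ (derivWithin_of_isOpen hO hp.2).symm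
  have hzd : ∀ s ∈ O, ∀ x, HasDerivAt (fun r ↦ z r x) (deriv (fun r ↦ z r x) s) s := by
    intro s hs x
    have h := hasDerivWithinAt_time_of_contMDiffOn (I := 𝓡 n) (k := ∞) (by simp) hz x hs
    exact (h.hasDerivAt (hO.mem_nhds hs)).differentiableAt.hasDerivAt
  have hdzc : ContinuousOn (fun p : ℝ × M ↦ deriv (fun r ↦ z r p.2) p.1) (O ×ˢ univ) :=
    hdz.continuousOn.comp continuous_swap.continuousOn hswap
  -- the integrands `F = Φ(z)`, `F' = Φ'(z) ∂ₛz`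
  set F : ℝ → M → ℝ := fun s x ↦ Φ (z s x) with hF
  set F' : ℝ → M → ℝ := fun s x ↦ deriv Φ (z s x) * deriv (fun r ↦ z r x) s with hF'
  have hFc : ContinuousOn (Function.uncurry F) (O ×ˢ univ) := hΦc.comp_continuousOn hzc
  have hF'c : ContinuousOn (Function.uncurry F') (O ×ˢ univ) :=
    (hΦ'c.comp_continuousOn hzc).mul hdzc
  have hFd : ∀ s ∈ O, ∀ x, HasDerivAt (F · x) (F' s x) s := fun s hs x ↦
    (hΦd (z s x)).comp s (hzd s hs x)
  have hFsc : ∀ s ∈ O, Continuous (F s) := fun s hs ↦ hΦc.comp (hzs s hs).continuous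
  have hF'sc : ∀ s ∈ O, Continuous (F' s) := fun s hs ↦
    hF'c.comp_continuous (Continuous.prodMk_right s) fun x ↦ ⟨hs, mem_univ _⟩
  -- the weights `h k = η_k e^{-V}`, energies `E k`, derivatives `E' k`, dissipation bounds `a k`
  set h : ℕ → M → ℝ := fun k x ↦ η k x * Real.exp (-V x) with hh
  have hhc : ∀ k, Continuous (h k) := fun k ↦ (hηs k).continuous.mul hexpc
  have hhs : ∀ k, HasCompactSupport (h k) := fun k ↦ (hηc k).mul_right
  have hh0 : ∀ k x, 0 ≤ h k x := fun k x ↦ mul_nonneg (hη01 k x).1 (Real.exp_pos _).le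
  set E : ℕ → ℝ → ℝ := fun k s ↦ ∫ x, h k x • F s x ∂μ with hE
  set E' : ℕ → ℝ → ℝ := fun k s ↦ ∫ x, h k x • F' s x ∂μ with hE'
  set a : ℕ → ℝ → ℝ := fun k s ↦ ∫ x, (|ℓ k x| * Real.exp (-V x)) • F s x ∂μ with ha
  have hEd : ∀ k, ∀ s ∈ O, HasDerivAt (E k) (E' k s) s := fun k s hs ↦
    Literature.Analysis.FluidPDE.hasDerivAt_integral_smul_of_continuousOn (hhc k) (hhs k) hO hFc
      hF'c hFd hs
  have hE'c : ∀ k, ContinuousOn (E' k) O := fun k ↦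
    Literature.Analysis.FluidPDE.continuousOn_integral_smul_of_continuousOn (hhc k) (hhs k) hF'c
  have hℓec : ∀ k, Continuous fun x ↦ |ℓ k x| * Real.exp (-V x) := fun k ↦ (hℓc k).abs.mul hexpc
  have hℓes : ∀ k, HasCompactSupport fun x ↦ |ℓ k x| * Real.exp (-V x) := fun k ↦
    ((hℓs k).comp_left (g := fun t : ℝ ↦ |t|) abs_zero).mul_right
  have hac : ∀ k, ContinuousOn (a k) O := fun k ↦
    Literature.Analysis.FluidPDE.continuousOn_integral_smul_of_continuousOn (hℓec k) (hℓes k) hFc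
  have ha0 : ∀ k s, 0 ≤ a k s := fun k s ↦ integral_nonneg fun x ↦
    mul_nonneg (mul_nonneg (abs_nonneg _) (Real.exp_pos _).le) (hΦbd _).1
  -- the dissipation bound `E' ≤ a` on `[0, T]`
  have hE'le : ∀ k, ∀ s ∈ Icc 0 T, E' k s ≤ a k s := by
    intro k s hs
    have hsO := hTO hs
    have hws := hzs s hsO
    have hLc : Continuous fun x ↦ g.dalembertian (z s) x -
        g.innerDual x (mvfderiv (𝓡 n) V x).toLinearMap (mvfderiv (𝓡 n) (z s) x).toLinearMap :=
      (continuous_dalembertian g (hws.of_le (WithTop.coe_le_coe.mpr le_top))).sub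
        (continuous_innerDual_mvfderiv g (hV.of_le (by norm_num)) (hws.of_le (by norm_num)))
    have i1 : Integrable (fun x ↦ h k x • F' s x) μ :=
      ((hhc k).smul (hF'sc s hsO)).integrable_of_hasCompactSupport ((hhs k).smul_right)
    have i2 : Integrable (fun x ↦ h k x • (deriv Φ (z s x) * (g.dalembertian (z s) x -
        g.innerDual x (mvfderiv (𝓡 n) V x).toLinearMap (mvfderiv (𝓡 n) (z s) x).toLinearMap))) μ :=
      ((hhc k).smul ((hΦ'c.comp hws.continuous).mul hLc)).integrable_of_hasCompactSupport
        ((hhs k).smul_right)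
    have step1 : E' k s ≤ ∫ x, h k x • (deriv Φ (z s x) * (g.dalembertian (z s) x -
        g.innerDual x (mvfderiv (𝓡 n) V x).toLinearMap (mvfderiv (𝓡 n) (z s) x).toLinearMap))
        ∂μ := by
      refine integral_mono i1 i2 fun x ↦ ?_
      exact mul_le_mul_of_nonneg_left (mul_le_mul_of_nonneg_left (hsub s hs x) (hΦ' _).1) (hh0 k x)
    have step2 := integral_test_dissipation_le hg hws (hηs k) (hηc k) (fun x ↦ (hη01 k x).1) hV hΦs
      (fun t ↦ (hΦbd t).1) hΦ''
    exact step1.trans step2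
  -- integrating in time: `E k s₀ ≤ ∫₀ᵀ a k`
  have hEbound : ∀ k, E k s₀ ≤ ∫ s in (0 : ℝ)..T, a k s := by
    intro k
    have hIcc : Icc 0 s₀ ⊆ O := fun s hs ↦ hTO ⟨hs.1, hs.2.trans hs₀.2⟩
    have hderiv : ∀ s ∈ uIcc 0 s₀, HasDerivAt (E k) (E' k s) s := by
      intro s hs
      rw [uIcc_of_le hs₀.1] at hs
      exact hEd k s (hIcc hs)
    have hE'i : IntervalIntegrable (E' k) volume 0 s₀ :=
      ((hE'c k).mono (by rw [uIcc_of_le hs₀.1]; exact hIcc)).intervalIntegrable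
    have hai : IntervalIntegrable (a k) volume 0 T :=
      ((hac k).mono (by rw [uIcc_of_le hT.le]; exact hTO)).intervalIntegrable
    have hai' : IntervalIntegrable (a k) volume 0 s₀ :=
      ((hac k).mono (by rw [uIcc_of_le hs₀.1]; exact hIcc)).intervalIntegrable
    have hFTC := intervalIntegral.integral_eq_sub_of_hasDerivAt hderiv hE'i
    have hE0 : E k 0 = 0 := by
      refine integral_eq_zero_of_ae (ae_of_all _ fun x ↦ ?_)
      simp [hF, hΦneg _ (hz0 x)]
    calc E k s₀ = ∫ s in (0 : ℝ)..s₀, E' k s := by rw [hFTC, hE0, sub_zero]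
      _ ≤ ∫ s in (0 : ℝ)..s₀, a k s := intervalIntegral.integral_mono_on hs₀.1 hE'i hai'
          fun s hs ↦ hE'le k s ⟨hs.1, hs.2.trans hs₀.2⟩
      _ ≤ ∫ s in (0 : ℝ)..T, a k s := intervalIntegral.integral_mono_interval le_rfl hs₀.1 hs₀.2
          (ae_restrict_of_forall_mem measurableSet_Ioc fun s _ ↦ ha0 k s) hai
  -- the strip integrals and their limit
  set ν : Measure (M × ℝ) := (μ.prod (volume : Measure ℝ)).restrict (univ ×ˢ Ioo 0 T) with hν
  set G : ℕ → M × ℝ → ℝ := fun k p ↦ (|ℓ k p.1| * Real.exp (-V p.1)) • F p.2 p.1 with hG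
  have hνeq : ν = μ.prod ((volume : Measure ℝ).restrict (Ioo 0 T)) := by
    rw [hν, ← Measure.prod_restrict, Measure.restrict_univ]
  have hGm : ∀ k, AEStronglyMeasurable (G k) ν := by
    intro k
    have hcont : ContinuousOn (G k) (univ ×ˢ O) := by
      refine ((((hℓc k).abs.mul hexpc).comp continuous_fst).continuousOn).smul ?_
      exact hΦc.comp_continuousOn hz.continuousOn
    exact (hcont.mono (prod_mono le_rfl (Ioo_subset_Icc_self.trans hTO))).aestronglyMeasurable
      (MeasurableSet.univ.prod measurableSet_Ioo)
  have hGbd : ∀ k p, ‖G k p‖ ≤ C * (max (z p.2 p.1) 0 * Real.exp (-V p.1)) := by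
    intro k p
    have h1 := hLη k p.1
    have h2 := (hΦbd (z p.2 p.1)).2
    have h3 := (hΦbd (z p.2 p.1)).1
    have hex := Real.exp_pos (-V p.1)
    rw [Real.norm_eq_abs, hG]
    simp only [smul_eq_mul]
    rw [abs_of_nonneg (mul_nonneg (mul_nonneg (abs_nonneg _) hex.le) h3)]
    calc |ℓ k p.1| * Real.exp (-V p.1) * Φ (z p.2 p.1)
        ≤ C * Real.exp (-V p.1) * max (z p.2 p.1) 0 := by gcongr
      _ = C * (max (z p.2 p.1) 0 * Real.exp (-V p.1)) := by ring
  have hGi : ∀ k, Integrable (G k) ν := fun k ↦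
    (hint.const_mul C).mono' (hGm k) (ae_of_all _ (hGbd k))
  have hstrip : ∀ k, ∫ s in (0 : ℝ)..T, a k s = ∫ p, G k p ∂ν := by
    intro k
    rw [intervalIntegral.integral_of_le hT.le, integral_Ioc_eq_integral_Ioo, hνeq,
      integral_prod_symm (G k) (by rw [← hνeq]; exact hGi k)]
  have hlim : Tendsto (fun k ↦ ∫ p, G k p ∂ν) atTop (𝓝 0) := by
    have h := tendsto_integral_of_dominated_convergence (F := G) (f := fun _ ↦ (0 : ℝ))
      (fun p ↦ C * (max (z p.2 p.1) 0 * Real.exp (-V p.1))) hGm (hint.const_mul C)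
      (fun k ↦ ae_of_all _ (hGbd k)) (ae_of_all _ fun p ↦ ?_)
    · simpa using h
    · refine tendsto_const_nhds.congr' ?_
      filter_upwards [hℓ0 p.1] with k hk
      simp [hG, hk]
  -- every energy vanishes at `s₀`
  have hs₀O := hTO hs₀
  have hEi : ∀ k, Integrable (fun x ↦ h k x • F s₀ x) μ := fun k ↦
    ((hhc k).smul (hFsc s₀ hs₀O)).integrable_of_hasCompactSupport ((hhs k).smul_right)
  have hEmono : ∀ k j, k ≤ j → E k s₀ ≤ E j s₀ := by
    intro k j hkj
    refine integral_mono (hEi k) (hEi j) fun x ↦ ?_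
    have hηle : η k x ≤ η j x := (monotone_nat_of_le_succ fun m ↦ hηmono m x) hkj
    exact mul_le_mul_of_nonneg_right (mul_le_mul_of_nonneg_right hηle (Real.exp_pos _).le)
      (hΦbd _).1
  have hEzero : ∀ k, E k s₀ = 0 := by
    intro k
    refine le_antisymm ?_ (integral_nonneg fun x ↦ mul_nonneg (hh0 k x) (hΦbd _).1)
    have hb : Tendsto (fun j ↦ ∫ s in (0 : ℝ)..T, a j s) atTop (𝓝 0) := by
      simp only [hstrip]; exact hlim
    exact ge_of_tendsto hb (eventually_atTop.2 ⟨k, fun j hj ↦ (hEmono k j hj).trans (hEbound j)⟩)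
  -- conclusion at `x₀`
  obtain ⟨k, hk⟩ := (hη1 x₀).exists
  have hk1 : η k x₀ = 1 := hk.self_of_nhds
  have hcont : Continuous fun x ↦ h k x • F s₀ x := (hhc k).smul (hFsc s₀ hs₀O)
  have hnn : 0 ≤ fun x ↦ h k x • F s₀ x := fun x ↦ mul_nonneg (hh0 k x) (hΦbd _).1
  have hae := (integral_eq_zero_iff_of_nonneg hnn (hEi k)).1 (hEzero k)
  have heq := (hcont.ae_eq_iff_eq μ continuous_const).1 hae
  have hx : h k x₀ * F s₀ x₀ = 0 := congr_fun heq x₀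
  have hpos : 0 < h k x₀ := by simp only [hh, hk1, one_mul]; exact Real.exp_pos _
  have hΦ0 : Φ (z s₀ x₀) = 0 := by
    rcases mul_eq_zero.1 hx with h0 | h0
    · exact absurd h0 hpos.ne'
    · exact h0
  exact hΦzero _ hΦ0

end Literature.Geometry.Riemannian.NoncompactShrinkerGapHeat

end Part1

/-!
## Part 2 — port of `Summits/SmoothPoincare4/SmoothPoincare4/Theorems/EntropyRungNoncompactShrinkerGapHeatTwoSidedBound.lean` (1 declarations kept)

# Two-sided bounds `inf ρ₀ ≤ ρ ≤ sup ρ₀` along the weighted heat flow on a complete weighted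
# manifold

`helper_twoSidedBound`. Setting as in
`EntropyRungNoncompactShrinkerGapHeatMaxPrinciple.lean` (`M` modelled on `ℝⁿ`, `g` Riemannian,
`V` smooth with `e^{-V} ∈ L¹(M)`, `L = Δ_g − g⁻¹(dV, d·)`, cut-offs `η_k` with `|Lη_k| ≤ C`).
**Theorem.** A solution `ρ` of `∂ₛρ = Lρ` on `[0, T]`, smooth on `M × O` (`O ⊇ [0,T]` open), with
`c₁ ≤ ρ(0) ≤ C₁`, `c₁ ≤ c₀ ≤ C₁` and `(ρ − c₀)² e^{-V} ∈ L¹(M × (0,T))` satisfies `c₁ ≤ ρ ≤ C₁` on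
`[0, T] × M`.

Proof: for constants `a, b` the affine image `z = aρ + b` is smooth on `M × O` and solves
`∂ₛz = Lz` (`L(aρ + b) = aLρ`, `weightedLaplacian_affine`); for `(a, b) = (1, −C₁)` and `(−1, c₁)`
one has `z(0) ≤ 0` and `z ≤ |ρ − c₀| ≤ (ρ − c₀)² + 1`, so `z₊ e^{-V}` is dominated by the integrable
`(ρ − c₀)² e^{-V} + e^{-V}` on the strip (`e^{-V} ⊗ 1` is integrable on `M × (0,T)`), and `z ≤ 0` by
`helper_weightedMaxPrinciple`. (Closed case: `heatFlow_ge_of_ge` / `heatFlow_le_of_le` of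
`WeightedHeatFlowAPriori.lean` via Topping's weak maximum principle.)
-/

section Part2

open scoped _root_.Manifold _root_.ContDiff _root_.ENNReal _root_.NNReal _root_.Topology
open _root_.MeasureTheory _root_.Set _root_.Filter
open Literature.Geometry.Lorentzian Literature.Geometry.Riemannian

namespace Literature.Geometry.Riemannian.NoncompactShrinkerGapHeat

/-! ### Two-sided bounds along the weighted heat flow on a complete manifold -/

/-- **Two-sided bounds `inf ρ₀ ≤ ρ ≤ sup ρ₀` along the weighted heat flow on a complete weighted
manifold** (`helper_twoSidedBound`): for a solution
`ρ` of `∂ₛρ = Lρ` on `[0, T]` with `c₁ ≤ ρ(0) ≤ C₁`, `c₁ ≤ c₀ ≤ C₁`, `(ρ − c₀)² e^{-V}` integrable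
on the strip and `e^{-V} ∈ L¹(M)`, both `z = ρ − C₁` and `z = c₁ − ρ` are (sub)solutions
(`L(aρ + b) = aLρ`) with `z(0) ≤ 0` and `z₊ ≤ |ρ − c₀| ≤ (ρ − c₀)² + 1`, so
`z₊ e^{-V} ∈ L¹(M × (0,T))` and `z ≤ 0` by the weak maximum principle
`helper_weightedMaxPrinciple`. The closed case is `heatFlow_ge_of_ge` / `heatFlow_le_of_le`
(`WeightedHeatFlowAPriori.lean`). [cite: Grigoryan2009, §11.4 and §12.1
(uniqueness class / maximum principle for the Cauchy problem on complete weighted manifolds)] -/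
theorem helper_twoSidedBound : ∀ (n : ℕ) (M : Type*) [TopologicalSpace M] [T2Space M] [SecondCountableTopology M] [ChartedSpace (EuclideanSpace ℝ (Fin n)) M] [IsManifold (𝓡 n) ∞ M] [T3Space M] [MeasurableSpace M] [BorelSpace M] (g : PseudoRiemannianMetric (𝓡 n) ∞ (EuclideanSpace ℝ (Fin n)) (TangentSpace (𝓡 n) : M → Type _)) [g.HasLeviCivita] (V : M → ℝ), g.IsRiemannian → ContMDiff (𝓡 n) 𝓘(ℝ, ℝ) ∞ V → Integrable (fun x ↦ Real.exp (-V x)) g.riemVolume → ∀ (η : ℕ → M → ℝ) (C : ℝ), (∀ k, ContMDiff (𝓡 n) 𝓘(ℝ, ℝ) ∞ (η k)) → (∀ k, HasCompactSupport (η k)) → (∀ k x, 0 ≤ η k x ∧ η k x ≤ 1) → (∀ k x, η k x ≤ η (k + 1) x) → (∀ x, ∀ᶠ k in atTop, ∀ᶠ y in 𝓝 x, η k y = 1) → (∀ k x, |g.dalembertian (η k) x - g.innerDual x (mvfderiv (𝓡 n) V x).toLinearMap (mvfderiv (𝓡 n) (η k) x).toLinearMap| ≤ C) → ∀ (T : ℝ)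 (O : Set ℝ) (ρ : ℝ → M → ℝ), 0 < T → IsOpen O → Icc 0 T ⊆ O → ContMDiffOn ((𝓡 n).prod 𝓘(ℝ, ℝ)) 𝓘(ℝ, ℝ) ∞ (fun p : M × ℝ ↦ ρ p.2 p.1) (univ ×ˢ O) → (∀ s ∈ Icc 0 T, ∀ x, deriv (fun r ↦ ρ r x) s = g.dalembertian (ρ s) x - g.innerDual x (mvfderiv (𝓡 n) V x).toLinearMap (mvfderiv (𝓡 n) (ρ s) x).toLinearMap) → ∀ (c₀ c₁ C₁ : ℝ), c₁ ≤ c₀ → c₀ ≤ C₁ → (∀ x, c₁ ≤ ρ 0 x ∧ ρ 0 x ≤ C₁) → Integrable (fun p : M × ℝ ↦ (ρ p.2 p.1 - c₀) ^ 2 * Real.exp (-V p.1)) ((g.riemVolume.prod (volume : Measure ℝ)).restrict (univ ×ˢ Ioo 0 T)) → ∀ s ∈ Icc 0 T, ∀ x, c₁ ≤ ρ s x ∧ ρ s x ≤ C₁ := by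
  intro n M _ _ _ _ _ _ _ _ g _ V hg hV hfin η C hηs hηc hη01 hηmono hη1 hLη T O ρ hT hO hTO hρ heq
    c₀ c₁ C₁ hc₁ hC₁ hρ0 hint s hs x
  -- measure-theoretic preliminaries
  haveI : LocallyCompactSpace M := Manifold.locallyCompact_of_finiteDimensional (M := M) (𝓡 n)
  haveI : IsFiniteMeasureOnCompacts g.riemVolume :=
    CarrilloNi2009_shrinkerLSI.isFiniteMeasureOnCompacts_riemVolume hg
  haveI : IsLocallyFiniteMeasure g.riemVolume := isLocallyFiniteMeasure_of_isFiniteMeasureOnCompacts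
  set μ : Measure M := g.riemVolume with hμ
  set ν : Measure (M × ℝ) := (μ.prod (volume : Measure ℝ)).restrict (univ ×ˢ Ioo 0 T) with hν
  have hνeq : ν = μ.prod ((volume : Measure ℝ).restrict (Ioo 0 T)) := by
    rw [hν, ← Measure.prod_restrict, Measure.restrict_univ]
  have hexpc : Continuous fun y ↦ Real.exp (-V y) := Real.continuous_exp.comp hV.continuous.neg
  have hexp_strip : Integrable (fun p : M × ℝ ↦ Real.exp (-V p.1)) ν := by
    rw [hνeq]
    have h := hfin.mul_prod (integrable_const (1 : ℝ) :
      Integrable (fun _ : ℝ ↦ (1 : ℝ)) ((volume : Measure ℝ).restrict (Ioo 0 T)))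
    simpa using h
  have hbound : Integrable (fun p : M × ℝ ↦ (ρ p.2 p.1 - c₀) ^ 2 * Real.exp (-V p.1) +
      Real.exp (-V p.1)) ν := hint.add hexp_strip
  -- regularity of `ρ`
  have hρs : ∀ r ∈ O, ContMDiff (𝓡 n) 𝓘(ℝ, ℝ) ∞ (ρ r) := fun r hr ↦
    contMDiff_slice_of_contMDiffOn hρ hr
  have hρd : ∀ r ∈ O, ∀ y, HasDerivAt (fun r' ↦ ρ r' y) (deriv (fun r' ↦ ρ r' y) r) r := by
    intro r hr y
    have h := hasDerivWithinAt_time_of_contMDiffOn (I := 𝓡 n) (k := ∞) (by simp) hρ y hr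
    exact (h.hasDerivAt (hO.mem_nhds hr)).differentiableAt.hasDerivAt
  -- the maximum principle for the affine images `a ρ + b`
  have key : ∀ a b : ℝ, (∀ y, a * ρ 0 y + b ≤ 0) → (∀ r y, a * ρ r y + b ≤ |ρ r y - c₀|) →
      a * ρ s x + b ≤ 0 := by
    intro a b h0 hle
    set z : ℝ → M → ℝ := fun r y ↦ a * ρ r y + b with hz
    have hzs : ContMDiffOn ((𝓡 n).prod 𝓘(ℝ, ℝ)) 𝓘(ℝ, ℝ) ∞ (fun p : M × ℝ ↦ z p.2 p.1)
        (univ ×ˢ O) := (contMDiffOn_const.mul hρ).add contMDiffOn_const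
    have hsub : ∀ r ∈ Icc 0 T, ∀ y, deriv (fun r' ↦ z r' y) r ≤ g.dalembertian (z r) y -
        g.innerDual y (mvfderiv (𝓡 n) V y).toLinearMap (mvfderiv (𝓡 n) (z r) y).toLinearMap := by
      intro r hr y
      have hrO := hTO hr
      have hd : HasDerivAt (fun r' ↦ z r' y) (a * deriv (fun r' ↦ ρ r' y) r) r :=
        ((hρd r hrO y).const_mul a).add_const b
      have h2 : ContMDiffAt (𝓡 n) 𝓘(ℝ, ℝ) 2 (ρ r) y :=
        ((hρs r hrO).of_le (WithTop.coe_le_coe.mpr le_top)).contMDiffAt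
      have hLz := weightedLaplacian_affine (g := g) (V := V) h2 a b
      rw [hd.deriv, show z r = fun y' ↦ a * ρ r y' + b from rfl, hLz, heq r hr y]
    have hint' : Integrable (fun p : M × ℝ ↦ max (z p.2 p.1) 0 * Real.exp (-V p.1)) ν := by
      refine hbound.mono' ?_ (ae_of_all _ fun p ↦ ?_)
      · have hcont : ContinuousOn (fun p : M × ℝ ↦ max (z p.2 p.1) 0 * Real.exp (-V p.1))
            (univ ×ˢ O) :=
          (hzs.continuousOn.sup continuousOn_const).mul (hexpc.comp continuous_fst).continuousOn
        exact (hcont.mono (prod_mono le_rfl (Ioo_subset_Icc_self.trans hTO))).aestronglyMeasurable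
          (MeasurableSet.univ.prod measurableSet_Ioo)
      · have hex := Real.exp_pos (-V p.1)
        have h1 : max (z p.2 p.1) 0 ≤ |ρ p.2 p.1 - c₀| := max_le (hle _ _) (abs_nonneg _)
        have h2 : |ρ p.2 p.1 - c₀| ≤ (ρ p.2 p.1 - c₀) ^ 2 + 1 := by
          nlinarith [abs_nonneg (ρ p.2 p.1 - c₀), sq_abs (ρ p.2 p.1 - c₀)]
        rw [Real.norm_eq_abs, abs_of_nonneg (mul_nonneg (le_max_right _ _) hex.le)]
        nlinarith
    exact helper_weightedMaxPrinciple n M g V hg hV η C hηs hηc hη01 hηmono hη1 hLη T O z hT hO hTO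
      hzs hsub h0 hint' s hs x
  refine ⟨?_, ?_⟩
  · have h := key (-1) c₁ (fun y ↦ by linarith [(hρ0 y).1])
      (fun r y ↦ by linarith [neg_abs_le (ρ r y - c₀)])
    linarith
  · have h := key 1 (-C₁) (fun y ↦ by linarith [(hρ0 y).2])
      (fun r y ↦ by linarith [le_abs_self (ρ r y - c₀)])
    linarith

end Literature.Geometry.Riemannian.NoncompactShrinkerGapHeat

end Part2

/-!
## Part 3 — port of `Summits/SmoothPoincare4/SmoothPoincare4/Theorems/EntropyRungNoncompactShrinkerGapHeatCutoffToolkit.lean` (3 declarations kept)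

# Cut-off toolkit for the weighted heat flow on a complete manifold

Auxiliary file of the helpers `helper_energyEstimate`, `helper_massConservation`,
`helper_energyVanishing` (energy method with compactly supported cut-offs `η_k` for solutions of
`∂ₛρ = Lρ`, `L = Δ_g − g⁻¹(dV, d·)`, on a NON-compact Riemannian manifold modelled on `ℝⁿ`).
First-order bookkeeping only, in the sub-namespace `CutoffToolkit`:

* `hasDerivAt_integral_mul_of_hasCompactSupport`, `continuousOn_integral_mul_of_hasCompactSupport`
  — `d/ds ∫ F(s,x) h(x) dμ = ∫ ∂ₛF(s,x) h(x) dμ` and continuity of `s ↦ ∫ F(s,x) h(x) dμ` for a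
  compactly supported continuous weight `h` (`WeightedParametricIntegral.lean`);
* `integral_strip_eq_intervalIntegral`, `aestronglyMeasurable_strip`,
  `integrable_strip_mul_of_hasCompactSupport` — Fubini on the strip `X × (a,b)` for
  `(μ ⊗ ds)|_{X×(a,b)}` and integrability there of `F(x,s) h(x)`, `h` compactly supported;
* `sigmaFinite_riemVolume`, `isOpenPosMeasure_riemVolume` — the Riemannian measure of a second
  countable manifold is σ-finite (so Fubini on `dV ⊗ ds` is available) and charges open sets;
* `integral_cutoff_mul_weightedLaplacian` (`∫ η (Lu) e^{-V} = ∫ u (Lη) e^{-V}`) and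
  `integral_sub_mul_cutoff_mul_weightedLaplacian` — the ENERGY IDENTITY with a cut-off
  `∫ (u − c) η (Lu) e^{-V} = −∫ η |∇u|² e^{-V} + ½ ∫ (u − c)² (Lη) e^{-V}` (from the landed
  weighted Green identities `weightedGreen_left/right`; only `Lη` enters, never a separate second
  derivative of `η`);
* `tendsto_cutoff`, `weightedLaplacian_cutoff_eventually_eq_zero`,
  `dalembertian_cutoff_eventually_eq_zero` — cut-offs eventually `= 1` near every point:
  `η_k(x) → 1` and `Lη_k(x) = 0` for large `k` (locality of `Δ_g`, `d`);
* `continuousOn_deriv_time`, `hasDerivAt_time` — time derivatives of functions smooth on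
  `M × O`, `O` open.

References: J. A. Carrillo, L. Ni, Comm. Anal. Geom. 17 (2009), §4 (integrations by parts with
cut-offs on the complete soliton) [CarrilloNi2009]; D. Bakry, I. Gentil, M. Ledoux, *Analysis and
Geometry of Markov Diffusion Operators* (2014), §3.2 [BakryGentilLedoux2014].
-/

section Part3

open scoped _root_.Manifold _root_.ContDiff _root_.ENNReal _root_.NNReal _root_.Topology
open _root_.MeasureTheory _root_.Set _root_.Filter
open Literature.Geometry.Lorentzian Literature.Geometry.Riemannian

namespace Literature.Geometry.Riemannian.NoncompactShrinkerGapHeat.CutoffToolkit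

/-! ### Parametric integrals against a compactly supported weight; the strip `X × (a, b)` -/

section Measure

variable {X : Type*} [TopologicalSpace X] [MeasurableSpace X]

end Measure

/-! ### The Riemannian measure of a second countable manifold; Green identities with compact
support on `g.riemVolume` -/

section Manifold

variable {n : ℕ} {M : Type*} [TopologicalSpace M] [T2Space M] [SecondCountableTopology M]
  [ChartedSpace (EuclideanSpace ℝ (Fin n)) M] [IsManifold (𝓡 n) ∞ M] [T3Space M]
  [MeasurableSpace M] [BorelSpace M]
  {g : PseudoRiemannianMetric (𝓡 n) ∞ (EuclideanSpace ℝ (Fin n)) (TangentSpace (𝓡 n) : M → Type _)}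

variable [g.HasLeviCivita]

/-! ### Two integrations by parts against a compactly supported cut-off -/

omit [T2Space M] [SecondCountableTopology M] [ChartedSpace (EuclideanSpace ℝ (Fin n)) M]
  [IsManifold (𝓡 n) ∞ M] [T3Space M] [MeasurableSpace M] [BorelSpace M] [g.HasLeviCivita] in
/-- A cut-off sequence eventually `= 1` near `x` converges to `1` at `x`. [cite: CarrilloNi2009, §4 (integration by parts on the complete soliton)] -/
theorem tendsto_cutoff {η : ℕ → M → ℝ} (hη1 : ∀ x, ∀ᶠ k in atTop, ∀ᶠ y in 𝓝 x, η k y = 1)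
    (x : M) : Tendsto (fun k ↦ η k x) atTop (𝓝 1) :=
  tendsto_const_nhds.congr' (by
    filter_upwards [hη1 x] with k hk
    exact (hk.self_of_nhds).symm)

omit [T2Space M] [SecondCountableTopology M] [T3Space M] [MeasurableSpace M] [BorelSpace M] in
/-- For a cut-off sequence eventually `= 1` near `x`, `Lη_k(x) = Δη_k(x) − g⁻¹(dV, dη_k)(x) = 0`
for all large `k` (locality of `Δ_g` and of `d`). [cite: CarrilloNi2009, §4 (integration by parts on the complete soliton)] -/
theorem weightedLaplacian_cutoff_eventually_eq_zero {V : M → ℝ} {η : ℕ → M → ℝ}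
    (hη1 : ∀ x, ∀ᶠ k in atTop, ∀ᶠ y in 𝓝 x, η k y = 1) (x : M) :
    ∀ᶠ k in atTop, g.dalembertian (η k) x - g.innerDual x (mvfderiv (𝓡 n) V x).toLinearMap
      (mvfderiv (𝓡 n) (η k) x).toLinearMap = 0 := by
  haveI : Fact ((1 : ℕ∞ω) ≤ (∞ : ℕ∞ω)) := ⟨WithTop.coe_le_coe.2 le_top⟩
  filter_upwards [hη1 x] with k hk
  have hk' : η k =ᶠ[𝓝 x] fun _ ↦ (1 : ℝ) := hk
  rw [g.dalembertian_congr_of_eventuallyEq hk', g.dalembertian_const, mvfderiv_congr_of_eventuallyEq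
    hk', mvfderiv_const, ContinuousLinearMap.toLinearMap_zero, g.innerDual_comm]
  simp [PseudoRiemannianMetric.innerDual]

omit [T2Space M] [SecondCountableTopology M] [T3Space M] [MeasurableSpace M] [BorelSpace M] in
/-- For a cut-off sequence eventually `= 1` near `x`, `Δη_k(x) = 0` for all large `k`.
[cite: CarrilloNi2009, §4 (integration by parts on the complete soliton)] -/
theorem dalembertian_cutoff_eventually_eq_zero {η : ℕ → M → ℝ}
    (hη1 : ∀ x, ∀ᶠ k in atTop, ∀ᶠ y in 𝓝 x, η k y = 1) (x : M) :
    ∀ᶠ k in atTop, g.dalembertian (η k) x = 0 := by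
  haveI : Fact ((1 : ℕ∞ω) ≤ (∞ : ℕ∞ω)) := ⟨WithTop.coe_le_coe.2 le_top⟩
  filter_upwards [hη1 x] with k hk
  have hk' : η k =ᶠ[𝓝 x] fun _ ↦ (1 : ℝ) := hk
  rw [g.dalembertian_congr_of_eventuallyEq hk', g.dalembertian_const]

/-! ### Time derivatives of functions smooth on `M × O`, `O` open -/

end Manifold

end Literature.Geometry.Riemannian.NoncompactShrinkerGapHeat.CutoffToolkit

namespace Literature.Geometry.Riemannian.NoncompactShrinkerGapHeat

end Literature.Geometry.Riemannian.NoncompactShrinkerGapHeat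

end Part3

/-!
## Part 4 — port of `Summits/SmoothPoincare4/SmoothPoincare4/Theorems/EntropyRungNoncompactShrinkerGapLiWangAllScalesAux.lean` (5 declarations kept)

# Lipschitz start and bounded generator for the energy-class weighted heat flow on a complete
# weighted manifold

Setting (the shrinker heat toolkit of leads c8/c9, namespace `…Theorems.NoncompactShrinkerGapHeat`):
`M` modelled on `ℝⁿ` (Hausdorff, second countable, `T₃`, Borel — NOT compact), `g` Riemannian with its
Levi-Civita connection, `V` smooth with `e^{-V} ∈ L¹(dV_g)`, `L = Δ_g − g⁻¹(dV, d·)`, cut-offs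
`η_k ∈ C_c^∞` with `0 ≤ η_k ≤ η_{k+1} ≤ 1`, `η_k = 1` near every point for large `k` and `|Lη_k| ≤ C`;
a solution `ρ` of `∂ₛρ = Lρ` on `[0, T]`, smooth on `M × O` (`O ⊇ [0, T]` open), in the energy class
`(ρ − c)² e^{-V} ∈ L¹(M × (0, T))` (the class produced by `helper_heatFlowExistence`).

* `heatFlow_sub_datum_abs_le` — `|ρ(s) − ρ(0)| ≤ C_L s` when `|Lρ(0)| ≤ C_L` and `ρ(0) − c` is
  bounded: `±(ρ − ρ(0)) − C_L s` are subsolutions (`helper_weightedMaxPrinciple`).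
* `heatFlow_weightedLaplacian_abs_le` (form `helper_liWangHeatLaplacianBound`) —
  `|Lρ(s)| ≤ C_L` on `[0, T)`: the difference quotients `(ρ(s + h) − ρ(s))/h` are solutions in the
  energy class (`integrable_strip_shift`, translation invariance of `ds`) starting in `[−C_L, C_L]`,
  hence stay there (`helper_twoSidedBound`), and `h → 0⁺` gives `|∂ₛρ| = |Lρ| ≤ C_L`.

With the uniqueness of the flow in the energy class (`heatFlow_unique`,
`EntropyRungNoncompactShrinkerGapLiWangAllScales.lean`) these linear a-priori facts glue the flows `u_T`
of all horizons into one flow on `M × [0, ∞)` with bounded generator, the input of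
`LiWang2020_shrinkerLSI_allScales_of_heatFlow`. Everything is proved; no definitions, no named facts.

## References

* [Grigoryan2009] A. Grigor'yan, *Heat Kernel and Analysis on Manifolds* (2009), §11.4 and §12.1
  (uniqueness class and weak maximum principle for the heat equation on a weighted manifold).
* [BakryGentilLedoux2014] D. Bakry, I. Gentil, M. Ledoux (2014), §1.4 ((1.4.3)–(1.4.4):
  `∂_t P_t f = L P_t f = P_t L f`, `‖L P_t f‖_∞ ≤ ‖Lf‖_∞`) and §3.2 (pp. 141–147).
-/

section Part4

open scoped _root_.Manifold _root_.ContDiff _root_.ENNReal _root_.NNReal _root_.Topology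
open _root_.MeasureTheory _root_.Set _root_.Filter
open Literature.Geometry.Lorentzian Literature.Geometry.Riemannian

namespace Literature.Geometry.Riemannian.NoncompactShrinkerGapLiWang

open NoncompactShrinkerGapHeat NoncompactShrinkerGapHeat.CutoffToolkit

section Weighted

variable {n : ℕ} {M : Type*} [TopologicalSpace M] [T2Space M] [SecondCountableTopology M]
  [ChartedSpace (EuclideanSpace ℝ (Fin n)) M] [IsManifold (𝓡 n) ∞ M] [T3Space M]
  [MeasurableSpace M] [BorelSpace M]
  {g : PseudoRiemannianMetric (𝓡 n) ∞ (EuclideanSpace ℝ (Fin n)) (TangentSpace (𝓡 n) : M → Type _)}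
  [g.HasLeviCivita]

omit [T2Space M] [SecondCountableTopology M] [T3Space M] [MeasurableSpace M] [BorelSpace M] in
/-- **`L(u + s v) = Lu + s Lv`** for `u, v` of class `C²` at the point (`L = Δ_g − g⁻¹(dV, d·)`).
[cite: Grigoryan2009, §11.4 and §12.1] -/
theorem weightedLaplacian_add_const_mul {u v V : M → ℝ} {x : M}
    (hu : ContMDiffAt (𝓡 n) 𝓘(ℝ, ℝ) 2 u x) (hv : ContMDiffAt (𝓡 n) 𝓘(ℝ, ℝ) 2 v x) (s : ℝ) :
    g.dalembertian (fun y ↦ u y + s * v y) x - g.innerDual x (mvfderiv (𝓡 n) V x).toLinearMap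
        (mvfderiv (𝓡 n) (fun y ↦ u y + s * v y) x).toLinearMap =
      (g.dalembertian u x - g.innerDual x (mvfderiv (𝓡 n) V x).toLinearMap
        (mvfderiv (𝓡 n) u x).toLinearMap)
      + s * (g.dalembertian v x - g.innerDual x (mvfderiv (𝓡 n) V x).toLinearMap
        (mvfderiv (𝓡 n) v x).toLinearMap) := by
  have hd : (mvfderiv (𝓡 n) (fun y ↦ u y + s * v y) x).toLinearMap =
      (mvfderiv (𝓡 n) u x).toLinearMap + s • (mvfderiv (𝓡 n) v x).toLinearMap := by
    ext a
    exact PseudoRiemannianMetric.mvfderiv_add_const_mul_apply (hu.mdifferentiableAt (by norm_num))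
      (hv.mdifferentiableAt (by norm_num)) s a
  rw [g.dalembertian_add_const_mul_of_contMDiffAt hu hv s, hd, g.innerDual_comm x _ (_ + _),
    g.innerDual_add_left, g.innerDual_smul_left, g.innerDual_comm x (mvfderiv (𝓡 n) u x).toLinearMap,
    g.innerDual_comm x (mvfderiv (𝓡 n) v x).toLinearMap]
  ring

omit [T2Space M] [g.HasLeviCivita] in
/-- The weight `e^{-V}` is integrable on the strip `M × (0, T)` when `e^{-V} ∈ L¹(M)`. [cite: Grigoryan2009, §11.4 and §12.1] -/
theorem integrable_exp_neg_strip (hg : g.IsRiemannian) {V : M → ℝ}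
    (hfin : Integrable (fun x ↦ Real.exp (-V x)) g.riemVolume) (T : ℝ) :
    Integrable (fun p : M × ℝ ↦ Real.exp (-V p.1))
      ((g.riemVolume.prod (volume : Measure ℝ)).restrict (univ ×ˢ Ioo 0 T)) := by
  haveI := CarrilloNi2009_shrinkerLSI.isFiniteMeasureOnCompacts_riemVolume hg
  haveI := sigmaFinite_riemVolume hg
  rw [← Measure.restrict_univ (μ := g.riemVolume), ← Measure.prod_restrict, Measure.restrict_univ]
  have h := hfin.mul_prod (integrable_const (1 : ℝ) :
    Integrable (fun _ : ℝ ↦ (1 : ℝ)) ((volume : Measure ℝ).restrict (Ioo 0 T)))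
  simpa using h

/-- **Lipschitz bound at the initial time**: for a solution `ρ` of `∂ₛρ = Lρ` on `[0, T]` in the
energy class with bounded `ρ(0) − c` and `|Lρ(0)| ≤ C_L`, `|ρ(s) − ρ(0)| ≤ C_L s` on `[0, T]`:
`±(ρ − ρ(0)) − C_L s` are subsolutions vanishing at `s = 0` (`L` is linear and kills constants),
so the weak maximum principle for subsolutions (`helper_weightedMaxPrinciple`) applies.
[cite: Grigoryan2009, §11.4 and §12.1] -/
theorem heatFlow_sub_datum_abs_le (hg : g.IsRiemannian) {V : M → ℝ}
    (hV : ContMDiff (𝓡 n) 𝓘(ℝ, ℝ) ∞ V) (hfin : Integrable (fun x ↦ Real.exp (-V x)) g.riemVolume)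
    {η : ℕ → M → ℝ} {C : ℝ} (hηs : ∀ k, ContMDiff (𝓡 n) 𝓘(ℝ, ℝ) ∞ (η k))
    (hηc : ∀ k, HasCompactSupport (η k)) (hη01 : ∀ k x, 0 ≤ η k x ∧ η k x ≤ 1)
    (hηmono : ∀ k x, η k x ≤ η (k + 1) x) (hη1 : ∀ x, ∀ᶠ k in atTop, ∀ᶠ y in 𝓝 x, η k y = 1)
    (hηL : ∀ k x, |g.dalembertian (η k) x - g.innerDual x (mvfderiv (𝓡 n) V x).toLinearMap
      (mvfderiv (𝓡 n) (η k) x).toLinearMap| ≤ C)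
    {T : ℝ} {O : Set ℝ} {ρ : ℝ → M → ℝ} (hT : 0 < T) (hO : IsOpen O) (hTO : Icc 0 T ⊆ O)
    (hρ : ContMDiffOn ((𝓡 n).prod 𝓘(ℝ, ℝ)) 𝓘(ℝ, ℝ) ∞ (fun p : M × ℝ ↦ ρ p.2 p.1) (univ ×ˢ O))
    (heq : ∀ s ∈ Icc 0 T, ∀ x, deriv (fun r ↦ ρ r x) s = g.dalembertian (ρ s) x
      - g.innerDual x (mvfderiv (𝓡 n) V x).toLinearMap (mvfderiv (𝓡 n) (ρ s) x).toLinearMap)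
    {c B CL : ℝ} (hB : ∀ x, |ρ 0 x - c| ≤ B)
    (hCL : ∀ x, |g.dalembertian (ρ 0) x - g.innerDual x (mvfderiv (𝓡 n) V x).toLinearMap
      (mvfderiv (𝓡 n) (ρ 0) x).toLinearMap| ≤ CL)
    (hint : Integrable (fun p : M × ℝ ↦ (ρ p.2 p.1 - c) ^ 2 * Real.exp (-V p.1))
      ((g.riemVolume.prod (volume : Measure ℝ)).restrict (univ ×ˢ Ioo 0 T))) :
    ∀ s ∈ Icc 0 T, ∀ x, |ρ s x - ρ 0 x| ≤ CL * s := by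
  intro s hs x
  have h2 : (2 : ℕ∞ω) ≤ (∞ : ℕ∞ω) := WithTop.coe_le_coe.mpr le_top
  have hexpc : Continuous fun y ↦ Real.exp (-V y) := Real.continuous_exp.comp hV.continuous.neg
  have hmeasS : MeasurableSet ((univ : Set M) ×ˢ Ioo (0 : ℝ) T) :=
    MeasurableSet.univ.prod measurableSet_Ioo
  have h0O : (0 : ℝ) ∈ O := hTO ⟨le_rfl, hT.le⟩
  have hρ0s : ContMDiff (𝓡 n) 𝓘(ℝ, ℝ) ∞ (ρ 0) := contMDiff_slice_of_contMDiffOn hρ h0O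
  have hρs : ∀ r ∈ O, ContMDiff (𝓡 n) 𝓘(ℝ, ℝ) ∞ (ρ r) := fun r hr ↦ contMDiff_slice_of_contMDiffOn hρ hr
  have hCL0 : 0 ≤ CL := (abs_nonneg _).trans (hCL x)
  have hB0 : 0 ≤ B := (abs_nonneg _).trans (hB x)
  have hbound : Integrable (fun p : M × ℝ ↦ (ρ p.2 p.1 - c) ^ 2 * Real.exp (-V p.1) +
      (1 + B) * Real.exp (-V p.1)) ((g.riemVolume.prod (volume : Measure ℝ)).restrict (univ ×ˢ Ioo 0 T)) :=
    hint.add ((integrable_exp_neg_strip hg hfin T).const_mul (1 + B))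
  have key : ∀ σ : ℝ, |σ| = 1 → σ * (ρ s x - ρ 0 x) - CL * s ≤ 0 := by
    intro σ hσ
    set z : ℝ → M → ℝ := fun r y ↦ σ * (ρ r y - ρ 0 y) - CL * r with hzdef
    have hzs : ContMDiffOn ((𝓡 n).prod 𝓘(ℝ, ℝ)) 𝓘(ℝ, ℝ) ∞ (fun p : M × ℝ ↦ z p.2 p.1) (univ ×ˢ O) :=
      (contMDiffOn_const.mul (hρ.sub (hρ0s.comp contMDiff_fst).contMDiffOn)).sub
        (contMDiffOn_const.mul contMDiff_snd.contMDiffOn)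
    have hsub : ∀ r ∈ Icc 0 T, ∀ y, deriv (fun r' ↦ z r' y) r ≤ g.dalembertian (z r) y -
        g.innerDual y (mvfderiv (𝓡 n) V y).toLinearMap (mvfderiv (𝓡 n) (z r) y).toLinearMap := by
      intro r hr y
      have hrO := hTO hr
      have hd : HasDerivAt (fun r' ↦ z r' y) (σ * deriv (fun r' ↦ ρ r' y) r - CL * 1) r :=
        (((CutoffToolkit.hasDerivAt_time hO hρ y hrO).sub_const (ρ 0 y)).const_mul σ).sub
          ((hasDerivAt_id r).const_mul CL)
      have hρ2 : ContMDiffAt (𝓡 n) 𝓘(ℝ, ℝ) 2 (ρ r) y := ((hρs r hrO).of_le h2).contMDiffAt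
      have hρ02 : ContMDiffAt (𝓡 n) 𝓘(ℝ, ℝ) 2 (ρ 0) y := (hρ0s.of_le h2).contMDiffAt
      have hu2 : ContMDiffAt (𝓡 n) 𝓘(ℝ, ℝ) 2 (fun y' ↦ σ * ρ r y' + -(CL * r)) y :=
        (contMDiffAt_const.mul hρ2).add contMDiffAt_const
      have hzr : z r = fun y' ↦ (σ * ρ r y' + -(CL * r)) + (-σ) * ρ 0 y' :=
        funext fun y' ↦ by simp only [hzdef]; ring
      rw [hd.deriv, hzr, weightedLaplacian_add_const_mul hu2 hρ02, weightedLaplacian_affine hρ2,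
        heq r hr y]
      have h1 : σ * (g.dalembertian (ρ 0) y - g.innerDual y (mvfderiv (𝓡 n) V y).toLinearMap
          (mvfderiv (𝓡 n) (ρ 0) y).toLinearMap) ≤ CL := by
        refine (le_abs_self _).trans ?_
        rw [abs_mul, hσ, one_mul]
        exact hCL y
      linarith
    have hz0 : ∀ y, z 0 y ≤ 0 := fun y ↦ by simp [hzdef]
    have hint' : Integrable (fun p : M × ℝ ↦ max (z p.2 p.1) 0 * Real.exp (-V p.1))
        ((g.riemVolume.prod (volume : Measure ℝ)).restrict (univ ×ˢ Ioo 0 T)) := by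
      refine hbound.mono' ?_ ?_
      · have hcont : ContinuousOn (fun p : M × ℝ ↦ max (z p.2 p.1) 0 * Real.exp (-V p.1))
            (univ ×ˢ O) :=
          (hzs.continuousOn.sup continuousOn_const).mul (hexpc.comp continuous_fst).continuousOn
        exact (hcont.mono (Set.prod_mono le_rfl (Ioo_subset_Icc_self.trans hTO))).aestronglyMeasurable
          hmeasS
      · rw [ae_restrict_iff' hmeasS]
        refine Eventually.of_forall fun p hp ↦ ?_
        obtain ⟨-, hr⟩ := hp
        have hex := Real.exp_pos (-V p.1)
        have h1 : max (z p.2 p.1) 0 ≤ |ρ p.2 p.1 - c| + B := by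
          refine max_le ?_ (add_nonneg (abs_nonneg _) hB0)
          simp only [hzdef]
          have h3 : σ * (ρ p.2 p.1 - ρ 0 p.1) ≤ |ρ p.2 p.1 - ρ 0 p.1| := by
            refine (le_abs_self _).trans ?_
            rw [abs_mul, hσ, one_mul]
          have h4 : |ρ p.2 p.1 - ρ 0 p.1| ≤ |ρ p.2 p.1 - c| + |ρ 0 p.1 - c| := by
            rw [show ρ p.2 p.1 - ρ 0 p.1 = (ρ p.2 p.1 - c) - (ρ 0 p.1 - c) by ring]
            exact abs_sub _ _
          nlinarith [hB p.1, hr.1]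
        have h2' : |ρ p.2 p.1 - c| ≤ (ρ p.2 p.1 - c) ^ 2 + 1 := by
          nlinarith [abs_nonneg (ρ p.2 p.1 - c), sq_abs (ρ p.2 p.1 - c)]
        rw [Real.norm_eq_abs, abs_of_nonneg (mul_nonneg (le_max_right _ _) hex.le)]
        nlinarith [le_max_right (z p.2 p.1) 0]
    exact helper_weightedMaxPrinciple n M g V hg hV η C hηs hηc hη01 hηmono hη1 hηL T O z hT hO hTO
      hzs hsub hz0 hint' s hs x
  have h1 := key 1 (by simp)
  have h2' := key (-1) (by simp)
  rw [abs_le]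
  constructor <;> linarith

omit [T2Space M] [g.HasLeviCivita] in
/-- **Time shifts stay in the energy class**: if `(ρ − c)² e^{-V}` is integrable on the strip
`M × (0, T)` then `(ρ(· + h) − c)² e^{-V}` is integrable on `M × (0, T − h)` for `0 ≤ h`
(translation invariance of Lebesgue measure). [cite: Grigoryan2009, §11.4 and §12.1] -/
theorem integrable_strip_shift (hg : g.IsRiemannian) {F : M × ℝ → ℝ} {T h : ℝ} (hh : 0 ≤ h)
    (hF : Integrable F ((g.riemVolume.prod (volume : Measure ℝ)).restrict (univ ×ˢ Ioo 0 T))) :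
    Integrable (fun p : M × ℝ ↦ F (p.1, p.2 + h))
      ((g.riemVolume.prod (volume : Measure ℝ)).restrict (univ ×ˢ Ioo 0 (T - h))) := by
  haveI := CarrilloNi2009_shrinkerLSI.isFiniteMeasureOnCompacts_riemVolume hg
  haveI := sigmaFinite_riemVolume hg
  have hΦ : MeasurePreserving (Prod.map (id : M → M) (fun s : ℝ ↦ s + h))
      (g.riemVolume.prod (volume : Measure ℝ)) (g.riemVolume.prod (volume : Measure ℝ)) :=
    (MeasurePreserving.id g.riemVolume).prod (measurePreserving_add_right (volume : Measure ℝ) h)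
  have hpre : (Prod.map (id : M → M) (fun s : ℝ ↦ s + h)) ⁻¹' ((univ : Set M) ×ˢ Ioo h T) =
      (univ : Set M) ×ˢ Ioo 0 (T - h) := by
    ext ⟨y, r⟩
    simp only [mem_preimage, Prod.map_apply, mem_prod, mem_univ, true_and, mem_Ioo]
    constructor
    · rintro ⟨h1, h2⟩; exact ⟨by linarith, by linarith⟩
    · rintro ⟨h1, h2⟩; exact ⟨by linarith, by linarith⟩
  have hres := hΦ.restrict_preimage (MeasurableSet.univ.prod (measurableSet_Ioo (a := h) (b := T)))
  rw [hpre] at hres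
  have hF' : Integrable F ((g.riemVolume.prod (volume : Measure ℝ)).restrict (univ ×ˢ Ioo h T)) :=
    hF.mono_measure (Measure.restrict_mono (Set.prod_mono le_rfl (Ioo_subset_Ioo_left hh)) le_rfl)
  exact hres.integrable_comp_of_integrable hF'

/-- **Bounded `Lρ` along the energy-class heat flow**: for a solution `ρ` of `∂ₛρ = Lρ` on
`[0, T]` in the energy class with bounded `ρ(0) − c` and `|Lρ(0)| ≤ C_L`, `|Lρ(s)| ≤ C_L` for
`s ∈ [0, T)`. The difference quotients `(ρ(s + h) − ρ(s))/h` solve the same linear equation in the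
energy class and start below `C_L` in absolute value (`heatFlow_sub_datum_abs_le`), so they stay
below `C_L` (`helper_twoSidedBound`); let `h → 0⁺` (`Lρ = ∂ₛρ`).
[cite: Grigoryan2009, §11.4 and §12.1] -/
theorem heatFlow_weightedLaplacian_abs_le (hg : g.IsRiemannian) {V : M → ℝ}
    (hV : ContMDiff (𝓡 n) 𝓘(ℝ, ℝ) ∞ V) (hfin : Integrable (fun x ↦ Real.exp (-V x)) g.riemVolume)
    {η : ℕ → M → ℝ} {C : ℝ} (hηs : ∀ k, ContMDiff (𝓡 n) 𝓘(ℝ, ℝ) ∞ (η k))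
    (hηc : ∀ k, HasCompactSupport (η k)) (hη01 : ∀ k x, 0 ≤ η k x ∧ η k x ≤ 1)
    (hηmono : ∀ k x, η k x ≤ η (k + 1) x) (hη1 : ∀ x, ∀ᶠ k in atTop, ∀ᶠ y in 𝓝 x, η k y = 1)
    (hηL : ∀ k x, |g.dalembertian (η k) x - g.innerDual x (mvfderiv (𝓡 n) V x).toLinearMap
      (mvfderiv (𝓡 n) (η k) x).toLinearMap| ≤ C)
    {T : ℝ} {O : Set ℝ} {ρ : ℝ → M → ℝ} (hT : 0 < T) (hO : IsOpen O) (hTO : Icc 0 T ⊆ O)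
    (hρ : ContMDiffOn ((𝓡 n).prod 𝓘(ℝ, ℝ)) 𝓘(ℝ, ℝ) ∞ (fun p : M × ℝ ↦ ρ p.2 p.1) (univ ×ˢ O))
    (heq : ∀ s ∈ Icc 0 T, ∀ x, deriv (fun r ↦ ρ r x) s = g.dalembertian (ρ s) x
      - g.innerDual x (mvfderiv (𝓡 n) V x).toLinearMap (mvfderiv (𝓡 n) (ρ s) x).toLinearMap)
    {c B CL : ℝ} (hB : ∀ x, |ρ 0 x - c| ≤ B)
    (hCL : ∀ x, |g.dalembertian (ρ 0) x - g.innerDual x (mvfderiv (𝓡 n) V x).toLinearMap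
      (mvfderiv (𝓡 n) (ρ 0) x).toLinearMap| ≤ CL)
    (hint : Integrable (fun p : M × ℝ ↦ (ρ p.2 p.1 - c) ^ 2 * Real.exp (-V p.1))
      ((g.riemVolume.prod (volume : Measure ℝ)).restrict (univ ×ˢ Ioo 0 T))) :
    ∀ s ∈ Ico 0 T, ∀ x, |g.dalembertian (ρ s) x - g.innerDual x (mvfderiv (𝓡 n) V x).toLinearMap
      (mvfderiv (𝓡 n) (ρ s) x).toLinearMap| ≤ CL := by
  intro s hs x
  have h2 : (2 : ℕ∞ω) ≤ (∞ : ℕ∞ω) := WithTop.coe_le_coe.mpr le_top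
  have hexpc : Continuous fun y ↦ Real.exp (-V y) := Real.continuous_exp.comp hV.continuous.neg
  have hρs : ∀ r ∈ O, ContMDiff (𝓡 n) 𝓘(ℝ, ℝ) ∞ (ρ r) := fun r hr ↦ contMDiff_slice_of_contMDiffOn hρ hr
  have hlip := heatFlow_sub_datum_abs_le hg hV hfin hηs hηc hη01 hηmono hη1 hηL hT hO hTO hρ heq hB
    hCL hint
  -- the difference quotients are bounded by `C_L`
  have hquot : ∀ h : ℝ, 0 < h → h < T - s → |ρ (s + h) x - ρ s x| ≤ CL * h := by
    intro h hh hhT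
    set O' : Set ℝ := O ∩ (fun r ↦ r + h) ⁻¹' O with hO'def
    have hO' : IsOpen O' := hO.inter (hO.preimage (continuous_id.add continuous_const))
    have hTO' : Icc 0 (T - h) ⊆ O' := fun r hr ↦
      ⟨hTO ⟨hr.1, by linarith [hr.2]⟩, hTO ⟨by linarith [hr.1], by linarith [hr.2]⟩⟩
    set w : ℝ → M → ℝ := fun r y ↦ ρ (r + h) y + (-1) * ρ r y with hwdef
    have hsh : ContMDiffOn ((𝓡 n).prod 𝓘(ℝ, ℝ)) 𝓘(ℝ, ℝ) ∞ (fun p : M × ℝ ↦ ρ (p.2 + h) p.1)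
        (univ ×ˢ O') := by
      have hmap : ContMDiff ((𝓡 n).prod 𝓘(ℝ, ℝ)) ((𝓡 n).prod 𝓘(ℝ, ℝ)) ∞
          (fun p : M × ℝ ↦ (p.1, p.2 + h)) :=
        contMDiff_fst.prodMk (contMDiff_snd.add contMDiff_const)
      exact hρ.comp hmap.contMDiffOn fun p hp ↦ ⟨mem_univ _, hp.2.2⟩
    have hws : ContMDiffOn ((𝓡 n).prod 𝓘(ℝ, ℝ)) 𝓘(ℝ, ℝ) ∞ (fun p : M × ℝ ↦ w p.2 p.1)
        (univ ×ˢ O') :=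
      hsh.add (contMDiffOn_const.mul (hρ.mono (Set.prod_mono le_rfl inter_subset_left)))
    have heqw : ∀ r ∈ Icc 0 (T - h), ∀ y, deriv (fun r' ↦ w r' y) r = g.dalembertian (w r) y -
        g.innerDual y (mvfderiv (𝓡 n) V y).toLinearMap (mvfderiv (𝓡 n) (w r) y).toLinearMap := by
      intro r hr y
      have hr' : r ∈ Icc 0 T := ⟨hr.1, by linarith [hr.2]⟩
      have hrh : r + h ∈ Icc 0 T := ⟨by linarith [hr.1], by linarith [hr.2]⟩
      have hd : HasDerivAt (fun r' ↦ w r' y)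
          (deriv (fun r' ↦ ρ r' y) (r + h) + (-1) * deriv (fun r' ↦ ρ r' y) r) r :=
        (HasDerivAt.comp_add_const r h (CutoffToolkit.hasDerivAt_time hO hρ y (hTO hrh))).add
          ((CutoffToolkit.hasDerivAt_time hO hρ y (hTO hr')).const_mul (-1))
      rw [hd.deriv, heq (r + h) hrh y, heq r hr' y,
        show w r = fun y' ↦ ρ (r + h) y' + (-1) * ρ r y' from rfl,
        weightedLaplacian_add_const_mul (((hρs _ (hTO hrh)).of_le h2).contMDiffAt)
          (((hρs _ (hTO hr')).of_le h2).contMDiffAt)]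
    have hw0 : ∀ y, -(CL * h) ≤ w 0 y ∧ w 0 y ≤ CL * h := fun y ↦ by
      have h1 := hlip h ⟨hh.le, by linarith [hs.1]⟩ y
      simp only [hwdef, zero_add]
      rw [abs_le] at h1
      constructor <;> linarith [h1.1, h1.2]
    have hintw : Integrable (fun p : M × ℝ ↦ (w p.2 p.1 - 0) ^ 2 * Real.exp (-V p.1))
        ((g.riemVolume.prod (volume : Measure ℝ)).restrict (univ ×ˢ Ioo 0 (T - h))) := by
      have hA := integrable_strip_shift hg hh.le hint
      have hB' : Integrable (fun p : M × ℝ ↦ (ρ p.2 p.1 - c) ^ 2 * Real.exp (-V p.1))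
          ((g.riemVolume.prod (volume : Measure ℝ)).restrict (univ ×ˢ Ioo 0 (T - h))) :=
        hint.mono_measure (Measure.restrict_mono (Set.prod_mono le_rfl
          (Ioo_subset_Ioo_right (by linarith))) le_rfl)
      have hbound : Integrable (fun p : M × ℝ ↦ 2 * ((ρ (p.2 + h) p.1 - c) ^ 2 * Real.exp (-V p.1)
          + (ρ p.2 p.1 - c) ^ 2 * Real.exp (-V p.1)))
          ((g.riemVolume.prod (volume : Measure ℝ)).restrict (univ ×ˢ Ioo 0 (T - h))) :=
        (hA.add hB').const_mul 2
      refine hbound.mono' ?_ (ae_of_all _ fun p ↦ ?_)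
      · have hcont : ContinuousOn (fun p : M × ℝ ↦ (w p.2 p.1 - 0) ^ 2 * Real.exp (-V p.1))
            (univ ×ˢ O') :=
          ((hws.continuousOn.sub continuousOn_const).pow 2).mul
            (hexpc.comp continuous_fst).continuousOn
        exact (hcont.mono (Set.prod_mono le_rfl (Ioo_subset_Icc_self.trans hTO'))).aestronglyMeasurable
          (MeasurableSet.univ.prod measurableSet_Ioo)
      · have hex := Real.exp_pos (-V p.1)
        rw [Real.norm_eq_abs, abs_of_nonneg (mul_nonneg (sq_nonneg _) hex.le)]
        simp only [hwdef]
        have : (ρ (p.2 + h) p.1 + (-1) * ρ p.2 p.1 - 0) ^ 2 ≤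
            2 * ((ρ (p.2 + h) p.1 - c) ^ 2 + (ρ p.2 p.1 - c) ^ 2) := by
          nlinarith [sq_nonneg (ρ (p.2 + h) p.1 + ρ p.2 p.1 - 2 * c)]
        nlinarith
    have hCL0 : 0 ≤ CL := (abs_nonneg _).trans (hCL x)
    have hb := helper_twoSidedBound n M g V hg hV hfin η C hηs hηc hη01 hηmono hη1 hηL (T - h) O' w
      (by linarith [hs.1]) hO' hTO' hws heqw 0 (-(CL * h)) (CL * h)
      (neg_nonpos.2 (mul_nonneg hCL0 hh.le)) (mul_nonneg hCL0 hh.le) hw0 hintw s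
      ⟨hs.1, by linarith⟩ x
    simp only [hwdef] at hb
    rw [abs_le]
    constructor <;> linarith [hb.1, hb.2]
  -- pass to the limit `h → 0⁺`
  have hsT : s ∈ Icc 0 T := ⟨hs.1, hs.2.le⟩
  have hd : HasDerivAt (fun r ↦ ρ r x) (deriv (fun r ↦ ρ r x) s) s := CutoffToolkit.hasDerivAt_time hO hρ x (hTO hsT)
  have hlim : Tendsto (fun t ↦ |t⁻¹ • (ρ (s + t) x - ρ s x)|) (𝓝[>] 0)
      (𝓝 |deriv (fun r ↦ ρ r x) s|) :=
    (continuous_abs.tendsto _).comp hd.tendsto_slope_zero_right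
  have hev : ∀ᶠ t in 𝓝[>] (0 : ℝ), |t⁻¹ • (ρ (s + t) x - ρ s x)| ≤ CL := by
    filter_upwards [Ioo_mem_nhdsGT (show (0 : ℝ) < T - s by linarith [hs.2])] with t ht
    rw [smul_eq_mul, abs_mul, abs_inv, abs_of_pos ht.1]
    calc t⁻¹ * |ρ (s + t) x - ρ s x| ≤ t⁻¹ * (CL * t) :=
          mul_le_mul_of_nonneg_left (hquot t ht.1 ht.2) (inv_nonneg.2 ht.1.le)
      _ = CL := by rw [mul_comm CL t, ← mul_assoc, inv_mul_cancel₀ ht.1.ne', one_mul]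
  have hfin' := le_of_tendsto hlim hev
  rwa [heq s hsT x] at hfin'

end Weighted

/-! ### Packaged forms -/

end Literature.Geometry.Riemannian.NoncompactShrinkerGapLiWang

end Part4

/-!
## Part 5 — port of `Summits/SmoothPoincare4/SmoothPoincare4/Theorems/EntropyRungNoncompactShrinkerGapStubCompactSupportLSIMixture.lean` (1 declarations kept)

# Mixture toolkit for the compact-support logarithmic Sobolev inequality (U1)

Fact-free lemmas consumed by `EntropyRungNoncompactShrinkerGapStubCompactSupportLSI.lean`
(Carrillo–Ni's logarithmic Sobolev inequality for compactly supported test functions on a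
complete gradient shrinker, Haslhofer–Müller 2011 (2.15)–(2.16), proved there by MIXTURES
`u_δ = (1−δ) w²/Z + δ e^{-f}/∫e^{-f}` of the test density with the Gaussian density of the soliton):
* `innerDual_self_nonneg`, `innerDual_mixture_le`, `gradSq_mixture_mul_le` — `g⁻¹ ≥ 0` for a
  Riemannian `g` and the perspective (joint convexity) inequality for the Fisher-information term
  of a mixture, `|∇(αw² + b)|²/(αw² + b) ≤ 4α|∇w|² + |∇b|²/b` with `b = β e^{-f}`, valid across
  the zero set of `w`;
* `negMulLog_add_le` — subadditivity `−(a+b) log (a+b) ≤ −a log a − b log b` (mixing entropy);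
* `isCompact_sublevel_of_growth`, `toReal_edist_sq_le` — properness of a potential with the
  quadratic lower growth `¼(d − K)₊² ≤ f` of Haslhofer–Müller's Lemma 2.1 when closed balls are
  compact, and the second-moment control `d(p, ·)² ≤ 8f + 2K²`;
* `mixture_entropy_le`, `mixture_integrand_le` — the pointwise bound of the `𝒲`-integrand of
  `ψ_δ = log A − log u_δ` by `(1−δ)/Z ·`(integrand of `w`) `+ δ/∫e^{-f} ·`(integrand of `f + c`)
  plus the mixing-entropy terms;
* `le_of_forall_mixture_bound` — `δ → 0`: `c ≤ (1−δ)F + δc + h(δ)` for all `δ ∈ (0,1)` gives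
  `c ≤ F` (`h(δ) = −(1−δ) log (1−δ) − δ log δ → 0`);
* `integrable_of_le_of_le` — integrability by sandwich.
Everything is proved; no definition, no named fact.
-/

section Part5

open scoped _root_.Manifold _root_.ContDiff _root_.ENNReal _root_.NNReal _root_.Topology
open _root_.MeasureTheory _root_.Set _root_.Filter
open Literature.Geometry.Lorentzian Literature.Geometry.Riemannian

namespace Literature.Geometry.Riemannian.NoncompactShrinkerGapCompactSupportLSI

/-! ## Pointwise algebra of the inverse metric -/

section Pointwise

variable {E : Type*} [NormedAddCommGroup E] [NormedSpace ℝ E] {H : Type*} [TopologicalSpace H]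
  {I : ModelWithCorners ℝ E H} {M : Type*} [TopologicalSpace M] [ChartedSpace H M]
  [IsManifold I ∞ M] {n : ℕ∞ω} [FiniteDimensional ℝ E]
  (g : PseudoRiemannianMetric I n E (TangentSpace I : M → Type _))

end Pointwise

section Growth

variable {E : Type*} [NormedAddCommGroup E] [NormedSpace ℝ E] [FiniteDimensional ℝ E]
  {H : Type*} [TopologicalSpace H] {I : ModelWithCorners ℝ E H} {M : Type*} [TopologicalSpace M]
  [ChartedSpace H M] [IsManifold I ∞ M]
  {g : PseudoRiemannianMetric I ∞ E (TangentSpace I : M → Type _)}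

/-- **A potential with quadratic lower growth is proper** when closed `g`-balls are compact:
`¼(r − K)₊² ≤ f(x)` whenever `r ≤ d(p, x)` forces `{f ≤ R} ⊆ {d(p, ·) ≤ 2√(R₊ + 1) + K₊}`.
[cite: CarrilloNi2009, Thm. 1.1 (i) and §4 (proper potential: compact sublevel sets)] -/
theorem isCompact_sublevel_of_growth (hg : g.IsRiemannian) {f : M → ℝ} (hf : Continuous f)
    (hc : ∀ (x : M) (r : NNReal), IsCompact {y : M | g.edist hg x y ≤ r}) {p : M} {K : ℝ}
    (hlow : ∀ (x : M) (r : NNReal), (r : ℝ≥0∞) ≤ g.edist hg p x →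
      (1 / 4 : ℝ) * (max ((r : ℝ) - K) 0) ^ 2 ≤ f x)
    (R : ℝ) : IsCompact {x | f x ≤ R} := by
  set R' : ℝ := max R 0 with hR'
  have hR'0 : 0 ≤ R' := le_max_right _ _
  have hRR' : R ≤ R' := le_max_left _ _
  set r₀ : NNReal := ⟨2 * Real.sqrt (R' + 1) + max K 0, by positivity⟩ with hr₀
  have hr₀v : (r₀ : ℝ) = 2 * Real.sqrt (R' + 1) + max K 0 := rfl
  refine (hc p r₀).of_isClosed_subset (isClosed_le hf continuous_const) fun x hx ↦ ?_
  by_contra hxr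
  have hle : (r₀ : ℝ≥0∞) ≤ g.edist hg p x := (lt_of_not_ge hxr).le
  have hfx := hlow x r₀ hle
  have hr₀K : 2 * Real.sqrt (R' + 1) ≤ max ((r₀ : ℝ) - K) 0 := by
    refine le_max_of_le_left ?_
    rw [hr₀v]
    linarith [le_max_left K 0]
  have hsq : (2 * Real.sqrt (R' + 1)) ^ 2 ≤ (max ((r₀ : ℝ) - K) 0) ^ 2 :=
    pow_le_pow_left₀ (by positivity) hr₀K 2
  have h4 : (2 * Real.sqrt (R' + 1)) ^ 2 = 4 * (R' + 1) := by
    rw [mul_pow, Real.sq_sqrt (by positivity)]; ring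
  have : f x ≤ R := hx
  linarith

end Growth

/-! ## Real-variable lemmas for the mixture -/

end Literature.Geometry.Riemannian.NoncompactShrinkerGapCompactSupportLSI

end Part5

/-!
## Part 6 — port of `Summits/SmoothPoincare4/SmoothPoincare4/Theorems/EntropyRungNoncompactShrinkerGapHeatShrinkerCutoff.lean` (2 declarations kept)

# H¹ cut-offs on a complete gradient shrinker

Helper `helper_shrinkerCutoff` of the heat-flow proof of the compact-support logarithmic Sobolev
inequality on a complete connected normalised gradient shrinking Ricci soliton `(M, g, f)`
(`Ric + Hess f = ½ g`, `R + |∇f|² = f`, closed `g`-balls compact): there are cut-off functions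
`η_k = ψ(f/(k+1))` (`ψ` a smooth antitone profile, `ψ = 1` on `(−∞, 1]`, `ψ = 0` on `[2, ∞)`) and a
constant `C` with `η_k` smooth, compactly supported, `0 ≤ η_k ≤ η_{k+1} ≤ 1`, `η_k = 1` near every
point of `{f < k+1}`, `|∇η_k|² ≤ C/(k+1)`, `|Δη_k| ≤ C`, `|⟨∇f, ∇η_k⟩| ≤ C`.

The mathematics (folklore; the cut-off argument of Carrillo–Ni 2009, §4, on the complete soliton):
`R ≥ 0` (Zhang 2009 / Chen 2009, the tree's `Zhang2009.minimumPrinciple_core` +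
`directionalComparison_core`), hence `0 ≤ |∇f|² ≤ f` and `f` is proper (Haslhofer–Müller 2011,
Lemma 2.1: a minimum point and the lower growth `¼(r − 5n)₊² ≤ f`); `Δf = n/2 − R`, so
`|Δf| ≤ n/2 + f`. By the chain rules `dη_k = ψ'(f/(k+1)) df/(k+1)` and
`Δη_k = ψ''(f/(k+1)) |∇f|²/(k+1)² + ψ'(f/(k+1)) Δf/(k+1)`, and since `ψ'`, `ψ''` are bounded and
vanish where `f > 2(k+1)`, on the support `|∇f|² ≤ f ≤ 2(k+1)` gives the three bounds with
`C = 2C₁² + 2C₁ + C₁ n/2 + 2C₂`.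
-/

section Part6

open scoped _root_.Manifold _root_.ContDiff _root_.ENNReal _root_.NNReal _root_.Topology
open _root_.MeasureTheory _root_.Set _root_.Filter
open Literature.Geometry.Lorentzian Literature.Geometry.Riemannian

namespace Literature.Geometry.Riemannian.NoncompactShrinkerGapHeat

open Literature.Geometry.Riemannian.NoncompactShrinkerGapCompactSupportLSI

/-- A smooth antitone cut-off profile `ψ : ℝ → ℝ` (`ψ = 1` on `(−∞, 1]`, `ψ = 0` on `[2, ∞)`,
`0 ≤ ψ ≤ 1`) together with the facts used by the cut-off argument: `ψ'` and `ψ''` vanish on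
`(2, ∞)` and are bounded (they are continuous with compact support in `[1, 2]`). [cite: HaslhoferMuller2011, Lemma 2.1 (p. 5)] -/
theorem exists_cutoffProfile_deriv_bounds :
    ∃ ψ : ℝ → ℝ, ContDiff ℝ ∞ ψ ∧ (∀ t ≤ 1, ψ t = 1) ∧ (∀ t, 2 ≤ t → ψ t = 0) ∧
      (∀ t, 0 ≤ ψ t ∧ ψ t ≤ 1) ∧ Antitone ψ ∧ (∀ t, 2 < t → deriv ψ t = 0) ∧
      (∀ t, 2 < t → deriv (deriv ψ) t = 0) ∧
      ∃ C₁ C₂ : ℝ, 0 ≤ C₁ ∧ 0 ≤ C₂ ∧ (∀ t, |deriv ψ t| ≤ C₁) ∧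
        ∀ t, |deriv (deriv ψ) t| ≤ C₂ := by
  obtain ⟨ψ, hψs, hψ1, hψ0, hψ01, hanti⟩ := CarrilloNi2009_shrinkerLSI.exists_antitone_cutoffProfile
  have hd1 : ContDiff ℝ ∞ (deriv ψ) := (contDiff_infty_iff_deriv.mp hψs).2
  have hd1c : Continuous (deriv ψ) := hd1.continuous
  have hd2c : Continuous (deriv (deriv ψ)) := hd1.continuous_deriv ENat.LEInfty.out
  -- `ψ' = 0` off `[1, 2]`
  have hlow : ∀ t < 1, deriv ψ t = 0 := fun t ht ↦ by
    have hev : ψ =ᶠ[𝓝 t] fun _ ↦ (1 : ℝ) := by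
      filter_upwards [Iio_mem_nhds ht] with s hs
      exact hψ1 s (le_of_lt hs)
    rw [hev.deriv_eq, deriv_const]
  have hhigh : ∀ t, 2 < t → deriv ψ t = 0 := fun t ht ↦ by
    have hev : ψ =ᶠ[𝓝 t] fun _ ↦ (0 : ℝ) := by
      filter_upwards [Ioi_mem_nhds ht] with s hs
      exact hψ0 s (le_of_lt hs)
    rw [hev.deriv_eq, deriv_const]
  have hhigh2 : ∀ t, 2 < t → deriv (deriv ψ) t = 0 := fun t ht ↦ by
    have hev : deriv ψ =ᶠ[𝓝 t] fun _ ↦ (0 : ℝ) := by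
      filter_upwards [Ioi_mem_nhds ht] with s hs
      exact hhigh s hs
    rw [hev.deriv_eq, deriv_const]
  have hsupp : HasCompactSupport (deriv ψ) := by
    refine HasCompactSupport.intro (K := Icc (1 : ℝ) 2) isCompact_Icc fun t ht ↦ ?_
    rw [mem_Icc, not_and_or, not_le, not_le] at ht
    rcases ht with ht | ht
    · exact hlow t ht
    · exact hhigh t ht
  have hsupp2 : HasCompactSupport (deriv (deriv ψ)) := hsupp.deriv
  obtain ⟨C₁, hC₁⟩ := hd1c.bounded_above_of_compact_support hsupp
  obtain ⟨C₂, hC₂⟩ := hd2c.bounded_above_of_compact_support hsupp2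
  refine ⟨ψ, hψs, hψ1, hψ0, hψ01, hanti, hhigh, hhigh2, C₁, C₂, (norm_nonneg _).trans (hC₁ 0),
    (norm_nonneg _).trans (hC₂ 0), fun t ↦ ?_, fun t ↦ ?_⟩
  · simpa [Real.norm_eq_abs] using hC₁ t
  · simpa [Real.norm_eq_abs] using hC₂ t

/-- **H¹ cut-offs on a complete gradient shrinker** (the cut-off family of the exhaustion argument
of Carrillo–Ni 2009, §4, with the potential `f` as exhaustion function — proper by Haslhofer–Müller
2011, Lemma 2.1, once `R ≥ 0`, Zhang 2009). On a complete connected normalised gradient shrinker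
`(M, g, f)` there are `η : ℕ → M → ℝ` and `C` with: every `η k` smooth, compactly supported,
`0 ≤ η k ≤ η (k+1) ≤ 1`, `η k = 1` near every point of `{f < k+1}`, `|∇η_k|² ≤ C/(k+1)`,
`|Δη_k| ≤ C`, `|g⁻¹(df, dη_k)| ≤ C`. Take `η k = ψ (f/(k+1))` for a smooth antitone profile `ψ`
(`= 1` on `(−∞,1]`, `= 0` on `[2,∞)`); the bounds follow from the chain rules for `d`, `|∇·|²`
and `Δ` of a composite, `|∇f|² ≤ f ≤ 2(k+1)` on the support of `ψ'(f/(k+1))`, and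
`|Δf| = |n/2 − R| ≤ n/2 + f`. [cite: CarrilloNi2009, §4 (integration by parts on the complete soliton)]
[cite: HaslhoferMuller2011, Lemma 2.1 (p. 5)] [cite: Zhang2009, Thm. 1.3 (ii)] -/
theorem helper_shrinkerCutoff : ∀ (n : ℕ) (M : Type*) [TopologicalSpace M] [T2Space M] [SecondCountableTopology M] [ChartedSpace (EuclideanSpace ℝ (Fin n)) M] [IsManifold (𝓡 n) ∞ M] [ConnectedSpace M] [T3Space M] [MeasurableSpace M] [BorelSpace M] (g : PseudoRiemannianMetric (𝓡 n) ∞ (EuclideanSpace ℝ (Fin n)) (TangentSpace (𝓡 n) : M → Type _)) [g.HasLeviCivita] (f : M → ℝ) (hg : g.IsRiemannian), (∀ (x : M) (r : NNReal), IsCompact {y : M | g.edist hg x y ≤ r}) → ContMDiff (𝓡 n) 𝓘(ℝ, ℝ) ∞ f → (∀ (x : M) (X Y : TangentSpace (𝓡 n) x), g.ricci x X Y + g.hessian f x X Y = (1 / 2 : ℝ) * g.val x X Y) → (∀ x : M, g.scalarCurvature x + g.gradSq f x = f x) → ∃ (η : ℕ → M → ℝ) (C : ℝ), (∀ k, ContMDiff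 (𝓡 n) 𝓘(ℝ, ℝ) ∞ (η k)) ∧ (∀ k, HasCompactSupport (η k)) ∧ (∀ k x, 0 ≤ η k x ∧ η k x ≤ 1) ∧ (∀ k x, η k x ≤ η (k + 1) x) ∧ (∀ (k : ℕ) (x : M), f x < k + 1 → ∀ᶠ y in 𝓝 x, η k y = 1) ∧ (∀ k x, g.gradSq (η k) x ≤ C / (k + 1)) ∧ (∀ k x, |g.dalembertian (η k) x| ≤ C) ∧ (∀ k x, |g.innerDual x (mvfderiv (𝓡 n) f x).toLinearMap (mvfderiv (𝓡 n) (η k) x).toLinearMap| ≤ C) := by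
  intro n M _ _ _ _ _ _ _ _ _ g _ f hg hc hf hsol hnorm
  classical
  /- `R ≥ 0` (Zhang 2009), `0 ≤ |∇f|² ≤ f`, `|Δf| ≤ n/2 + f`, properness of `f` -/
  have hk1 : ((1 : ℕ∞) : ℕ∞ω) + 1 ≤ (∞ : ℕ∞ω) := by
    rw [show ((1 : ℕ∞) : ℕ∞ω) + 1 = 2 by norm_num]
    exact WithTop.coe_le_coe.2 le_top
  haveI : CovariantDerivative.ContMDiffCovariantDerivative g.leviCivita 1 :=
    ⟨g.isLocallyContMDiff_leviCivita_holds 1 hk1 univ isOpen_univ⟩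
  haveI : CovariantDerivative.ContMDiffCovariantDerivative g.leviCivita ∞ :=
    ⟨g.isLocallyContMDiff_leviCivita_holds ⊤ (le_of_eq rfl) univ isOpen_univ⟩
  have hS0 : ∀ x, 0 ≤ g.scalarCurvature x := fun x ↦
    Zhang2009.minimumPrinciple_core g hg hc hf hsol
      (fun p ↦ Zhang2009.directionalComparison_core g hg hc hf hsol p) x
  have hgrad : ∀ x, g.gradSq f x ≤ f x := fun x ↦ by linarith [hS0 x, hnorm x]
  have hG0 : ∀ x, 0 ≤ g.gradSq f x := fun x ↦ g.gradSq_nonneg hg f x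
  have hf0 : ∀ x, 0 ≤ f x := fun x ↦ (hG0 x).trans (hgrad x)
  have hΔf : ∀ x, |g.dalembertian f x| ≤ n / 2 + f x := fun x ↦ by
    have h1 := CarrilloNi2009_shrinkerLSI.scalarCurvature_add_dalembertian hsol x
    have hn0 : (0 : ℝ) ≤ n := Nat.cast_nonneg _
    rw [abs_le]
    constructor <;> linarith [hS0 x, hnorm x, hG0 x, hf0 x]
  obtain ⟨p, hp⟩ := HaslhoferMuller.exists_forall_potential_le g hg hc hf hgrad hsol
  have hlow : ∀ (x : M) (r : NNReal), (r : ℝ≥0∞) ≤ g.edist hg p x →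
      (1 / 4 : ℝ) * (max ((r : ℝ) - 5 * n) 0) ^ 2 ≤ f x := fun x r hr ↦ by
    have h := HaslhoferMuller.potential_lower_of_scalarCurvature_nonneg g hg hc hf hsol hnorm
      hS0 hp x r hr
    rwa [finrank_euclideanSpace_fin] at h
  have hprop : ∀ R : ℝ, IsCompact {x | f x ≤ R} :=
    isCompact_sublevel_of_growth hg hf.continuous hc hlow
  /- the profile `ψ`, the rescaled profiles `ζ k = ψ (· / (k+1))` and their derivatives -/
  obtain ⟨ψ, hψs, hψ1, hψ0, hψ01, hanti, hψd0, hψdd0, C₁, C₂, hC₁0, hC₂0, hC₁, hC₂⟩ :=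
    exists_cutoffProfile_deriv_bounds
  have hk : ∀ k : ℕ, (0 : ℝ) < k + 1 := fun k ↦ by positivity
  set ζ : ℕ → ℝ → ℝ := fun k t ↦ ψ (t / (k + 1)) with hζ
  have hζs : ∀ k, ContDiff ℝ ∞ (ζ k) := fun k ↦ hψs.comp (contDiff_id.div_const _)
  have hζd : ∀ (k : ℕ) (t : ℝ), HasDerivAt (ζ k) (deriv ψ (t / (k + 1)) / (k + 1)) t := by
    intro k t
    have h1 : HasDerivAt (fun s : ℝ ↦ s / (k + 1)) (1 / (k + 1)) t := (hasDerivAt_id t).div_const _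
    have h2 : HasDerivAt ψ (deriv ψ (t / (k + 1))) (t / (k + 1)) :=
      (hψs.differentiable (by norm_num) _).hasDerivAt
    simpa [hζ, div_eq_mul_inv, Function.comp_def] using h2.comp t h1
  have hζ' : ∀ k : ℕ, deriv (ζ k) = fun t ↦ deriv ψ (t / (k + 1)) / (k + 1) := fun k ↦
    funext fun t ↦ (hζd k t).deriv
  have hζdd : ∀ (k : ℕ) (t : ℝ),
      deriv (deriv (ζ k)) t = deriv (deriv ψ) (t / (k + 1)) / (k + 1) / (k + 1) := by
    intro k t
    rw [hζ' k]
    have h1 : HasDerivAt (fun s : ℝ ↦ s / (k + 1)) (1 / (k + 1)) t := (hasDerivAt_id t).div_const _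
    have hd1 : ContDiff ℝ ∞ (deriv ψ) := (contDiff_infty_iff_deriv.mp hψs).2
    have h2 : HasDerivAt (deriv ψ) (deriv (deriv ψ) (t / (k + 1))) (t / (k + 1)) :=
      (hd1.differentiable (by norm_num) _).hasDerivAt
    have h3 := (h2.comp t h1).div_const ((k : ℝ) + 1)
    simpa [div_eq_mul_inv, Function.comp_def] using h3.deriv
  /- the cut-offs `η k = ζ k ∘ f` and their differential calculus -/
  set η : ℕ → M → ℝ := fun k x ↦ ζ k (f x) with hη
  have hηζ : ∀ k, η k = ζ k ∘ f := fun k ↦ rfl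
  have hfd : ∀ x, MDifferentiableAt (𝓡 n) 𝓘(ℝ, ℝ) f x := fun x ↦ hf.mdifferentiableAt (by norm_num)
  have hf2 : ∀ x, ContMDiffAt (𝓡 n) 𝓘(ℝ, ℝ) 2 f x := fun x ↦ (hf.of_le ENat.LEInfty.out).contMDiffAt
  have hd : ∀ (k : ℕ) (x : M), (mvfderiv (𝓡 n) (η k) x).toLinearMap =
      (deriv ψ (f x / (k + 1)) / (k + 1)) • (mvfderiv (𝓡 n) f x).toLinearMap := fun k x ↦ by
    ext v
    have := mvfderiv_real_comp_apply (I := 𝓡 n) (hζd k (f x)) (hfd x) v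
    simpa [hη, Function.comp_def] using this
  have hgradη : ∀ (k : ℕ) (x : M),
      g.gradSq (η k) x = (deriv ψ (f x / (k + 1)) / (k + 1)) ^ 2 * g.gradSq f x := fun k x ↦ by
    rw [hηζ]
    exact g.gradSq_real_comp (hζd k (f x)) (hfd x)
  have hcross : ∀ (k : ℕ) (x : M), g.innerDual x (mvfderiv (𝓡 n) f x).toLinearMap
      (mvfderiv (𝓡 n) (η k) x).toLinearMap = deriv ψ (f x / (k + 1)) / (k + 1) * g.gradSq f x :=
    fun k x ↦ by
    rw [hd k x]
    simp only [PseudoRiemannianMetric.innerDual, PseudoRiemannianMetric.gradSq, map_smul,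
      smul_eq_mul]
  have hΔη : ∀ (k : ℕ) (x : M), g.dalembertian (η k) x =
      deriv (deriv ψ) (f x / (k + 1)) / (k + 1) / (k + 1) * g.gradSq f x +
        deriv ψ (f x / (k + 1)) / (k + 1) * g.dalembertian f x := fun k x ↦ by
    have h := g.dalembertian_real_comp (ζ := ζ k) (hf2 x) ((hζs k).of_le ENat.LEInfty.out).contDiffAt
    rw [hηζ, h, hζdd, hζ']
    rfl
  -- off `{f ≤ 2(k+1)}` the derivatives of the profile vanish
  have hfar : ∀ (k : ℕ) (x : M), ¬ f x ≤ 2 * (k + 1) →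
      deriv ψ (f x / (k + 1)) = 0 ∧ deriv (deriv ψ) (f x / (k + 1)) = 0 := by
    intro k x hx
    have h2 : 2 < f x / (k + 1) := by
      rw [lt_div_iff₀ (hk k)]
      linarith [lt_of_not_ge hx]
    exact ⟨hψd0 _ h2, hψdd0 _ h2⟩
  /- the constant -/
  have hCn : (0 : ℝ) ≤ n := Nat.cast_nonneg _
  have hC₁n : 0 ≤ C₁ * n := mul_nonneg hC₁0 hCn
  have hC₁sq : 0 ≤ C₁ ^ 2 := sq_nonneg _
  set C : ℝ := 2 * C₁ ^ 2 + 2 * C₁ + C₁ * n / 2 + 2 * C₂ with hC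
  have hC0 : 0 ≤ C := by linarith
  refine ⟨η, C, fun k ↦ (hζs k).comp_contMDiff hf, ?_, fun k x ↦ hψ01 _, ?_, ?_, ?_, ?_, ?_⟩
  · -- compact support inside `{f ≤ 2(k+1)}`
    intro k
    refine HasCompactSupport.intro (hprop (2 * (k + 1))) fun x hx ↦ ?_
    have hx' : 2 * ((k : ℝ) + 1) < f x := lt_of_not_ge hx
    exact hψ0 _ (by rw [le_div_iff₀ (hk k)]; linarith)
  · -- monotone in `k`
    intro k x
    show ψ (f x / (k + 1)) ≤ ψ (f x / (((k + 1 : ℕ) : ℝ) + 1))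
    push_cast
    exact hanti (div_le_div_of_nonneg_left (hf0 x) (hk k) (by linarith))
  · -- `= 1` near every point of `{f < k+1}`
    intro k x hx
    have hopen : IsOpen {y : M | f y < k + 1} := isOpen_lt hf.continuous continuous_const
    filter_upwards [hopen.mem_nhds hx] with y hy
    show ψ (f y / (k + 1)) = 1
    refine hψ1 _ ?_
    rw [div_le_one (hk k)]
    exact le_of_lt hy
  · -- `|∇η_k|² ≤ C/(k+1)`
    intro k x
    rw [hgradη]
    by_cases hfx : f x ≤ 2 * (k + 1)
    · have ha : deriv ψ (f x / (k + 1)) ^ 2 ≤ C₁ ^ 2 := by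
        rw [← sq_abs]
        exact pow_le_pow_left₀ (abs_nonneg _) (hC₁ _) 2
      calc (deriv ψ (f x / (k + 1)) / (k + 1)) ^ 2 * g.gradSq f x
          ≤ C₁ ^ 2 / (k + 1) ^ 2 * (2 * (k + 1)) := by
            rw [div_pow]
            exact mul_le_mul (div_le_div_of_nonneg_right ha (by positivity))
              ((hgrad x).trans hfx) (hG0 x) (by positivity)
        _ = 2 * C₁ ^ 2 / (k + 1) := by
            field_simp
        _ ≤ C / (k + 1) := div_le_div_of_nonneg_right (by linarith) (hk k).le
    · rw [(hfar k x hfx).1]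
      simpa using div_nonneg hC0 (hk k).le
  · -- `|Δη_k| ≤ C`
    intro k x
    rw [hΔη]
    by_cases hfx : f x ≤ 2 * (k + 1)
    · have hkk : (1 : ℝ) ≤ k + 1 := by linarith [(Nat.cast_nonneg k : (0 : ℝ) ≤ k)]
      calc |deriv (deriv ψ) (f x / (k + 1)) / (k + 1) / (k + 1) * g.gradSq f x +
              deriv ψ (f x / (k + 1)) / (k + 1) * g.dalembertian f x|
          ≤ |deriv (deriv ψ) (f x / (k + 1)) / (k + 1) / (k + 1) * g.gradSq f x| +
              |deriv ψ (f x / (k + 1)) / (k + 1) * g.dalembertian f x| := abs_add_le _ _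
        _ = |deriv (deriv ψ) (f x / (k + 1))| / (k + 1) / (k + 1) * g.gradSq f x +
              |deriv ψ (f x / (k + 1))| / (k + 1) * |g.dalembertian f x| := by
            rw [abs_mul, abs_mul, abs_div, abs_div, abs_div, abs_of_pos (hk k),
              abs_of_nonneg (hG0 x)]
        _ ≤ C₂ / (k + 1) / (k + 1) * (2 * (k + 1)) + C₁ / (k + 1) * (n / 2 + 2 * (k + 1)) := by
            refine add_le_add (mul_le_mul ?_ ((hgrad x).trans hfx) (hG0 x) ?_)
              (mul_le_mul ?_ ((hΔf x).trans (by linarith)) (abs_nonneg _) ?_)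
            · exact div_le_div_of_nonneg_right
                (div_le_div_of_nonneg_right (hC₂ _) (hk k).le) (hk k).le
            · exact div_nonneg (div_nonneg hC₂0 (hk k).le) (hk k).le
            · exact div_le_div_of_nonneg_right (hC₁ _) (hk k).le
            · exact div_nonneg hC₁0 (hk k).le
        _ = (2 * C₂ + C₁ * n / 2) / (k + 1) + 2 * C₁ := by
            field_simp
            ring
        _ ≤ (2 * C₂ + C₁ * n / 2) + 2 * C₁ := by
            have : (2 * C₂ + C₁ * n / 2) / (k + 1) ≤ 2 * C₂ + C₁ * n / 2 :=
              div_le_self (by linarith) hkk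
            linarith
        _ ≤ C := by linarith
    · rw [(hfar k x hfx).1, (hfar k x hfx).2]
      simpa using hC0
  · -- `|g⁻¹(df, dη_k)| ≤ C`
    intro k x
    rw [hcross]
    by_cases hfx : f x ≤ 2 * (k + 1)
    · calc |deriv ψ (f x / (k + 1)) / (k + 1) * g.gradSq f x|
          = |deriv ψ (f x / (k + 1))| / (k + 1) * g.gradSq f x := by
            rw [abs_mul, abs_div, abs_of_pos (hk k), abs_of_nonneg (hG0 x)]
        _ ≤ C₁ / (k + 1) * (2 * (k + 1)) :=
            mul_le_mul (div_le_div_of_nonneg_right (hC₁ _) (hk k).le) ((hgrad x).trans hfx)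
              (hG0 x) (div_nonneg hC₁0 (hk k).le)
        _ = 2 * C₁ := by
            field_simp
        _ ≤ C := by linarith
    · rw [(hfar k x hfx).1]
      simpa using hC0

end Literature.Geometry.Riemannian.NoncompactShrinkerGapHeat

end Part6

/-!
## Part 7 — port of `Summits/SmoothPoincare4/SmoothPoincare4/Theorems/EntropyRungNoncompactShrinkerGapHeatVeryWeakNoncompact.lean` (1 declarations kept)

# Lions' very weak existence for the static linear heat equation on a complete manifold

Theorem `helper_veryWeakHeat_noncompact` (from the compact-support LSI programme): the non-compact,
static-metric version of `exists_veryWeak_linearHeat` (`LinearHeatWeakExistence.lean`, written for a closed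
manifold and a time-dependent family with density ratio `ρ`). Let `(M, g)` be a Riemannian manifold modelled
on `ℝⁿ` (Hausdorff, second countable, `T₃` — NOT compact), `Q, G` smooth on `M × ℝ` with `G` compactly
supported, `a < b` and `Q ≥ 1` on `M × [a, b]`. Then there is a measurable `u ∈ L²(V_g ⊗ ds)`, `u = 0` for
`s ∉ (a, b)`, with
`∫ u (−∂ₛζ − Δ_g ζ(·, s) + Qζ) d(V_g ⊗ ds) = ∫_{M×(a,b)} G ζ d(V_g ⊗ ds)`
for every smooth compactly supported `ζ` with `tsupport ζ ⊆ M × (−∞, b)` — a very weak solution of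
`∂ₛu = Δ_g u − Qu + G` on `M × (a, b)` with `u(a) = 0` weakly, extended by zero.

Proof (Trèves 1975, §41, Lemma 41.2 ⇒ Thm. 40.1, exactly as in the tree, with the compactness of `M`
replaced by compact SPATIAL support of the test functions): J.-L. Lions' projection lemma
(`lions_projection`) in `H = L²(M × (a, b), V_g ⊗ ds)` with the test space `Φ` of smooth functions on
`M × ℝ` vanishing off `K × ℝ` for some compact `K ⊆ M` and for `s ≥ b'` for some `b' < b` (a submodule);
every `φ ∈ Φ` and `𝒜φ = −∂ₛφ − Δ_g φ(·, s) + Qφ` is continuous and vanishes off `K × ℝ`, hence lies in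
`L²` of the strip (`V_g` is finite on compact sets; no finiteness of `V_g(M)` is used); coercivity
`‖φ‖² ≤ ⟪𝒜φ, φ⟫` is the energy inequality `energy_le_integral_mul_heatAdjoint_static` of the auxiliary file
(`helper_energyIneq_static`); the embedding constant is `1`; `|∫ Gφ| ≤ ‖G‖₂‖φ‖₂` since `G` has compact
support. A compactly supported `ζ` with `tsupport ζ ⊆ M × (−∞, b)` belongs to `Φ` with
`K = fst(tsupport ζ)`. Everything is proved; no definitions.

References: F. Trèves, *Basic Linear Partial Differential Equations* (1975), §41, Lemma 41.2, (41.7),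
Thm. 40.1; J.-L. Lions, *Équations différentielles opérationnelles et problèmes aux limites* (1961).
-/

section Part7

open scoped _root_.Manifold _root_.ContDiff _root_.ENNReal _root_.NNReal _root_.Topology _root_.InnerProductSpace
open _root_.MeasureTheory _root_.Set _root_.Filter
open Literature.Geometry.Lorentzian Literature.Geometry.Riemannian

namespace Literature.Geometry.Riemannian.NoncompactShrinkerGapHeat

section VeryWeakStatic

variable {n : ℕ} {M : Type*} [TopologicalSpace M] [T2Space M] [SecondCountableTopology M]
  [ChartedSpace (EuclideanSpace ℝ (Fin n)) M] [IsManifold (𝓡 n) ∞ M] [T3Space M] [MeasurableSpace M]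
  [BorelSpace M]
  {g : PseudoRiemannianMetric (𝓡 n) ∞ (EuclideanSpace ℝ (Fin n)) (TangentSpace (𝓡 n) : M → Type _)}

end VeryWeakStatic

/-- **`helper_veryWeakHeat_noncompact`**: Lions' very weak
`L²` existence for the static linear heat equation `∂ₛu − Δ_g u + Qu = G` with zero initial data at `s = a`
on a (non-compact) Riemannian manifold `(M, g)` modelled on `ℝⁿ`, for a compactly supported smooth source
`G` and `Q ≥ 1` on `M × [a, b]` (`exists_veryWeak_linearHeat_static`).
[cite: Treves1975, §41, Lemma 41.2 and Thm. 40.1] -/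
theorem helper_veryWeakHeat_noncompact : ∀ (n : ℕ) (M : Type*) [TopologicalSpace M] [T2Space M] [SecondCountableTopology M] [ChartedSpace (EuclideanSpace ℝ (Fin n)) M] [IsManifold (𝓡 n) ∞ M] [T3Space M] [MeasurableSpace M] [BorelSpace M] (g : PseudoRiemannianMetric (𝓡 n) ∞ (EuclideanSpace ℝ (Fin n)) (TangentSpace (𝓡 n) : M → Type _)), g.IsRiemannian → ∀ (Q G : ℝ → M → ℝ), ContMDiff ((𝓡 n).prod 𝓘(ℝ, ℝ)) 𝓘(ℝ, ℝ) ∞ (fun p : M × ℝ ↦ Q p.2 p.1) → ContMDiff ((𝓡 n).prod 𝓘(ℝ, ℝ)) 𝓘(ℝ, ℝ) ∞ (fun p : M × ℝ ↦ G p.2 p.1) → HasCompactSupport (fun p : M × ℝ ↦ G p.2 p.1) → ∀ (a b : ℝ), a < b → (∀ (x : M) (s : ℝ), s ∈ Icc a b → 1 ≤ Q s x) → ∃ u : M × ℝ → ℝ, Measurable u ∧ MemLp u 2 (g.riemVolume.prod (volume : Measure ℝ)) ∧ (∀ p : M × ℝ, p.2 ∉ Ioo a b → u p = 0) ∧ ∀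 ζ : M × ℝ → ℝ, ContMDiff ((𝓡 n).prod 𝓘(ℝ, ℝ)) 𝓘(ℝ, ℝ) ∞ ζ → HasCompactSupport ζ → tsupport ζ ⊆ univ ×ˢ Iio b → ∫ p, u p * (-(deriv (fun s ↦ ζ (p.1, s)) p.2) - g.laplaceBeltrami (fun x ↦ ζ (x, p.2)) p.1 + Q p.2 p.1 * ζ p) ∂(g.riemVolume.prod (volume : Measure ℝ)) = ∫ p in univ ×ˢ Ioo a b, G p.2 p.1 * ζ p ∂(g.riemVolume.prod (volume : Measure ℝ)) := by
  intro n M _ _ _ _ _ _ _ _ g hg Q G hQ hG hGc a b hab hQ1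
  exact exists_veryWeak_linearHeat_static hg hQ hG hGc hab hQ1

end Literature.Geometry.Riemannian.NoncompactShrinkerGapHeat

end Part7

/-!
## Part 8 — port of `Summits/SmoothPoincare4/SmoothPoincare4/Theorems/EntropyRungNoncompactShrinkerGapHeatEnergyVanishing.lean` (1 declarations kept)

# Energy uniqueness (`w(·, a) = 0`, `w ∈ L²` ⇒ `w = 0`) for `∂ₛw = Δw − Qw`, `Q ≥ 0`, on a complete
# manifold

Setting: `(M, g)` Riemannian, modelled on `ℝⁿ` (Hausdorff, second countable, NOT compact),
unweighted measure `dV`; cut-offs `η_k ∈ C_c^∞`, `0 ≤ η_k ≤ 1`, `η_k ↑`, eventually `= 1` near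
every point, `|Δη_k| ≤ C`; `w` smooth on `M × O`, `O ⊇ [a, b]` open, `∂ₛw = Δw − Qw` on `[a, b]`
with `Q ≥ 0` there (no regularity of `Q` is needed), `w(·, a) = 0`, `∫∫_{M×(a,b)} w² < ∞`.
Then `w = 0` on `M × [a, b]`.

* `integral_sq_cutoff_le` — for ONE cut-off `η ≥ 0`: `∫ w(·,s)² η ≤ ∫∫_{M×(a,b)} w² |Δη|`
  (`E(s) = ∫ w(·,s)² η`, `E' = 2∫ w η ∂ₛw ≤ 2∫ w η Δw = −2∫ η|∇w|² + ∫ w² Δη ≤ ∫ w² |Δη|`, by the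
  energy identity with a cut-off of `CutoffToolkit` with `V = 0`; FTC and Fubini);
* `helper_energyVanishing` — `∫∫ w² |Δη_k| → 0` (dominated convergence, `|Δη_k| ≤ C`, `Δη_k → 0`
  pointwise), `E_k(s) ↑` in `k`, so `E_k(s) = 0`; the continuous nonnegative integrand vanishes
  identically (the Riemannian measure charges open sets), and `η_k(x) = 1` for large `k`.

Source: the standard energy method for uniqueness of the heat equation with cut-offs on complete
manifolds, A. Grigor'yan, *Heat kernel and analysis on manifolds* (2009), Ch. 8 and §11.2; the
cut-off bookkeeping of J. A. Carrillo, L. Ni, Comm. Anal. Geom. 17 (2009), §4 [CarrilloNi2009].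
-/

section Part8

open scoped _root_.Manifold _root_.ContDiff _root_.ENNReal _root_.NNReal _root_.Topology
open _root_.MeasureTheory _root_.Set _root_.Filter
open Literature.Geometry.Lorentzian Literature.Geometry.Riemannian

namespace Literature.Geometry.Riemannian.NoncompactShrinkerGapHeat

open CutoffToolkit

section Vanishing

variable {n : ℕ} {M : Type*} [TopologicalSpace M] [T2Space M] [SecondCountableTopology M]
  [ChartedSpace (EuclideanSpace ℝ (Fin n)) M] [IsManifold (𝓡 n) ∞ M] [T3Space M]
  [MeasurableSpace M] [BorelSpace M]
  {g : PseudoRiemannianMetric (𝓡 n) ∞ (EuclideanSpace ℝ (Fin n)) (TangentSpace (𝓡 n) : M → Type _)}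
  [g.HasLeviCivita]

/-- **Energy uniqueness for `∂ₛw = Δw − Qw`, `Q ≥ 0`, on a complete manifold** (`helper_energyVanishing`): with cut-offs
`η_k ∈ C_c^∞`, `0 ≤ η_k ≤ 1`, `η_k ↑`, eventually `1` near every point, `|Δη_k| ≤ C`, a smooth `w`
on `M × O` (`O ⊇ [a, b]` open) with `∂ₛw = Δw − Qw` on `[a, b]`, `w(·, a) = 0` and
`∫∫_{M×(a,b)} w² < ∞` vanishes on `M × [a, b]`: `∫ w(·,s)² η_k ≤ ∫∫ w² |Δη_k| → 0`
(`integral_sq_cutoff_le`, dominated convergence), the left side is non-decreasing in `k`, hence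
`0`, and a continuous nonnegative function with zero integral against a measure charging open
sets vanishes. [cite: CarrilloNi2009, §4 (integration by parts on the complete soliton)] -/
theorem helper_energyVanishing : ∀ (n : ℕ) (M : Type*) [TopologicalSpace M] [T2Space M] [SecondCountableTopology M] [ChartedSpace (EuclideanSpace ℝ (Fin n)) M] [IsManifold (𝓡 n) ∞ M] [T3Space M] [MeasurableSpace M] [BorelSpace M] (g : PseudoRiemannianMetric (𝓡 n) ∞ (EuclideanSpace ℝ (Fin n)) (TangentSpace (𝓡 n) : M → Type _)) [g.HasLeviCivita], g.IsRiemannian → ∀ (η : ℕ → M → ℝ) (C : ℝ), (∀ k, ContMDiff (𝓡 n) 𝓘(ℝ, ℝ) ∞ (η k)) → (∀ k, HasCompactSupport (η k)) → (∀ k x, 0 ≤ η k x ∧ η k x ≤ 1) → (∀ k x, η k x ≤ η (k + 1) x) → (∀ x, ∀ᶠ k in atTop, ∀ᶠ y in 𝓝 x, η k y = 1) → (∀ k x, |g.dalembertian (η k) x| ≤ C) → ∀ (Q : ℝ → M → ℝ) (a b : ℝ) (O : Set ℝ) (w : M × ℝ → ℝ), a < b → IsOpen O → Icc a b ⊆ O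 → (∀ s ∈ Icc a b, ∀ x, 0 ≤ Q s x) → ContMDiffOn ((𝓡 n).prod 𝓘(ℝ, ℝ)) 𝓘(ℝ, ℝ) ∞ w (univ ×ˢ O) → (∀ s ∈ Icc a b, ∀ x, deriv (fun r ↦ w (x, r)) s = g.dalembertian (fun y ↦ w (y, s)) x - Q s x * w (x, s)) → (∀ x, w (x, a) = 0) → Integrable (fun p : M × ℝ ↦ w p ^ 2) ((g.riemVolume.prod (volume : Measure ℝ)).restrict (univ ×ˢ Ioo a b)) → ∀ s ∈ Icc a b, ∀ x, w (x, s) = 0 := by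
  intro n M _ _ _ _ _ _ _ _ g _ hg η C hηs hηc hη01 hmono hη1 hΔη Q a b O w hab hO habO hQ hw heq hwa
    hInt s hs x₀
  haveI := CarrilloNi2009_shrinkerLSI.isFiniteMeasureOnCompacts_riemVolume hg
  haveI := sigmaFinite_riemVolume hg
  haveI := isOpenPosMeasure_riemVolume hg
  have h2 : (2 : ℕ∞ω) ≤ (∞ : ℕ∞ω) := WithTop.coe_le_coe.mpr le_top
  set μ : Measure M := g.riemVolume with hμ
  set ν : Measure (M × ℝ) := (μ.prod (volume : Measure ℝ)).restrict (univ ×ˢ Ioo a b) with hν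
  -- the slice `u = w(·, s)` is smooth
  have hu : ContMDiff (𝓡 n) 𝓘(ℝ, ℝ) ∞ fun y ↦ w (y, s) :=
    contMDiff_slice_of_contMDiffOn (u := fun r y ↦ w (y, r)) hw (habO hs)
  -- Step 1: `E_k(s) ≤ r_k = ∫∫ w² |Δη_k|`
  have hstep : ∀ k, ∫ x, w (x, s) ^ 2 * η k x ∂μ ≤ ∫ p, w p ^ 2 * |g.dalembertian (η k) p.1| ∂ν :=
    fun k ↦ integral_sq_cutoff_le hg (hηs k) (hηc k) (fun x ↦ (hη01 k x).1) hO habO hQ hw heq hwa hs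
  -- Step 2: `r_k → 0`
  have hwc : ContinuousOn (fun p : M × ℝ ↦ w p ^ 2) (univ ×ˢ Ioo a b) :=
    (hw.continuousOn.mono (prod_mono le_rfl (Ioo_subset_Icc_self.trans habO))).pow 2
  have hr_meas : ∀ k, AEStronglyMeasurable (fun p : M × ℝ ↦ w p ^ 2 * |g.dalembertian (η k) p.1|) ν :=
    fun k ↦ aestronglyMeasurable_strip μ (hwc.mul ((continuous_abs.comp
      (continuous_dalembertian g ((hηs k).of_le h2))).comp continuous_fst).continuousOn)
  have hr_bd : ∀ k (p : M × ℝ), ‖w p ^ 2 * |g.dalembertian (η k) p.1|‖ ≤ C * w p ^ 2 := fun k p ↦ by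
    rw [Real.norm_eq_abs, abs_mul, abs_abs, abs_of_nonneg (sq_nonneg _), mul_comm]
    exact mul_le_mul_of_nonneg_right (hΔη k p.1) (sq_nonneg _)
  have hr_t : Tendsto (fun k ↦ ∫ p, w p ^ 2 * |g.dalembertian (η k) p.1| ∂ν) atTop (𝓝 0) := by
    have hlim : ∀ p : M × ℝ, Tendsto (fun k ↦ w p ^ 2 * |g.dalembertian (η k) p.1|) atTop (𝓝 0) :=
      fun p ↦ by
      refine tendsto_const_nhds.congr' ?_
      filter_upwards [dalembertian_cutoff_eventually_eq_zero (g := g) hη1 p.1] with k hk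
      rw [hk, abs_zero, mul_zero]
    have h := tendsto_integral_of_dominated_convergence (fun p : M × ℝ ↦ C * w p ^ 2) hr_meas
      (hInt.const_mul C) (fun k ↦ Eventually.of_forall (hr_bd k)) (Eventually.of_forall hlim)
    simpa using h
  -- Step 3: `E_k(s)` is non-decreasing in `k`, hence `E_k(s) ≤ 0`, hence `= 0`
  have hηmono : ∀ x, Monotone fun k ↦ η k x := fun x ↦ monotone_nat_of_le_succ fun k ↦ hmono k x
  have hEi : ∀ k, Integrable (fun x ↦ w (x, s) ^ 2 * η k x) μ := fun k ↦
    ((hu.continuous.pow 2).mul (hηs k).continuous).integrable_of_hasCompactSupport (hηc k).mul_left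
  have hEmono : ∀ k k', k ≤ k' → ∫ x, w (x, s) ^ 2 * η k x ∂μ ≤ ∫ x, w (x, s) ^ 2 * η k' x ∂μ :=
    fun k k' hkk' ↦ integral_mono (hEi k) (hEi k') fun x ↦
      mul_le_mul_of_nonneg_left (hηmono x hkk') (sq_nonneg _)
  have hE0 : ∀ k, ∫ x, w (x, s) ^ 2 * η k x ∂μ = 0 := by
    intro k
    refine le_antisymm ?_ (integral_nonneg fun x ↦ mul_nonneg (sq_nonneg _) (hη01 k x).1)
    refine ge_of_tendsto hr_t ?_
    filter_upwards [eventually_ge_atTop k] with k' hk'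
    exact (hEmono k k' hk').trans (hstep k')
  -- Step 4: the continuous nonnegative integrand vanishes identically; `η_k(x₀) = 1` for large `k`
  obtain ⟨k, hk⟩ := (hη1 x₀).exists
  have hk1 : η k x₀ = 1 := hk.self_of_nhds
  have hae : (fun x ↦ w (x, s) ^ 2 * η k x) =ᵐ[μ] 0 :=
    (integral_eq_zero_iff_of_nonneg (fun x ↦ mul_nonneg (sq_nonneg _) (hη01 k x).1) (hEi k)).1 (hE0 k)
  have hzero : (fun x ↦ w (x, s) ^ 2 * η k x) = 0 :=
    (Continuous.ae_eq_iff_eq μ ((hu.continuous.pow 2).mul (hηs k).continuous) continuous_const).1 hae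
  have hx := congrFun hzero x₀
  simp only [hk1, mul_one, Pi.zero_apply] at hx
  exact pow_eq_zero_iff (two_ne_zero) |>.1 hx

end Vanishing

end Literature.Geometry.Riemannian.NoncompactShrinkerGapHeat

end Part8

/-!
## Part 9 — port of `Summits/SmoothPoincare4/SmoothPoincare4/Theorems/EntropyRungNoncompactShrinkerGapHeatLinearHeat.lean` (2 declarations kept)

# The linear heat Cauchy problem with compactly supported datum on a complete manifold: smooth solutions
# up to `s = 0` in `L²` of the strip

`helper_linearHeat_noncompact` (compact-support LSI programme): the non-compact,
static-metric version of `exists_smooth_linearHeat_forcing` + `exists_smooth_linearHeat_cauchy_of_coercive`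
(`LinearHeatForcedExistence.lean`, `LinearHeatCauchyExistence.lean`, closed manifolds). Setting: `(M, g)`
Riemannian, modelled on `ℝⁿ` (Hausdorff, second countable, `T₃` — NOT compact), Laplacian cut-offs `η_k`
(`|Δη_k| ≤ C`, eventually `1` near every point), a potential `Q ≥ 1` smooth on `M × ℝ`, and flat-corrector data
`(W, G, K)` (`W`, `G` smooth on `M × ℝ`, vanishing off the compact `K` and for `s ≥ 1`, `G = 0` for `s ≤ 0`,
`G = −(∂ₛW − ΔW + QW)` for `s ≥ 0`). CONCLUSION: for every `T > 0` a function `w`, smooth on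
`M × (−∞, T + 1)`, with `w(0) = W(0)`, `∂ₛw = Δw − Qw` on `[0, T]`, and `w ∈ L²(M × (0, T))`.

Proof (Trèves 1975, §41, as in the tree with compactness replaced by the landed non-compact helpers):
Lions' very weak solution `u ∈ L²` of `∂u = Δu − Qu + G` on `M × (−2, T+1)` with zero data, extended by
zero (`helper_veryWeakHeat_noncompact`; `G` has compact support in `K × [0, 1]`); it is very weak on
`M × (−∞, T+1)` since `G = 0` for `s ≤ 0`; Hörmander's hypoellipticity (`helper_hypoelliptic_noncompact`)
gives a smooth representative `v`, which solves the equation classically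
(`helper_classicalOfVeryWeak_noncompact`), vanishes on `M × (−∞, −2)` (continuity) and on `M × [−3, 0]` by
energy uniqueness with cut-offs (`helper_energyVanishing`); then `w = W + v`.

References: F. Trèves, *Basic Linear Partial Differential Equations* (1975), §41, Thm. 40.1; L. Hörmander,
Acta Math. 119 (1967); A. Grigor'yan, *Heat kernel and analysis on manifolds* (2009), Ch. 8.
-/

section Part9

open scoped _root_.Manifold _root_.ContDiff _root_.ENNReal _root_.NNReal _root_.Topology
open _root_.MeasureTheory _root_.Set _root_.Filter
open Literature.Geometry.Lorentzian Literature.Geometry.Riemannian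
open Literature.Geometry.Lorentzian.PseudoRiemannianMetric (laplaceBeltrami_eq_dalembertian)

namespace Literature.Geometry.Riemannian.NoncompactShrinkerGapHeat

section Static

variable {n : ℕ} {M : Type*} [TopologicalSpace M] [T2Space M] [SecondCountableTopology M]
  [ChartedSpace (EuclideanSpace ℝ (Fin n)) M] [IsManifold (𝓡 n) ∞ M] [T3Space M] [MeasurableSpace M]
  [BorelSpace M]
  {g : PseudoRiemannianMetric (𝓡 n) ∞ (EuclideanSpace ℝ (Fin n)) (TangentSpace (𝓡 n) : M → Type _)}
  [g.HasLeviCivita]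

/-- **The forced static problem on a complete manifold** (non-compact `exists_smooth_linearHeat_forcing`):
for `Q ≥ 1` smooth, `G` smooth with compact support in `M × ℝ` and `G = 0` for `s ≤ 0`, and Laplacian
cut-offs `η_k`, there is `v` smooth on `M × (−∞, b)` with `v = 0` for `s ≤ 0`,
`∂ₛv = Δ_g v − Qv + G` on `M × (−∞, b)`, and `v ∈ L²(M × ℝ, dV ⊗ ds)`-a.e. equal to Lions' solution, in
particular `v² ∈ L¹(M × (0, b'))` for `b' < b`. [cite: Treves1975, §41, Thm. 40.1] -/
theorem exists_smooth_linearHeat_forcing_static (hg : g.IsRiemannian)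
    {η : ℕ → M → ℝ} {C : ℝ} (hηs : ∀ k, ContMDiff (𝓡 n) 𝓘(ℝ, ℝ) ∞ (η k))
    (hηc : ∀ k, HasCompactSupport (η k)) (hη01 : ∀ k x, 0 ≤ η k x ∧ η k x ≤ 1)
    (hηmono : ∀ k x, η k x ≤ η (k + 1) x) (hη1 : ∀ x, ∀ᶠ k in atTop, ∀ᶠ y in 𝓝 x, η k y = 1)
    (hηΔ : ∀ k x, |g.dalembertian (η k) x| ≤ C)
    {Q G : ℝ → M → ℝ} (hQ : ContMDiff ((𝓡 n).prod 𝓘(ℝ, ℝ)) 𝓘(ℝ, ℝ) ∞ (fun p : M × ℝ ↦ Q p.2 p.1))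
    (hQ1 : ∀ s x, 1 ≤ Q s x)
    (hG : ContMDiff ((𝓡 n).prod 𝓘(ℝ, ℝ)) 𝓘(ℝ, ℝ) ∞ (fun p : M × ℝ ↦ G p.2 p.1))
    (hGc : HasCompactSupport (fun p : M × ℝ ↦ G p.2 p.1)) (hG0 : ∀ s ≤ (0 : ℝ), ∀ x, G s x = 0)
    {b : ℝ} (hb : 0 < b) :
    ∃ v : M × ℝ → ℝ, ContMDiffOn ((𝓡 n).prod 𝓘(ℝ, ℝ)) 𝓘(ℝ, ℝ) ∞ v (univ ×ˢ Iio b) ∧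
      (∀ x, ∀ s ≤ (0 : ℝ), v (x, s) = 0) ∧
      (∀ x, ∀ s < b, deriv (fun r ↦ v (x, r)) s =
        g.laplaceBeltrami (fun y ↦ v (y, s)) x - Q s x * v (x, s) + G s x) ∧
      Integrable (fun p : M × ℝ ↦ v p ^ 2) ((g.riemVolume.prod (volume : Measure ℝ)).restrict
        (univ ×ˢ Ioo 0 b)) := by
  classical
  haveI : LocallyCompactSpace M := ChartedSpace.locallyCompactSpace (EuclideanSpace ℝ (Fin n)) M
  haveI := CarrilloNi2009_shrinkerLSI.isFiniteMeasureOnCompacts_riemVolume hg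
  set μ₀ : Measure M := g.riemVolume with hμ₀
  haveI : μ₀.IsOpenPosMeasure := Literature.Geometry.Riemannian.isOpenPosMeasure_riemVolume hg
  haveI : (μ₀.prod (volume : Measure ℝ)).IsOpenPosMeasure := Measure.prod.instIsOpenPosMeasure
  haveI : SigmaFinite μ₀ := Literature.Geometry.Riemannian.sigmaFinite_riemVolume hg
  have hab : (-2 : ℝ) < b := by linarith
  -- Lions' very weak solution on `M × (-2, b)`, extended by zero
  obtain ⟨u, hum, hu2, hu0, huweak⟩ := helper_veryWeakHeat_noncompact n M g hg Q G hQ hG hGc (-2) b hab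
    (fun x s _ ↦ hQ1 s x)
  -- it is a very weak solution on `M × (-∞, b)` (the forcing vanishes for `s ≤ 0`)
  have huweak' : ∀ ζ : M × ℝ → ℝ, ContMDiff ((𝓡 n).prod 𝓘(ℝ, ℝ)) 𝓘(ℝ, ℝ) ∞ ζ → HasCompactSupport ζ →
      tsupport ζ ⊆ univ ×ˢ Iio b →
      ∫ p, u p * (-(deriv (fun s ↦ ζ (p.1, s)) p.2) - g.laplaceBeltrami (fun x ↦ ζ (x, p.2)) p.1 +
          Q p.2 p.1 * ζ p) ∂μ₀.prod (volume : Measure ℝ) =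
        ∫ p, G p.2 p.1 * ζ p ∂μ₀.prod (volume : Measure ℝ) := by
    intro ζ hζ hζc hζb
    rw [huweak ζ hζ hζc hζb]
    refine setIntegral_eq_integral_of_forall_compl_eq_zero fun p hp ↦ ?_
    by_cases hpb : p.2 < b
    · have hpa : p.2 ≤ -2 := by
        by_contra h'
        exact hp ⟨mem_univ _, not_le.1 h', hpb⟩
      rw [hG0 p.2 (by linarith) p.1, zero_mul]
    · have hp' : p ∉ tsupport ζ := fun h' ↦ hpb (hζb h').2
      rw [image_eq_zero_of_notMem_tsupport hp', mul_zero]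
  -- interior regularity on the open time set `(-∞, b)`
  have hu1 : LocallyIntegrableOn u (univ ×ˢ Iio b) (μ₀.prod (volume : Measure ℝ)) :=
    (hu2.locallyIntegrable (by norm_num)).locallyIntegrableOn _
  obtain ⟨v, hv, hae⟩ := helper_hypoelliptic_noncompact n M g hg Q G hQ hG (Iio b) u isOpen_Iio hum hu1
    huweak'
  -- the weak identity for the smooth representative
  have hvweak : ∀ ζ : M × ℝ → ℝ, ContMDiff ((𝓡 n).prod 𝓘(ℝ, ℝ)) 𝓘(ℝ, ℝ) ∞ ζ → HasCompactSupport ζ →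
      tsupport ζ ⊆ univ ×ˢ Iio b →
      ∫ p, v p * (-(deriv (fun s ↦ ζ (p.1, s)) p.2) - g.laplaceBeltrami (fun x ↦ ζ (x, p.2)) p.1 +
          Q p.2 p.1 * ζ p) ∂μ₀.prod (volume : Measure ℝ) =
        ∫ p, G p.2 p.1 * ζ p ∂μ₀.prod (volume : Measure ℝ) := by
    intro ζ hζ hζc hζb
    rw [← huweak' ζ hζ hζc hζb]
    refine integral_congr_ae ?_
    filter_upwards [hae] with p hp
    by_cases hpz : p ∈ tsupport ζ
    · rw [hp (hζb hpz)]
    · simp only [staticHeatAdjoint_eq_zero_of_notMem_tsupport Q hpz, mul_zero]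
  -- the classical equation on `M × (-∞, b)`
  have hclass : ∀ x, ∀ s < b, deriv (fun r ↦ v (x, r)) s =
      g.laplaceBeltrami (fun y ↦ v (y, s)) x - Q s x * v (x, s) + G s x := by
    intro x s hs
    have h := helper_classicalOfVeryWeak_noncompact n M g hg Q G hQ hG (Iio b) v isOpen_Iio hv hvweak (x, s)
      ⟨mem_univ _, hs⟩
    simp only at h
    linarith
  -- `v = 0` on `M × (-∞, -2)`, where `u = 0`
  have hv0 : ∀ x, ∀ s < (-2 : ℝ), v (x, s) = 0 := by
    have hO : IsOpen ((univ : Set M) ×ˢ Iio (-2 : ℝ)) := isOpen_univ.prod isOpen_Iio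
    have hsub : (univ : Set M) ×ˢ Iio (-2 : ℝ) ⊆ univ ×ˢ Iio b :=
      Set.prod_mono le_rfl (Iio_subset_Iio hab.le)
    have heq : EqOn v 0 ((univ : Set M) ×ˢ Iio (-2 : ℝ)) := by
      refine Measure.eqOn_open_of_ae_eq (μ := μ₀.prod (volume : Measure ℝ)) ?_ hO
        (hv.mono hsub).continuousOn continuousOn_const
      rw [Filter.EventuallyEq, ae_restrict_iff' hO.measurableSet]
      filter_upwards [hae] with p hp hpO
      rw [← hp (hsub hpO), Pi.zero_apply]
      exact hu0 p fun h' ↦ lt_irrefl _ (h'.1.trans hpO.2)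
    intro x s hs
    exact heq ⟨mem_univ _, hs⟩
  -- `v² ∈ L¹` of every strip inside `(-∞, b)` (`v = u` a.e., `u ∈ L²`)
  have hu2sq : Integrable (fun p : M × ℝ ↦ u p ^ 2) (μ₀.prod (volume : Measure ℝ)) := by
    have := hu2.integrable_norm_rpow two_ne_zero ENNReal.ofNat_ne_top
    refine this.congr (Eventually.of_forall fun p ↦ ?_)
    simp [Real.norm_eq_abs, sq_abs]
  have hv2 : ∀ a' b' : ℝ, b' ≤ b → Integrable (fun p : M × ℝ ↦ v p ^ 2)
      ((μ₀.prod (volume : Measure ℝ)).restrict (univ ×ˢ Ioo a' b')) := by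
    intro a' b' hb'
    refine (hu2sq.restrict (s := univ ×ˢ Ioo a' b')).congr ?_
    rw [Filter.EventuallyEq, ae_restrict_iff' (MeasurableSet.univ.prod measurableSet_Ioo)]
    filter_upwards [hae] with p hp hpS
    rw [hp ⟨mem_univ _, lt_of_lt_of_le hpS.2.2 hb'⟩]
  -- `v = 0` on `M × [-3, 0]` by energy uniqueness for the homogeneous equation
  have hv00 : ∀ s ∈ Icc (-3 : ℝ) 0, ∀ x, v (x, s) = 0 := by
    refine helper_energyVanishing n M g hg η C hηs hηc hη01 hηmono hη1 hηΔ Q (-3) 0 (Iio b) v (by norm_num)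
      isOpen_Iio (fun s hs ↦ lt_of_le_of_lt hs.2 hb) (fun s _ x ↦ zero_le_one.trans (hQ1 s x)) hv ?_ ?_ ?_
    · intro s hs x
      rw [hclass x s (lt_of_le_of_lt hs.2 hb), hG0 s hs.2 x, add_zero, laplaceBeltrami_eq_dalembertian]
    · intro x
      exact hv0 x (-3) (by norm_num)
    · exact hv2 (-3) 0 hb.le
  refine ⟨v, hv, fun x s hs ↦ ?_, hclass, hv2 0 b le_rfl⟩
  rcases lt_or_ge s (-2) with hs' | hs'
  · exact hv0 x s hs'
  · exact hv00 s ⟨by linarith, hs⟩ x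

end Static

/-- **Helper `helper_linearHeat_noncompact`** (line `collapsed-ends-usc`, v13; see the module docstring): the
linear heat Cauchy problem `∂ₛw = Δ_g w − Qw`, `w(0) = W(0)`, for flat-corrector data `(W, G, K)` on a complete
manifold with Laplacian cut-offs — a solution smooth on `M × (−∞, T+1)` and square integrable on `M × (0, T)`.
[cite: Treves1975, §41, Thm. 40.1] -/
theorem helper_linearHeat_noncompact : ∀ (n : ℕ) (M : Type*) [TopologicalSpace M] [T2Space M] [SecondCountableTopology M] [ChartedSpace (EuclideanSpace ℝ (Fin n)) M] [IsManifold (𝓡 n) ∞ M] [T3Space M] [MeasurableSpace M] [BorelSpace M] (g : PseudoRiemannianMetric (𝓡 n) ∞ (EuclideanSpace ℝ (Fin n)) (TangentSpace (𝓡 n) : M → Type _)) [g.HasLeviCivita], g.IsRiemannian → ∀ (η : ℕ → M → ℝ) (C : ℝ), (∀ k, ContMDiff (𝓡 n) 𝓘(ℝ, ℝ) ∞ (η k)) → (∀ k, HasCompactSupport (η k)) → (∀ k x, 0 ≤ η k x ∧ η k x ≤ 1) → (∀ k x, η k x ≤ η (k + 1) x) → (∀ x, ∀ᶠ k in atTop,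 ∀ᶠ y in 𝓝 x, η k y = 1) → (∀ k x, |g.dalembertian (η k) x| ≤ C) → ∀ (Q : ℝ → M → ℝ), ContMDiff ((𝓡 n).prod 𝓘(ℝ, ℝ)) 𝓘(ℝ, ℝ) ∞ (fun p : M × ℝ ↦ Q p.2 p.1) → (∀ s x, 1 ≤ Q s x) → ∀ (W G : ℝ → M → ℝ) (K : Set M), IsCompact K → ContMDiff ((𝓡 n).prod 𝓘(ℝ, ℝ)) 𝓘(ℝ, ℝ) ∞ (fun p : M × ℝ ↦ W p.2 p.1) → ContMDiff ((𝓡 n).prod 𝓘(ℝ, ℝ)) 𝓘(ℝ, ℝ) ∞ (fun p : M × ℝ ↦ G p.2 p.1) → (∀ s x, x ∉ K → W s x = 0) → (∀ s x, x ∉ K → G s x = 0) → (∀ s, 1 ≤ s → ∀ x, W s x = 0 ∧ G s x = 0) → (∀ s ≤ 0, ∀ x, G s x = 0) → (∀ s, 0 ≤ s → ∀ x, G s x = -(deriv (fun r ↦ W r x) s - (g.laplaceBeltrami (W s) x - Q s x * W s x))) → ∀ T : ℝ, 0 < T → ∃ (O : Set ℝ) (w : ℝ → M → ℝ), IsOpen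 O ∧ Icc 0 T ⊆ O ∧ ContMDiffOn ((𝓡 n).prod 𝓘(ℝ, ℝ)) 𝓘(ℝ, ℝ) ∞ (fun p : M × ℝ ↦ w p.2 p.1) (univ ×ˢ O) ∧ (∀ x, w 0 x = W 0 x) ∧ (∀ s ∈ Icc 0 T, ∀ x, deriv (fun r ↦ w r x) s = g.dalembertian (w s) x - Q s x * w s x) ∧ Integrable (fun p : M × ℝ ↦ w p.2 p.1 ^ 2) ((g.riemVolume.prod (volume : Measure ℝ)).restrict (univ ×ˢ Ioo 0 T)) := by
  intro n M _ _ _ _ _ _ _ _ g _ hg η C hηs hηc hη01 hηmono hη1 hηΔ Q hQ hQ1 W G K hK hW hG hWK hGK hWG1 hG0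
    hGW T hT
  classical
  haveI : LocallyCompactSpace M := ChartedSpace.locallyCompactSpace (EuclideanSpace ℝ (Fin n)) M
  haveI := CarrilloNi2009_shrinkerLSI.isFiniteMeasureOnCompacts_riemVolume hg
  haveI : SigmaFinite g.riemVolume := Literature.Geometry.Riemannian.sigmaFinite_riemVolume hg
  -- `G` has compact support in `K × [0, 1]`
  have hGc : HasCompactSupport (fun p : M × ℝ ↦ G p.2 p.1) := by
    refine HasCompactSupport.intro (hK.prod (isCompact_Icc (a := (0 : ℝ)) (b := 1))) ?_
    rintro ⟨x, s⟩ hp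
    simp only [mem_prod, mem_Icc, not_and_or, not_le] at hp
    rcases hp with hx | hs | hs
    · exact hGK s x hx
    · exact hG0 s hs.le x
    · exact (hWG1 s hs.le x).2
  set b : ℝ := T + 1 with hbdef
  have hb : 0 < b := by rw [hbdef]; linarith
  obtain ⟨v, hv, hv0, hveq, hvL2⟩ := NoncompactShrinkerGapHeat.exists_smooth_linearHeat_forcing_static hg hηs hηc hη01 hηmono hη1
    hηΔ hQ hQ1 hG hGc hG0 hb
  -- the solution `w = W + v`
  set w : ℝ → M → ℝ := fun s x ↦ W s x + v (x, s) with hwdef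
  have hws : ContMDiffOn ((𝓡 n).prod 𝓘(ℝ, ℝ)) 𝓘(ℝ, ℝ) ∞ (fun p : M × ℝ ↦ w p.2 p.1) (univ ×ˢ Iio b) :=
    hW.contMDiffOn.add hv
  refine ⟨Iio b, w, isOpen_Iio, fun s hs ↦ by simp only [mem_Iio, hbdef]; linarith [hs.2], hws, fun x ↦ ?_,
    fun s hs x ↦ ?_, ?_⟩
  · simp [hwdef, hv0 x 0 le_rfl]
  · -- the equation on `[0, T]`
    have hsb : s < b := by rw [hbdef]; linarith [hs.2]
    have hdW : HasDerivAt (fun r ↦ W r x) (deriv (fun r ↦ W r x) s) s :=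
      ((contDiff_time_slice hW x).differentiable (by simp)).differentiableAt.hasDerivAt
    have hdv : HasDerivAt (fun r ↦ v (x, r)) (deriv (fun r ↦ v (x, r)) s) s :=
      hasDerivAt_slice_of_contMDiffOn isOpen_Iio hv x hsb
    have hd : deriv (fun r ↦ w r x) s = deriv (fun r ↦ W r x) s + deriv (fun r ↦ v (x, r)) s :=
      (hdW.add hdv).deriv
    have h2 : (2 : ℕ∞ω) ≤ (∞ : ℕ∞ω) := by norm_cast
    have hWs2 : ContMDiffAt (𝓡 n) 𝓘(ℝ, ℝ) 2 (W s) x :=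
      ((contMDiff_space_slice hW s).of_le h2).contMDiffAt
    have hvs2 : ContMDiffAt (𝓡 n) 𝓘(ℝ, ℝ) 2 (fun y ↦ v (y, s)) x := by
      have hO : IsOpen ((univ : Set M) ×ˢ Iio b) := isOpen_univ.prod isOpen_Iio
      have h1 : ContMDiffOn (𝓡 n) 𝓘(ℝ, ℝ) ∞ (fun y ↦ v (y, s)) univ := fun y _ ↦
        (hv.comp_contMDiff (f := fun y : M ↦ ((y, s) : M × ℝ)) (contMDiff_id.prodMk contMDiff_const)
          (fun y ↦ ⟨mem_univ _, hsb⟩)).contMDiffAt.contMDiffWithinAt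
      exact ((contMDiffOn_univ.1 h1).of_le h2).contMDiffAt
    have hΔ : g.dalembertian (w s) x = g.dalembertian (W s) x + g.dalembertian (fun y ↦ v (y, s)) x := by
      have := g.dalembertian_add_of_contMDiffAt hWs2 hvs2
      simpa [hwdef, Pi.add_def] using this
    have hGW' := hGW s hs.1 x
    have hveq' := hveq x s hsb
    rw [laplaceBeltrami_eq_dalembertian] at hGW' hveq'
    simp only [hwdef]
    rw [hd, hΔ]
    linarith
  · -- `w² ∈ L¹(M × (0, T))`: `W` is bounded with compact spatial support, `v ∈ L²`
    have hmeasS : MeasurableSet ((univ : Set M) ×ˢ Ioo (0 : ℝ) T) := MeasurableSet.univ.prod measurableSet_Ioo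
    have hvT : Integrable (fun p : M × ℝ ↦ v p ^ 2)
        ((g.riemVolume.prod (volume : Measure ℝ)).restrict (univ ×ˢ Ioo 0 T)) := by
      refine hvL2.mono_measure (Measure.restrict_mono (Set.prod_mono le_rfl (Ioo_subset_Ioo le_rfl ?_)) le_rfl)
      rw [hbdef]; linarith
    obtain ⟨B, hB⟩ := (hK.prod (isCompact_Icc (a := (0 : ℝ)) (b := T))).exists_bound_of_continuousOn
      (f := fun p : M × ℝ ↦ W p.2 p.1) hW.continuous.continuousOn
    have hWbd : ∀ p ∈ (univ : Set M) ×ˢ Ioo (0 : ℝ) T,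
        ‖W p.2 p.1‖ ≤ (K ×ˢ (univ : Set ℝ)).indicator (fun _ ↦ max B 0) p := by
      rintro ⟨x, s⟩ ⟨-, hs⟩
      by_cases hx : x ∈ K
      · rw [indicator_of_mem (show ((x, s) : M × ℝ) ∈ K ×ˢ (univ : Set ℝ) from ⟨hx, mem_univ _⟩)]
        exact (hB (x, s) ⟨hx, Ioo_subset_Icc_self hs⟩).trans (le_max_left _ _)
      · rw [indicator_of_notMem (show ((x, s) : M × ℝ) ∉ K ×ˢ (univ : Set ℝ) from fun h ↦ hx h.1)]
        simp [hWK s x hx]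
    set ν : Measure (M × ℝ) := (g.riemVolume.prod (volume : Measure ℝ)).restrict (univ ×ˢ Ioo 0 T) with hν
    have hKfin : ν (K ×ˢ (univ : Set ℝ)) ≠ (⊤ : ℝ≥0∞) := by
      rw [hν, Measure.restrict_apply (hK.measurableSet.prod MeasurableSet.univ)]
      have h1 : K ×ˢ (univ : Set ℝ) ∩ (univ : Set M) ×ˢ Ioo (0 : ℝ) T = K ×ˢ Ioo (0 : ℝ) T := by
        ext ⟨x, s⟩; simp [mem_prod]
      rw [h1, Measure.prod_prod]
      exact (ENNReal.mul_lt_top (hK.measure_lt_top) measure_Ioo_lt_top).ne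
    have hdom : Integrable (fun p : M × ℝ ↦ ((K ×ˢ (univ : Set ℝ)).indicator (fun _ ↦ max B 0) p) ^ 2 +
        v p ^ 2 + 2 * (((K ×ˢ (univ : Set ℝ)).indicator (fun _ ↦ max B 0) p) * |v p|)) ν := by
      have hI : Integrable (fun p : M × ℝ ↦ (K ×ˢ (univ : Set ℝ)).indicator (fun _ ↦ max B 0) p) ν :=
        (integrableOn_const (C := max B 0) hKfin).integrable_indicator (hK.measurableSet.prod MeasurableSet.univ)
      have hI2 : Integrable (fun p : M × ℝ ↦ ((K ×ˢ (univ : Set ℝ)).indicator (fun _ ↦ max B 0) p) ^ 2) ν := by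
        have : (fun p : M × ℝ ↦ ((K ×ˢ (univ : Set ℝ)).indicator (fun _ ↦ max B 0) p) ^ 2) =
            (K ×ˢ (univ : Set ℝ)).indicator (fun _ ↦ (max B 0) ^ 2) := by
          funext p
          by_cases hp : p ∈ K ×ˢ (univ : Set ℝ)
          · simp [indicator_of_mem hp]
          · simp [indicator_of_notMem hp]
        rw [this]
        exact (integrableOn_const (C := (max B 0) ^ 2) hKfin).integrable_indicator
          (hK.measurableSet.prod MeasurableSet.univ)
      -- `indicator * |v|` is dominated by `indicator² + v²` up to the factor 1/2; use `2ab ≤ a² + b²`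
      have hIv : Integrable (fun p : M × ℝ ↦ ((K ×ˢ (univ : Set ℝ)).indicator (fun _ ↦ max B 0) p) * |v p|) ν := by
        refine (hI2.add hvT).mono' ?_ (Eventually.of_forall fun p ↦ ?_)
        · refine (hI.aestronglyMeasurable.mul ?_)
          have hvc : ContinuousOn v ((univ : Set M) ×ˢ Ioo (0 : ℝ) T) :=
            hv.continuousOn.mono (Set.prod_mono le_rfl fun s hs ↦ by
              simp only [mem_Iio, hbdef]; linarith [hs.2])
          exact (hvc.aestronglyMeasurable hmeasS).norm.congr (Eventually.of_forall fun p ↦ by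
            simp [Real.norm_eq_abs])
        · show ‖(K ×ˢ (univ : Set ℝ)).indicator (fun _ ↦ max B 0) p * |v p|‖ ≤
            ((K ×ˢ (univ : Set ℝ)).indicator (fun _ ↦ max B 0) p) ^ 2 + v p ^ 2
          rw [Real.norm_eq_abs, abs_mul, abs_abs]
          have ha : 0 ≤ (K ×ˢ (univ : Set ℝ)).indicator (fun _ ↦ max B 0) p := by
            by_cases hp : p ∈ K ×ˢ (univ : Set ℝ)
            · simp [indicator_of_mem hp]
            · simp [indicator_of_notMem hp]
          rw [abs_of_nonneg ha]
          nlinarith [sq_nonneg ((K ×ˢ (univ : Set ℝ)).indicator (fun _ ↦ max B 0) p - |v p|), sq_abs (v p)]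
      exact (hI2.add hvT).add (hIv.const_mul 2)
    refine hdom.mono' ?_ ?_
    · have hwc : ContinuousOn (fun p : M × ℝ ↦ w p.2 p.1 ^ 2) ((univ : Set M) ×ˢ Ioo (0 : ℝ) T) :=
        (hws.continuousOn.mono (Set.prod_mono le_rfl fun s hs ↦ by
          simp only [mem_Iio, hbdef]; linarith [hs.2])).pow 2
      exact hwc.aestronglyMeasurable hmeasS
    · rw [hν, ae_restrict_iff' hmeasS]
      refine Eventually.of_forall fun p hp ↦ ?_
      have h1 := hWbd p hp
      rw [Real.norm_eq_abs] at h1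
      rw [Real.norm_eq_abs, abs_pow, hwdef]
      simp only
      have h2 : |W p.2 p.1 + v (p.1, p.2)| ≤ |W p.2 p.1| + |v p| := by
        simpa using abs_add_le (W p.2 p.1) (v (p.1, p.2))
      have h3 : 0 ≤ |W p.2 p.1| := abs_nonneg _
      have h4 : 0 ≤ |v p| := abs_nonneg _
      calc |W p.2 p.1 + v (p.1, p.2)| ^ 2 ≤ (|W p.2 p.1| + |v p|) ^ 2 :=
            pow_le_pow_left₀ (abs_nonneg _) h2 2
        _ ≤ ((K ×ˢ (univ : Set ℝ)).indicator (fun _ ↦ max B 0) p + |v p|) ^ 2 := by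
            apply pow_le_pow_left₀ (by positivity)
            linarith
        _ = ((K ×ˢ (univ : Set ℝ)).indicator (fun _ ↦ max B 0) p) ^ 2 + v p ^ 2 +
              2 * (((K ×ˢ (univ : Set ℝ)).indicator (fun _ ↦ max B 0) p) * |v p|) := by
            rw [add_sq, sq_abs]; ring

end Literature.Geometry.Riemannian.NoncompactShrinkerGapHeat

end Part9

/-!
## Part 10 — port of `Summits/SmoothPoincare4/SmoothPoincare4/Theorems/EntropyRungNoncompactShrinkerGapHeatFlowExistence.lean` (2 declarations kept)

# The weighted heat flow from a compactly perturbed constant on a complete weighted manifold with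
# Laplacian cut-offs

`helper_heatFlowExistence_of` and `helper_heatFlowExistence` (compact-support LSI programme: heat-flow proof of the compact-support logarithmic Sobolev inequality on the complete
shrinker). Setting: `(M, g)` Riemannian, modelled on `ℝⁿ` (Hausdorff, second countable, `T₃` — NOT compact),
`V` smooth with `¼|∇V|² − ½ΔV + λ ≥ 1`, Laplacian cut-offs `η_k` (`|Δη_k| ≤ C`). For `c₀ ∈ ℝ`, `ψ₀ ∈ C_c^∞(M)`
and `T > 0` there is `ρ`, smooth on `M × O` (`O ⊇ [0, T]` open), with `ρ(0) = c₀ + ψ₀`,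
`∂ₛρ = Δρ − g⁻¹(dV, dρ)` on `[0, T]`, and `(ρ − c₀)² e^{-V} ∈ L¹(M × (0, T))`.

Proof: with the potential `Q = ¼|∇V|² − ½ΔV + λ ≥ 1` and the datum `w₀ = e^{-V/2} ψ₀ ∈ C_c^∞`, the flat
corrector (`helper_flatCorrector_noncompact`) and the linear Cauchy problem (`helper_linearHeat_noncompact`) give
`w` smooth on `M × O` with `∂ₛw = Δw − Qw`, `w(0) = w₀`, `w ∈ L²` of the strip; then
`ρ = c₀ + e^{V/2} e^{λs} w`: the time shift removes `λ`, and the conjugation by `e^{V/2}` turns the potential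
`¼|∇V|² − ½ΔV` into the drift (`heatDrift_of_potential`, Literature); finally
`(ρ − c₀)² e^{-V} = e^{2λs} w² ≤ e^{2|λ|T} w²`.

References: F. Trèves, *Basic Linear Partial Differential Equations* (1975), §41 ((41.9): the exponential
shift); D. Bakry, I. Gentil, M. Ledoux (2014), §1.15.7 (the `h`-transform `L = e^{V/2} (Δ − Q) e^{-V/2}`).
-/

section Part10

open scoped _root_.Manifold _root_.ContDiff _root_.ENNReal _root_.NNReal _root_.Topology
open _root_.MeasureTheory _root_.Set _root_.Filter
open Literature.Geometry.Lorentzian Literature.Geometry.Riemannian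

namespace Literature.Geometry.Riemannian.NoncompactShrinkerGapHeat

/-- **Helper `helper_heatFlowExistence_of`** (line `collapsed-ends-usc`, v13; see the module docstring): the
weighted heat flow from `c₀ + ψ₀` GIVEN the flat corrector and the linear Cauchy solver as hypotheses
(exponential shift + conjugation by `e^{V/2}`). [cite: Treves1975, §41, (41.9)] -/
theorem helper_heatFlowExistence_of : ∀ (n : ℕ) (M : Type*) [TopologicalSpace M] [T2Space M] [SecondCountableTopology M] [ChartedSpace (EuclideanSpace ℝ (Fin n)) M] [IsManifold (𝓡 n) ∞ M] [T3Space M] [MeasurableSpace M] [BorelSpace M] (g : PseudoRiemannianMetric (𝓡 n) ∞ (EuclideanSpace ℝ (Fin n)) (TangentSpace (𝓡 n) : M → Type _)) [g.HasLeviCivita] (V : M → ℝ) (lam : ℝ), g.IsRiemannian → ContMDiff (𝓡 n) 𝓘(ℝ, ℝ) ∞ V → (∀ x, 1 ≤ g.gradSq V x / 4 - g.dalembertian V x / 2 + lam) → (∀ (Q : ℝ → M → ℝ), ContMDiff ((𝓡 n).prod 𝓘(ℝ, ℝ)) 𝓘(ℝ, ℝ) ∞ (fun p : M × ℝ ↦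 Q p.2 p.1) → ∀ (w₀ : M → ℝ), ContMDiff (𝓡 n) 𝓘(ℝ, ℝ) ∞ w₀ → HasCompactSupport w₀ → ∃ (W G : ℝ → M → ℝ) (K : Set M), IsCompact K ∧ ContMDiff ((𝓡 n).prod 𝓘(ℝ, ℝ)) 𝓘(ℝ, ℝ) ∞ (fun p : M × ℝ ↦ W p.2 p.1) ∧ ContMDiff ((𝓡 n).prod 𝓘(ℝ, ℝ)) 𝓘(ℝ, ℝ) ∞ (fun p : M × ℝ ↦ G p.2 p.1) ∧ W 0 = w₀ ∧ (∀ s x, x ∉ K → W s x = 0) ∧ (∀ s x, x ∉ K → G s x = 0) ∧ (∀ s, 1 ≤ s → ∀ x, W s x = 0 ∧ G s x = 0) ∧ (∀ s ≤ 0, ∀ x, G s x = 0) ∧ ∀ s, 0 ≤ s → ∀ x, G s x = -(deriv (fun r ↦ W r x) s - (g.laplaceBeltrami (W s) x - Q s x * W s x))) → (∀ (Q : ℝ → M → ℝ), ContMDiff ((𝓡 n).prod 𝓘(ℝ, ℝ)) 𝓘(ℝ, ℝ) ∞ (fun p : M × ℝ ↦ Q p.2 p.1) → (∀ s x, 1 ≤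 Q s x) → ∀ (W G : ℝ → M → ℝ) (K : Set M), IsCompact K → ContMDiff ((𝓡 n).prod 𝓘(ℝ, ℝ)) 𝓘(ℝ, ℝ) ∞ (fun p : M × ℝ ↦ W p.2 p.1) → ContMDiff ((𝓡 n).prod 𝓘(ℝ, ℝ)) 𝓘(ℝ, ℝ) ∞ (fun p : M × ℝ ↦ G p.2 p.1) → (∀ s x, x ∉ K → W s x = 0) → (∀ s x, x ∉ K → G s x = 0) → (∀ s, 1 ≤ s → ∀ x, W s x = 0 ∧ G s x = 0) → (∀ s ≤ 0, ∀ x, G s x = 0) → (∀ s, 0 ≤ s → ∀ x, G s x = -(deriv (fun r ↦ W r x) s - (g.laplaceBeltrami (W s) x - Q s x * W s x))) → ∀ T : ℝ, 0 < T → ∃ (O : Set ℝ) (w : ℝ → M → ℝ), IsOpen O ∧ Icc 0 T ⊆ O ∧ ContMDiffOn ((𝓡 n).prod 𝓘(ℝ, ℝ)) 𝓘(ℝ, ℝ) ∞ (fun p : M × ℝ ↦ w p.2 p.1) (univ ×ˢ O) ∧ (∀ x, w 0 x = W 0 x) ∧ (∀ s ∈ Icc 0 T, ∀ x, deriv (fun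 r ↦ w r x) s = g.dalembertian (w s) x - Q s x * w s x) ∧ Integrable (fun p : M × ℝ ↦ w p.2 p.1 ^ 2) ((g.riemVolume.prod (volume : Measure ℝ)).restrict (univ ×ˢ Ioo 0 T))) → ∀ (c₀ : ℝ) (ψ₀ : M → ℝ), ContMDiff (𝓡 n) 𝓘(ℝ, ℝ) ∞ ψ₀ → HasCompactSupport ψ₀ → ∀ T : ℝ, 0 < T → ∃ (O : Set ℝ) (ρ : ℝ → M → ℝ), IsOpen O ∧ Icc 0 T ⊆ O ∧ ContMDiffOn ((𝓡 n).prod 𝓘(ℝ, ℝ)) 𝓘(ℝ, ℝ) ∞ (fun p : M × ℝ ↦ ρ p.2 p.1) (univ ×ˢ O) ∧ (∀ x, ρ 0 x = c₀ + ψ₀ x) ∧ (∀ s ∈ Icc 0 T, ∀ x, deriv (fun r ↦ ρ r x) s = g.dalembertian (ρ s) x - g.innerDual x (mvfderiv (𝓡 n) V x).toLinearMap (mvfderiv (𝓡 n) (ρ s) x).toLinearMap) ∧ Integrable (fun p : M × ℝ ↦ (ρ p.2 p.1 - c₀) ^ 2 * Real.exp (-V p.1)) ((g.riemVolume.prod (volume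 : Measure ℝ)).restrict (univ ×ˢ Ioo 0 T)) := by
  intro n M _ _ _ _ _ _ _ _ g _ V lam hg hV hlam HFC HLH c₀ ψ₀ hψ hψc T hT
  classical
  -- the potential `Q = ¼|∇V|² − ½ΔV + λ ≥ 1` (time independent)
  set Q : ℝ → M → ℝ := fun _ x ↦ g.gradSq V x / 4 - g.dalembertian V x / 2 + lam with hQdef
  have hQs : ContMDiff ((𝓡 n).prod 𝓘(ℝ, ℝ)) 𝓘(ℝ, ℝ) ∞ (fun p : M × ℝ ↦ Q p.2 p.1) := by
    have h1 : ContMDiff (𝓡 n) 𝓘(ℝ, ℝ) ∞ (fun x ↦ g.gradSq V x / 4 - g.dalembertian V x / 2 + lam) :=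
      (((contMDiff_gradSq g hV).div_const 4).sub ((contMDiff_dalembertian g hV).div_const 2)).add
        contMDiff_const
    exact h1.comp contMDiff_fst
  have hQ1 : ∀ s x, 1 ≤ Q s x := fun s x ↦ hlam x
  -- the datum `w₀ = e^{-V/2} ψ₀`
  set w₀ : M → ℝ := fun x ↦ Real.exp (-(V x / 2)) * ψ₀ x with hw₀def
  have hw₀ : ContMDiff (𝓡 n) 𝓘(ℝ, ℝ) ∞ w₀ :=
    ((contMDiff_iff_contDiff.2 Real.contDiff_exp).comp (hV.div_const 2).neg).mul hψ
  have hw₀c : HasCompactSupport w₀ := hψc.mul_left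
  -- the flat corrector and the linear Cauchy problem
  obtain ⟨W, G, K, hK, hW, hG, hW0, hWK, hGK, hWG1, hG0, hGW⟩ := HFC Q hQs w₀ hw₀ hw₀c
  obtain ⟨O, w, hO, hTO, hws, hw0, hweq, hwL2⟩ :=
    HLH Q hQs hQ1 W G K hK hW hG hWK hGK hWG1 hG0 hGW T hT
  -- the candidate `ρ = c₀ + e^{V/2} e^{λ s} w`
  set u : ℝ → M → ℝ := fun s x ↦ Real.exp (V x / 2) * (Real.exp (lam * s) * w s x) with hudef
  set ρ : ℝ → M → ℝ := fun s x ↦ 1 * u s x + c₀ with hρdef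
  have hus : ContMDiffOn ((𝓡 n).prod 𝓘(ℝ, ℝ)) 𝓘(ℝ, ℝ) ∞ (fun p : M × ℝ ↦ u p.2 p.1) (univ ×ˢ O) := by
    have hE : ContMDiff ((𝓡 n).prod 𝓘(ℝ, ℝ)) 𝓘(ℝ, ℝ) ∞ (fun p : M × ℝ ↦ Real.exp (V p.1 / 2)) :=
      ((contMDiff_iff_contDiff.2 Real.contDiff_exp).comp ((hV.comp contMDiff_fst).div_const 2))
    have hL : ContMDiff ((𝓡 n).prod 𝓘(ℝ, ℝ)) 𝓘(ℝ, ℝ) ∞ (fun p : M × ℝ ↦ Real.exp (lam * p.2)) :=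
      (contMDiff_iff_contDiff.2 Real.contDiff_exp).comp (contMDiff_const.mul contMDiff_snd)
    exact hE.contMDiffOn.mul (hL.contMDiffOn.mul hws)
  have hρs : ContMDiffOn ((𝓡 n).prod 𝓘(ℝ, ℝ)) 𝓘(ℝ, ℝ) ∞ (fun p : M × ℝ ↦ ρ p.2 p.1) (univ ×ˢ O) :=
    (contMDiffOn_const.mul hus).add contMDiffOn_const
  refine ⟨O, ρ, hO, hTO, hρs, fun x ↦ ?_, fun s hs x ↦ ?_, ?_⟩
  · -- `ρ(0) = c₀ + ψ₀`
    have h1 : Real.exp (V x / 2) * Real.exp (-(V x / 2)) = 1 := by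
      rw [← Real.exp_add]; simp
    simp only [hρdef, hudef, hw0, hW0, hw₀def, mul_zero, Real.exp_zero, one_mul]
    calc Real.exp (V x / 2) * (Real.exp (-(V x / 2)) * ψ₀ x) + c₀
        = (Real.exp (V x / 2) * Real.exp (-(V x / 2))) * ψ₀ x + c₀ := by ring
      _ = c₀ + ψ₀ x := by rw [h1]; ring
  · -- the equation: exponential shift, then conjugation by `e^{V/2}`
    have hsO : s ∈ O := hTO hs
    have h2 : (2 : ℕ∞ω) ≤ (∞ : ℕ∞ω) := by norm_cast
    have hslice : ContMDiff (𝓡 n) 𝓘(ℝ, ℝ) ∞ (w s) :=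
      hws.comp_contMDiff (contMDiff_id.prodMk contMDiff_const) fun y ↦ ⟨mem_univ _, hsO⟩
    have hws2 : ContMDiffAt (𝓡 n) 𝓘(ℝ, ℝ) 2 (w s) x := (hslice.of_le h2).contMDiffAt
    -- the shifted function `w̃ = e^{λ s} w`
    set wt : ℝ → M → ℝ := fun r y ↦ Real.exp (lam * r) * w r y with hwtdef
    have hwt2 : ContMDiffAt (𝓡 n) 𝓘(ℝ, ℝ) 2 (wt s) x := (contMDiffAt_const.mul hws2 :)
    have hdw : HasDerivAt (fun r ↦ w r x) (g.dalembertian (w s) x - Q s x * w s x) s := by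
      rw [← hweq s hs x]
      exact CutoffToolkit.hasDerivAt_time hO hws x hsO
    have hdE : HasDerivAt (fun r : ℝ ↦ Real.exp (lam * r)) (lam * Real.exp (lam * s)) s := by
      have := ((hasDerivAt_id s).const_mul lam).exp
      simpa [mul_comm] using this
    have hdwt : HasDerivAt (fun r ↦ wt r x)
        (g.dalembertian (wt s) x - (g.gradSq V x / 4 - g.dalembertian V x / 2) * wt s x) s := by
      have h := hdE.mul hdw
      have hΔ : g.dalembertian (wt s) x = Real.exp (lam * s) * g.dalembertian (w s) x := by
        show g.dalembertian (fun y ↦ Real.exp (lam * s) * w s y) x = _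
        exact g.dalembertian_const_mul_of_contMDiffAt hws2 _
      rw [hΔ]
      refine h.congr_deriv ?_
      simp only [hwtdef, hQdef]
      ring
    have hconj := heatDrift_of_potential g hV (S := univ) hwt2 hdwt.hasDerivWithinAt
    have hdu : HasDerivAt (fun r ↦ u r x)
        (g.dalembertian (u s) x - g.innerDual x (mvfderiv (𝓡 n) V x).toLinearMap
          (mvfderiv (𝓡 n) (u s) x).toLinearMap) s := by
      have h := hconj.hasDerivAt (Filter.univ_mem)
      simpa [hudef, hwtdef] using h
    have hdρ : HasDerivAt (fun r ↦ ρ r x)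
        (1 * (g.dalembertian (u s) x - g.innerDual x (mvfderiv (𝓡 n) V x).toLinearMap
          (mvfderiv (𝓡 n) (u s) x).toLinearMap)) s := by
      have := (hdu.const_mul 1).add_const c₀
      simpa [hρdef] using this
    rw [hdρ.deriv]
    have hu2 : ContMDiffAt (𝓡 n) 𝓘(ℝ, ℝ) 2 (u s) x := by
      have hA : ContMDiffAt (𝓡 n) 𝓘(ℝ, ℝ) 2 (fun y ↦ Real.exp (V y / 2)) x :=
        (((contMDiff_iff_contDiff.2 Real.contDiff_exp).comp (hV.div_const 2)).of_le h2).contMDiffAt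
      exact hA.mul hwt2
    have haff := weightedLaplacian_affine (g := g) (V := V) hu2 1 c₀
    rw [show ρ s = fun y ↦ 1 * u s y + c₀ from rfl, haff]
  · -- `(ρ − c₀)² e^{-V} = e^{2λs} w² ≤ e^{2|λ|T} w²` on the strip
    have hmeasS : MeasurableSet ((univ : Set M) ×ˢ Ioo (0 : ℝ) T) := MeasurableSet.univ.prod measurableSet_Ioo
    refine (hwL2.const_mul (Real.exp (2 * |lam| * T))).mono' ?_ ?_
    · have hsub : (univ : Set M) ×ˢ Ioo (0 : ℝ) T ⊆ univ ×ˢ O :=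
        Set.prod_mono le_rfl fun s hs ↦ hTO (Ioo_subset_Icc_self hs)
      have hρc : ContinuousOn (fun p : M × ℝ ↦ ρ p.2 p.1) ((univ : Set M) ×ˢ Ioo (0 : ℝ) T) :=
        hρs.continuousOn.mono hsub
      have hc : ContinuousOn (fun p : M × ℝ ↦ (ρ p.2 p.1 - c₀) ^ 2 * Real.exp (-V p.1))
          ((univ : Set M) ×ˢ Ioo (0 : ℝ) T) :=
        ((hρc.sub continuousOn_const).pow 2).mul
          (Real.continuous_exp.comp (hV.continuous.comp continuous_fst).neg).continuousOn
      exact hc.aestronglyMeasurable hmeasS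
    · rw [ae_restrict_iff' hmeasS]
      refine Eventually.of_forall fun p hp ↦ ?_
      obtain ⟨-, hs⟩ := hp
      have h1 : (ρ p.2 p.1 - c₀) ^ 2 * Real.exp (-V p.1) = Real.exp (2 * (lam * p.2)) * w p.2 p.1 ^ 2 := by
        simp only [hρdef, hudef]
        have hE : Real.exp (V p.1 / 2) ^ 2 * Real.exp (-V p.1) = 1 := by
          rw [sq, ← Real.exp_add, ← Real.exp_add]
          convert Real.exp_zero using 2
          ring
        have hL : Real.exp (lam * p.2) ^ 2 = Real.exp (2 * (lam * p.2)) := by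
          rw [sq, ← Real.exp_add]
          congr 1
          ring
        calc (1 * (Real.exp (V p.1 / 2) * (Real.exp (lam * p.2) * w p.2 p.1)) + c₀ - c₀) ^ 2 * Real.exp (-V p.1)
            = (Real.exp (V p.1 / 2) ^ 2 * Real.exp (-V p.1)) * (Real.exp (lam * p.2) ^ 2 * w p.2 p.1 ^ 2) := by
              ring
          _ = Real.exp (2 * (lam * p.2)) * w p.2 p.1 ^ 2 := by rw [hE, hL, one_mul]
      rw [Real.norm_eq_abs, h1, abs_of_nonneg (by positivity)]
      refine mul_le_mul_of_nonneg_right (Real.exp_le_exp.2 ?_) (sq_nonneg _)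
      have h3 : lam * p.2 ≤ |lam| * T := by
        calc lam * p.2 ≤ |lam| * p.2 := mul_le_mul_of_nonneg_right (le_abs_self _) hs.1.le
          _ ≤ |lam| * T := mul_le_mul_of_nonneg_left hs.2.le (abs_nonneg _)
      linarith

/-- **Helper `helper_heatFlowExistence`** (line `collapsed-ends-usc`, v13; see the module docstring): the weighted
heat flow `∂ₛρ = Δρ − g⁻¹(dV, dρ)` from `c₀ + ψ₀` on a complete weighted manifold with Laplacian cut-offs and
`¼|∇V|² − ½ΔV + λ ≥ 1` — `helper_heatFlowExistence_of` fed with `helper_flatCorrector_noncompact` and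
`helper_linearHeat_noncompact`. [cite: Treves1975, §41, Thm. 40.1] -/
theorem helper_heatFlowExistence : ∀ (n : ℕ) (M : Type*) [TopologicalSpace M] [T2Space M] [SecondCountableTopology M] [ChartedSpace (EuclideanSpace ℝ (Fin n)) M] [IsManifold (𝓡 n) ∞ M] [T3Space M] [MeasurableSpace M] [BorelSpace M] (g : PseudoRiemannianMetric (𝓡 n) ∞ (EuclideanSpace ℝ (Fin n)) (TangentSpace (𝓡 n) : M → Type _)) [g.HasLeviCivita] (V : M → ℝ) (lam : ℝ), g.IsRiemannian → ContMDiff (𝓡 n) 𝓘(ℝ, ℝ) ∞ V → (∀ x, 1 ≤ g.gradSq V x / 4 - g.dalembertian V x / 2 + lam) → ∀ (η : ℕ → M → ℝ) (C : ℝ), (∀ k, ContMDiff (𝓡 n) 𝓘(ℝ, ℝ) ∞ (η k)) → (∀ k, HasCompactSupport (η k)) → (∀ k x, 0 ≤ η k x ∧ η k x ≤ 1) → (∀ k x, η k x ≤ η (k + 1) x) → (∀ x, ∀ᶠ k in atTop, ∀ᶠ y in 𝓝 x, η k y = 1) → (∀ k x, |g.dalembertian (η k) x| ≤ C) → ∀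 (c₀ : ℝ) (ψ₀ : M → ℝ), ContMDiff (𝓡 n) 𝓘(ℝ, ℝ) ∞ ψ₀ → HasCompactSupport ψ₀ → ∀ T : ℝ, 0 < T → ∃ (O : Set ℝ) (ρ : ℝ → M → ℝ), IsOpen O ∧ Icc 0 T ⊆ O ∧ ContMDiffOn ((𝓡 n).prod 𝓘(ℝ, ℝ)) 𝓘(ℝ, ℝ) ∞ (fun p : M × ℝ ↦ ρ p.2 p.1) (univ ×ˢ O) ∧ (∀ x, ρ 0 x = c₀ + ψ₀ x) ∧ (∀ s ∈ Icc 0 T, ∀ x, deriv (fun r ↦ ρ r x) s = g.dalembertian (ρ s) x - g.innerDual x (mvfderiv (𝓡 n) V x).toLinearMap (mvfderiv (𝓡 n) (ρ s) x).toLinearMap) ∧ Integrable (fun p : M × ℝ ↦ (ρ p.2 p.1 - c₀) ^ 2 * Real.exp (-V p.1)) ((g.riemVolume.prod (volume : Measure ℝ)).restrict (univ ×ˢ Ioo 0 T)) := by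
  intro n M _ _ _ _ _ _ _ _ g _ V lam hg hV hlam η C hηs hηc hη01 hηmono hη1 hηΔ c₀ ψ₀ hψ hψc T hT
  exact helper_heatFlowExistence_of n M g V lam hg hV hlam
    (fun Q hQ w₀ hw₀ hw₀c ↦ helper_flatCorrector_noncompact n M g Q hQ w₀ hw₀ hw₀c)
    (fun Q hQ hQ1 W G K hK hW hG hWK hGK hWG1 hG0 hGW T hT ↦
      helper_linearHeat_noncompact n M g hg η C hηs hηc hη01 hηmono hη1 hηΔ Q hQ hQ1 W G K hK hW hG hWK hGK
        hWG1 hG0 hGW T hT)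
    c₀ ψ₀ hψ hψc T hT

end Literature.Geometry.Riemannian.NoncompactShrinkerGapHeat

end Part10

/-!
## Part 11 — port of `Summits/SmoothPoincare4/SmoothPoincare4/Theorems/EntropyRungNoncompactShrinkerGapHeatGradientDecay.lean` (1 declarations kept)

# Gradient decay `|∇ρ(s)|² ≤ e^{-2Ks} sup|∇ρ₀|²` along the weighted heat flow on a complete weighted
# manifold

`helper_gradientDecay`. Setting as in
`EntropyRungNoncompactShrinkerGapHeatMaxPrinciple.lean` (`M` modelled on `ℝⁿ`, `g` Riemannian,
`V` smooth, `L = Δ_g − g⁻¹(dV, d·)`, cut-offs `η_k` with `|Lη_k| ≤ C`), plus the Bakry–Émery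
condition `Ric + Hess V ≥ K g`. **Theorem.** A solution `ρ` of `∂ₛρ = Lρ` on `[0, T]`, smooth on
`M × O` (`O ⊇ [0,T]` open), with `|∇ρ|² e^{-V} ∈ L¹(M × (0,T))` and `|∇ρ(0)|² ≤ G₀` satisfies
`|∇ρ(s)|² ≤ e^{-2Ks} G₀` on `[0, T]`.

Proof: `z = e^{2Ks}|∇ρ|² − G₀` is smooth on `M × O` (`contMDiffOn_gradSq_family`), a subsolution
(`∂ₛ|∇ρ|² = 2 g⁻¹(dρ, d(Lρ))` — `deriv_gradSq_of_heatFlow_isOpen`, the chart computation of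
`derivWithin_gradSq_of_heatFlow` of `WeightedHeatFlowAPriori.lean` for an open time set — and
`2 g⁻¹(dρ, d(Lρ)) ≤ L|∇ρ|² − 2K|∇ρ|²` by `weightedBochner_pointwise_ge`, while
`L(e^{2Ks}|∇ρ|² − G₀) = e^{2Ks} L|∇ρ|²`), `z(0) ≤ 0`, and `z₊ e^{-V} ≤ e^{2|K|T}|∇ρ|² e^{-V}` is
integrable on the strip; hence `z ≤ 0` by `helper_weightedMaxPrinciple`. (Closed case:
`heatFlow_gradSq_le`; Carrillo–Ni 2009, §3, the `C(K, ∞)` computation, p. 8.)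
-/

section Part11

open scoped _root_.Manifold _root_.ContDiff _root_.ENNReal _root_.NNReal _root_.Topology
open _root_.MeasureTheory _root_.Set _root_.Filter
open Literature.Geometry.Lorentzian Literature.Geometry.Riemannian

namespace Literature.Geometry.Riemannian.NoncompactShrinkerGapHeat

/-! ### Gradient decay along the weighted heat flow on a complete manifold -/

section GradientDecay

variable {n : ℕ} {M : Type*} [TopologicalSpace M] [T2Space M] [SecondCountableTopology M]
  [ChartedSpace (EuclideanSpace ℝ (Fin n)) M] [IsManifold (𝓡 n) ∞ M] [T3Space M]
  [MeasurableSpace M] [BorelSpace M]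
  {g : PseudoRiemannianMetric (𝓡 n) ∞ (EuclideanSpace ℝ (Fin n)) (TangentSpace (𝓡 n) : M → Type _)}
  [g.HasLeviCivita]

end GradientDecay

/-- **Gradient decay `|∇ρ(s)|² ≤ e^{-2Ks} sup|∇ρ₀|²` along the weighted heat flow on a complete
weighted manifold with `Ric + Hess V ≥ K g`** (`helper_gradientDecay`): `z = e^{2Ks}|∇ρ|² − G₀` is a subsolution (`∂ₛ|∇ρ|² = 2g⁻¹(dρ, d(Lρ))
≤ L|∇ρ|² − 2K|∇ρ|²` by `weightedBochner_pointwise_ge`, and `L(e^{2Ks}|∇ρ|² − G₀) = e^{2Ks}L|∇ρ|²`)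
with `z(0) ≤ 0` and `z₊ e^{-V} ≤ e^{2|K|T}|∇ρ|² e^{-V} ∈ L¹` of the strip, so `z ≤ 0` by the weak
maximum principle `helper_weightedMaxPrinciple`. The closed case is `heatFlow_gradSq_le`
(`WeightedHeatFlowAPriori.lean`). [cite: CarrilloNi2009, §3 (C(K,∞), p. 8)] -/
theorem helper_gradientDecay : ∀ (n : ℕ) (M : Type*) [TopologicalSpace M] [T2Space M] [SecondCountableTopology M] [ChartedSpace (EuclideanSpace ℝ (Fin n)) M] [IsManifold (𝓡 n) ∞ M] [T3Space M] [MeasurableSpace M] [BorelSpace M] (g : PseudoRiemannianMetric (𝓡 n) ∞ (EuclideanSpace ℝ (Fin n)) (TangentSpace (𝓡 n) : M → Type _)) [g.HasLeviCivita] (V : M → ℝ) (K : ℝ), g.IsRiemannian → ContMDiff (𝓡 n) 𝓘(ℝ, ℝ) ∞ V → (∀ (x : M) (X : TangentSpace (𝓡 n) x), K * g.val x X X ≤ g.ricci x X X + g.hessian V x X X) → ∀ (η : ℕ → M → ℝ) (C : ℝ), (∀ k, ContMDiff (𝓡 n) 𝓘(ℝ, ℝ) ∞ (η k)) → (∀ k,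 HasCompactSupport (η k)) → (∀ k x, 0 ≤ η k x ∧ η k x ≤ 1) → (∀ k x, η k x ≤ η (k + 1) x) → (∀ x, ∀ᶠ k in atTop, ∀ᶠ y in 𝓝 x, η k y = 1) → (∀ k x, |g.dalembertian (η k) x - g.innerDual x (mvfderiv (𝓡 n) V x).toLinearMap (mvfderiv (𝓡 n) (η k) x).toLinearMap| ≤ C) → ∀ (T : ℝ) (O : Set ℝ) (ρ : ℝ → M → ℝ), 0 < T → IsOpen O → Icc 0 T ⊆ O → ContMDiffOn ((𝓡 n).prod 𝓘(ℝ, ℝ)) 𝓘(ℝ, ℝ) ∞ (fun p : M × ℝ ↦ ρ p.2 p.1) (univ ×ˢ O) → (∀ s ∈ Icc 0 T, ∀ x, deriv (fun r ↦ ρ r x) s = g.dalembertian (ρ s) x - g.innerDual x (mvfderiv (𝓡 n) V x).toLinearMap (mvfderiv (𝓡 n) (ρ s) x).toLinearMap) → Integrable (fun p : M × ℝ ↦ g.gradSq (ρ p.2) p.1 * Real.exp (-V p.1)) ((g.riemVolume.prod (volume : Measure ℝ)).restrict (univ ×ˢ Ioo 0 T)) → ∀ (G₀ : ℝ), (∀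 x, g.gradSq (ρ 0) x ≤ G₀) → ∀ s ∈ Icc 0 T, ∀ x, g.gradSq (ρ s) x ≤ Real.exp (-2 * K * s) * G₀ := by
  intro n M _ _ _ _ _ _ _ _ g _ V K hg hV hRic η C hηs hηc hη01 hηmono hη1 hLη T O ρ hT hO hTO hρ
    heq hint G₀ hG₀ s hs x
  -- the subsolution `z = e^{2Ks} |∇ρ|² − G₀`
  set z : ℝ → M → ℝ := fun r y ↦ Real.exp (2 * K * r) * g.gradSq (ρ r) y + (-G₀) with hz
  have hρs : ∀ r ∈ O, ContMDiff (𝓡 n) 𝓘(ℝ, ℝ) ∞ (ρ r) := fun r hr ↦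
    contMDiff_slice_of_contMDiffOn hρ hr
  have hG₀0 : 0 ≤ G₀ := (g.gradSq_nonneg hg _ x).trans (hG₀ x)
  -- smoothness of `z` on `M × O`
  have hgradfam := contMDiffOn_gradSq_family g hO.uniqueDiffOn hρ
  have hexpfam : ContMDiff ((𝓡 n).prod 𝓘(ℝ, ℝ)) 𝓘(ℝ, ℝ) ∞
      (fun p : M × ℝ ↦ Real.exp (2 * K * p.2)) :=
    (Real.contDiff_exp.comp (contDiff_const.mul contDiff_id)).comp_contMDiff contMDiff_snd
  have hzs : ContMDiffOn ((𝓡 n).prod 𝓘(ℝ, ℝ)) 𝓘(ℝ, ℝ) ∞ (fun p : M × ℝ ↦ z p.2 p.1) (univ ×ˢ O) :=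
    (hexpfam.contMDiffOn.mul hgradfam).add contMDiffOn_const
  -- the subsolution property
  have hsub : ∀ r ∈ Icc 0 T, ∀ y, deriv (fun r' ↦ z r' y) r ≤ g.dalembertian (z r) y -
      g.innerDual y (mvfderiv (𝓡 n) V y).toLinearMap (mvfderiv (𝓡 n) (z r) y).toLinearMap := by
    intro r hr y
    have hrO := hTO hr
    have hgd : HasDerivAt (fun r' ↦ g.gradSq (ρ r') y) (deriv (fun r' ↦ g.gradSq (ρ r') y) r)
        r := by
      have h := hasDerivWithinAt_time_of_contMDiffOn (I := 𝓡 n) (k := ∞) (by simp)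
        (u := fun r' y ↦ g.gradSq (ρ r') y) hgradfam y hrO
      exact (h.hasDerivAt (hO.mem_nhds hrO)).differentiableAt.hasDerivAt
    have hformula := deriv_gradSq_of_heatFlow_isOpen (g := g) hV hO hρ hrO (heq r hr) y
    have hbochner := weightedBochner_pointwise_ge g hg hV hRic (hρs r hrO) y
    have hzd : HasDerivAt (fun r' ↦ z r' y) (Real.exp (2 * K * r) * (2 * K) * g.gradSq (ρ r) y +
        Real.exp (2 * K * r) * deriv (fun r' ↦ g.gradSq (ρ r') y) r) r := by
      have h1 : HasDerivAt (fun r' : ℝ ↦ Real.exp (2 * K * r')) (Real.exp (2 * K * r) * (2 * K))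
          r := by
        have := ((hasDerivAt_id r).const_mul (2 * K)).exp
        simpa using this
      exact (h1.mul hgd).add_const (-G₀)
    rw [hzd.deriv]
    have h2 : ContMDiffAt (𝓡 n) 𝓘(ℝ, ℝ) 2 (g.gradSq (ρ r)) y :=
      ((contMDiff_gradSq g (hρs r hrO)).of_le (WithTop.coe_le_coe.mpr le_top)).contMDiffAt
    have hLz := weightedLaplacian_affine (g := g) (V := V) h2 (Real.exp (2 * K * r)) (-G₀)
    rw [show z r = fun y' ↦ Real.exp (2 * K * r) * g.gradSq (ρ r) y' + (-G₀) from rfl, hLz,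
      hformula]
    have hE := Real.exp_pos (2 * K * r)
    nlinarith [hbochner, hE]
  have hz0 : ∀ y, z 0 y ≤ 0 := by
    intro y
    simp only [hz, mul_zero, Real.exp_zero, one_mul]
    linarith [hG₀ y]
  -- `z₊ e^{-V}` is integrable on the strip
  have hexpc : Continuous fun y ↦ Real.exp (-V y) := Real.continuous_exp.comp hV.continuous.neg
  have hint' : Integrable (fun p : M × ℝ ↦ max (z p.2 p.1) 0 * Real.exp (-V p.1))
      ((g.riemVolume.prod (volume : Measure ℝ)).restrict (univ ×ˢ Ioo 0 T)) := by
    refine (hint.const_mul (Real.exp (2 * |K| * T))).mono' ?_ ?_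
    · have hcont : ContinuousOn (fun p : M × ℝ ↦ max (z p.2 p.1) 0 * Real.exp (-V p.1))
          (univ ×ˢ O) :=
        (hzs.continuousOn.sup continuousOn_const).mul (hexpc.comp continuous_fst).continuousOn
      exact (hcont.mono (prod_mono le_rfl (Ioo_subset_Icc_self.trans hTO))).aestronglyMeasurable
        (MeasurableSet.univ.prod measurableSet_Ioo)
    · refine ae_restrict_of_forall_mem (MeasurableSet.univ.prod measurableSet_Ioo) fun p hp ↦ ?_
      have hs' : p.2 ∈ Ioo 0 T := hp.2
      have hΓ := g.gradSq_nonneg hg (ρ p.2) p.1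
      have hex := Real.exp_pos (-V p.1)
      have hE := Real.exp_pos (2 * K * p.2)
      have hEle : Real.exp (2 * K * p.2) ≤ Real.exp (2 * |K| * T) := by
        refine Real.exp_le_exp.2 ?_
        have h1 : 2 * K * p.2 ≤ 2 * |K| * p.2 := by nlinarith [le_abs_self K, hs'.1]
        have h2 : 2 * |K| * p.2 ≤ 2 * |K| * T := by nlinarith [abs_nonneg K, hs'.2]
        linarith
      have hmax : max (z p.2 p.1) 0 ≤ Real.exp (2 * K * p.2) * g.gradSq (ρ p.2) p.1 :=
        max_le (by simp only [hz]; linarith) (mul_nonneg hE.le hΓ)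
      rw [Real.norm_eq_abs, abs_of_nonneg (mul_nonneg (le_max_right _ _) hex.le)]
      calc max (z p.2 p.1) 0 * Real.exp (-V p.1)
          ≤ (Real.exp (2 * K * p.2) * g.gradSq (ρ p.2) p.1) * Real.exp (-V p.1) :=
            mul_le_mul_of_nonneg_right hmax hex.le
        _ ≤ (Real.exp (2 * |K| * T) * g.gradSq (ρ p.2) p.1) * Real.exp (-V p.1) :=
            mul_le_mul_of_nonneg_right (mul_le_mul_of_nonneg_right hEle hΓ) hex.le
        _ = Real.exp (2 * |K| * T) * (g.gradSq (ρ p.2) p.1 * Real.exp (-V p.1)) := by ring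
  -- the weak maximum principle
  have hmax := helper_weightedMaxPrinciple n M g V hg hV η C hηs hηc hη01 hηmono hη1 hLη T O z hT hO
    hTO hzs hsub hz0 hint' s hs x
  have hle : Real.exp (2 * K * s) * g.gradSq (ρ s) x ≤ G₀ := by
    simp only [hz] at hmax
    linarith
  have hexp : Real.exp (-2 * K * s) * Real.exp (2 * K * s) = 1 := by
    rw [← Real.exp_add]; convert Real.exp_zero using 2; ring
  calc g.gradSq (ρ s) x = Real.exp (-2 * K * s) * (Real.exp (2 * K * s) * g.gradSq (ρ s) x) := by
        rw [← mul_assoc, hexp, one_mul]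
    _ ≤ Real.exp (-2 * K * s) * G₀ := mul_le_mul_of_nonneg_left hle (Real.exp_pos _).le

end Literature.Geometry.Riemannian.NoncompactShrinkerGapHeat

end Part11

/-!
## Part 12 — port of `Summits/SmoothPoincare4/SmoothPoincare4/Theorems/EntropyRungNoncompactShrinkerGapHeatEnergyEstimate.lean` (1 declarations kept)

# The energy estimate `∫₀ᵀ∫ |∇ρ|² e^{-V} ≤ ½ ∫ (ρ₀ − c₀)² e^{-V}` for the weighted heat flow on a
# complete manifold

Setting: `(M, g)` Riemannian, modelled on `ℝⁿ` (Hausdorff, second countable, NOT compact), `V`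
smooth, `L = Δ_g − g⁻¹(dV, d·)`, weight `e^{-V}`; cut-offs `η_k ∈ C_c^∞`, `0 ≤ η_k ≤ 1`, `η_k ↑`,
eventually `= 1` near every point, `|Lη_k| ≤ C`; `ρ` smooth on `M × O`, `O ⊇ [0, T]` open, with
`∂ₛρ = Lρ` on `[0, T]`.

* `two_mul_integral_gradSq_cutoff_eq` — for ONE compactly supported smooth `η` the integrated
  energy identity `2 ∫∫_{M×(0,T)} |∇ρ|² η e^{-V} = E(0) − E(T) + ∫∫_{M×(0,T)} (ρ − c₀)² (Lη) e^{-V}`,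
  `E(s) = ∫ (ρ(s) − c₀)² η e^{-V}`: Leibniz rule with the compactly supported weight `η e^{-V}`,
  the energy identity with a cut-off `2∫ (ρ − c₀) η (Lρ) e^{-V} = −2∫ η|∇ρ|² e^{-V} + ∫ (ρ − c₀)² (Lη) e^{-V}`
  (`CutoffToolkit.integral_sub_mul_cutoff_mul_weightedLaplacian`), the fundamental theorem of
  calculus on `[0, T]` and Fubini on the strip.
* `helper_energyEstimate` — if `(ρ − c₀)² e^{-V}` is integrable on the strip and at `s = 0`, then
  `|∇ρ|² e^{-V}` is integrable on the strip and `∫∫ |∇ρ|² e^{-V} ≤ ½ ∫ (ρ(0) − c₀)² e^{-V}`: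
  with `η = η_k`, `E_k(T) ≥ 0`, `E_k(0) ≤ ∫ (ρ₀ − c₀)² e^{-V}`, the error
  `∫∫ (ρ − c₀)² (Lη_k) e^{-V} → 0` by dominated convergence (`|Lη_k| ≤ C`, `Lη_k → 0` pointwise),
  and `k → ∞` by Fatou / dominated convergence (`η_k ↑ 1`).

Source of the argument: the energy method with cut-offs of J. A. Carrillo, L. Ni, Comm. Anal. Geom.
17 (2009), §4 [CarrilloNi2009]; A. Grigor'yan, *Heat kernel and analysis on manifolds* (2009),
Ch. 7–8 (weighted manifolds, integrated energy identities).
-/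

section Part12

open scoped _root_.Manifold _root_.ContDiff _root_.ENNReal _root_.NNReal _root_.Topology
open _root_.MeasureTheory _root_.Set _root_.Filter
open Literature.Geometry.Lorentzian Literature.Geometry.Riemannian

namespace Literature.Geometry.Riemannian.NoncompactShrinkerGapHeat

open CutoffToolkit

section Energy

variable {n : ℕ} {M : Type*} [TopologicalSpace M] [T2Space M] [SecondCountableTopology M]
  [ChartedSpace (EuclideanSpace ℝ (Fin n)) M] [IsManifold (𝓡 n) ∞ M] [T3Space M]
  [MeasurableSpace M] [BorelSpace M]
  {g : PseudoRiemannianMetric (𝓡 n) ∞ (EuclideanSpace ℝ (Fin n)) (TangentSpace (𝓡 n) : M → Type _)}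
  [g.HasLeviCivita]

/-- **The energy estimate for the weighted heat flow on a complete manifold** (`helper_energyEstimate`): with cut-offs
`η_k ∈ C_c^∞`, `0 ≤ η_k ≤ 1`, `η_k ↑`, eventually `1` near every point, `|Lη_k| ≤ C`, a solution
`ρ` of `∂ₛρ = Lρ` on `[0, T]` (smooth on `M × O`, `O ⊇ [0, T]` open) with `(ρ − c₀)² e^{-V}`
integrable on the strip `M × (0, T)` and at `s = 0` has `|∇ρ|² e^{-V}` integrable on the strip and
`∫∫_{M×(0,T)} |∇ρ|² e^{-V} ≤ ½ ∫ (ρ(0) − c₀)² e^{-V}`. Proof: `two_mul_integral_gradSq_cutoff_eq`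
with `η = η_k`; `E_k(T) ≥ 0`, `E_k(0) ≤ ∫ (ρ₀ − c₀)² e^{-V}`; the error term tends to `0` by
dominated convergence (`|Lη_k| ≤ C`, `Lη_k(x) = 0` for large `k`); `k → ∞` by Fatou and
dominated convergence (`η_k ↑ 1`). [cite: CarrilloNi2009, §4 (integration by parts on the complete soliton)] -/
theorem helper_energyEstimate : ∀ (n : ℕ) (M : Type*) [TopologicalSpace M] [T2Space M] [SecondCountableTopology M] [ChartedSpace (EuclideanSpace ℝ (Fin n)) M] [IsManifold (𝓡 n) ∞ M] [T3Space M] [MeasurableSpace M] [BorelSpace M] (g : PseudoRiemannianMetric (𝓡 n) ∞ (EuclideanSpace ℝ (Fin n)) (TangentSpace (𝓡 n) : M → Type _)) [g.HasLeviCivita] (V : M → ℝ), g.IsRiemannian → ContMDiff (𝓡 n) 𝓘(ℝ, ℝ) ∞ V → ∀ (η : ℕ → M → ℝ) (C : ℝ), (∀ k, ContMDiff (𝓡 n) 𝓘(ℝ, ℝ) ∞ (η k)) → (∀ k, HasCompactSupport (η k)) → (∀ k x, 0 ≤ η k x ∧ η k x ≤ 1) → (∀ k x, η k x ≤ η (k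 + 1) x) → (∀ x, ∀ᶠ k in atTop, ∀ᶠ y in 𝓝 x, η k y = 1) → (∀ k x, |g.dalembertian (η k) x - g.innerDual x (mvfderiv (𝓡 n) V x).toLinearMap (mvfderiv (𝓡 n) (η k) x).toLinearMap| ≤ C) → ∀ (T : ℝ) (O : Set ℝ) (ρ : ℝ → M → ℝ), 0 < T → IsOpen O → Icc 0 T ⊆ O → ContMDiffOn ((𝓡 n).prod 𝓘(ℝ, ℝ)) 𝓘(ℝ, ℝ) ∞ (fun p : M × ℝ ↦ ρ p.2 p.1) (univ ×ˢ O) → (∀ s ∈ Icc 0 T, ∀ x, deriv (fun r ↦ ρ r x) s = g.dalembertian (ρ s) x - g.innerDual x (mvfderiv (𝓡 n) V x).toLinearMap (mvfderiv (𝓡 n) (ρ s) x).toLinearMap) → ∀ (c₀ : ℝ), Integrable (fun p : M × ℝ ↦ (ρ p.2 p.1 - c₀) ^ 2 * Real.exp (-V p.1)) ((g.riemVolume.prod (volume : Measure ℝ)).restrict (univ ×ˢ Ioo 0 T)) → Integrable (fun x ↦ (ρ 0 x - c₀) ^ 2 * Real.exp (-V x)) g.riemVolume → Integrable (fun p : M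 × ℝ ↦ g.gradSq (ρ p.2) p.1 * Real.exp (-V p.1)) ((g.riemVolume.prod (volume : Measure ℝ)).restrict (univ ×ˢ Ioo 0 T)) ∧ ∫ p in univ ×ˢ Ioo 0 T, g.gradSq (ρ p.2) p.1 * Real.exp (-V p.1) ∂(g.riemVolume.prod (volume : Measure ℝ)) ≤ 1 / 2 * ∫ x, (ρ 0 x - c₀) ^ 2 * Real.exp (-V x) ∂g.riemVolume := by
  intro n M _ _ _ _ _ _ _ _ g _ V hg hV η C hηs hηc hη01 _hmono hη1 hLη T O ρ hT hO hTO hρ heq c₀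
    hInt h0
  haveI := CarrilloNi2009_shrinkerLSI.isFiniteMeasureOnCompacts_riemVolume hg
  haveI := sigmaFinite_riemVolume hg
  have h1 : (1 : ℕ∞ω) ≤ (∞ : ℕ∞ω) := WithTop.coe_le_coe.mpr le_top
  have h2 : (2 : ℕ∞ω) ≤ (∞ : ℕ∞ω) := WithTop.coe_le_coe.mpr le_top
  set μ : Measure M := g.riemVolume with hμ
  set ν : Measure (M × ℝ) := (μ.prod (volume : Measure ℝ)).restrict (univ ×ˢ Ioo 0 T) with hν
  set L : ℕ → M → ℝ := fun k x ↦ g.dalembertian (η k) x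
    - g.innerDual x (mvfderiv (𝓡 n) V x).toLinearMap (mvfderiv (𝓡 n) (η k) x).toLinearMap with hL
  set A : ℝ := ∫ x, (ρ 0 x - c₀) ^ 2 * Real.exp (-V x) ∂μ with hA
  set B : ℝ := ∫ p, (ρ p.2 p.1 - c₀) ^ 2 * Real.exp (-V p.1) ∂ν with hB
  set r : ℕ → ℝ := fun k ↦ ∫ p, (ρ p.2 p.1 - c₀) ^ 2 * (L k p.1 * Real.exp (-V p.1)) ∂ν with hr
  set F : M × ℝ → ℝ := fun p ↦ g.gradSq (ρ p.2) p.1 * Real.exp (-V p.1) with hFdef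
  have hec : Continuous fun x ↦ Real.exp (-V x) := Real.continuous_exp.comp hV.continuous.neg
  -- Step 1: the integrated identity for every `k`
  have hid : ∀ k, 2 * ∫ p, g.gradSq (ρ p.2) p.1 * (η k p.1 * Real.exp (-V p.1)) ∂ν =
      ∫ x, (ρ 0 x - c₀) ^ 2 * (η k x * Real.exp (-V x)) ∂μ
        - ∫ x, (ρ T x - c₀) ^ 2 * (η k x * Real.exp (-V x)) ∂μ + r k := fun k ↦
    two_mul_integral_gradSq_cutoff_eq hg hV (hηs k) (hηc k) hT hO hTO hρ heq c₀
  -- Step 2: `E_k(0) ≤ A`, `E_k(T) ≥ 0`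
  have hE0 : ∀ k, ∫ x, (ρ 0 x - c₀) ^ 2 * (η k x * Real.exp (-V x)) ∂μ ≤ A := fun k ↦ by
    refine integral_mono_of_nonneg (Eventually.of_forall fun x ↦ ?_) h0
      (Eventually.of_forall fun x ↦ ?_)
    · exact mul_nonneg (sq_nonneg _) (mul_nonneg (hη01 k x).1 (Real.exp_nonneg _))
    · exact mul_le_mul_of_nonneg_left (mul_le_of_le_one_left (Real.exp_nonneg _) (hη01 k x).2)
        (sq_nonneg _)
  have hET : ∀ k, 0 ≤ ∫ x, (ρ T x - c₀) ^ 2 * (η k x * Real.exp (-V x)) ∂μ := fun k ↦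
    integral_nonneg fun x ↦ mul_nonneg (sq_nonneg _) (mul_nonneg (hη01 k x).1 (Real.exp_nonneg _))
  -- Step 3: the error terms `r k` are dominated by `C (ρ - c₀)² e^{-V}` and tend to `0`
  have hcontρ : ContinuousOn (fun p : M × ℝ ↦ ρ p.2 p.1) (univ ×ˢ Ioo 0 T) :=
    hρ.continuousOn.mono (prod_mono le_rfl (Ioo_subset_Icc_self.trans hTO))
  have hLc : ∀ k, Continuous (L k) := fun k ↦
    (continuous_dalembertian g ((hηs k).of_le h2)).sub
      (continuous_innerDual_mvfderiv g (hV.of_le h1) ((hηs k).of_le h1))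
  have hr_meas : ∀ k, AEStronglyMeasurable
      (fun p : M × ℝ ↦ (ρ p.2 p.1 - c₀) ^ 2 * (L k p.1 * Real.exp (-V p.1))) ν := fun k ↦
    aestronglyMeasurable_strip μ (((hcontρ.sub continuousOn_const).pow 2).mul
      (((hLc k).comp continuous_fst).mul (hec.comp continuous_fst)).continuousOn)
  have hr_bound : ∀ k (p : M × ℝ), ‖(ρ p.2 p.1 - c₀) ^ 2 * (L k p.1 * Real.exp (-V p.1))‖ ≤
      C * ((ρ p.2 p.1 - c₀) ^ 2 * Real.exp (-V p.1)) := fun k p ↦ by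
    rw [Real.norm_eq_abs, abs_mul, abs_mul, abs_of_nonneg (sq_nonneg _),
      abs_of_nonneg (Real.exp_nonneg _)]
    have hC := hLη k p.1
    have h0' : 0 ≤ (ρ p.2 p.1 - c₀) ^ 2 * Real.exp (-V p.1) :=
      mul_nonneg (sq_nonneg _) (Real.exp_nonneg _)
    calc (ρ p.2 p.1 - c₀) ^ 2 * (|L k p.1| * Real.exp (-V p.1))
        = |L k p.1| * ((ρ p.2 p.1 - c₀) ^ 2 * Real.exp (-V p.1)) := by ring
      _ ≤ C * ((ρ p.2 p.1 - c₀) ^ 2 * Real.exp (-V p.1)) := mul_le_mul_of_nonneg_right hC h0'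
  have hdom : Integrable (fun p : M × ℝ ↦ C * ((ρ p.2 p.1 - c₀) ^ 2 * Real.exp (-V p.1))) ν :=
    hInt.const_mul C
  have hr_tendsto : Tendsto r atTop (𝓝 0) := by
    have hlim : ∀ p : M × ℝ, Tendsto (fun k ↦ (ρ p.2 p.1 - c₀) ^ 2 * (L k p.1 * Real.exp (-V p.1)))
        atTop (𝓝 0) := fun p ↦ by
      refine tendsto_const_nhds.congr' ?_
      filter_upwards [weightedLaplacian_cutoff_eventually_eq_zero (g := g) (V := V) hη1 p.1] with k hk
      rw [show L k p.1 = 0 from hk, zero_mul, mul_zero]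
    have h := tendsto_integral_of_dominated_convergence
      (fun p : M × ℝ ↦ C * ((ρ p.2 p.1 - c₀) ^ 2 * Real.exp (-V p.1))) hr_meas hdom
      (fun k ↦ Eventually.of_forall (hr_bound k)) (Eventually.of_forall hlim)
    simpa [hr] using h
  have hr_le : ∀ k, r k ≤ C * B := fun k ↦ by
    calc r k ≤ ‖r k‖ := Real.le_norm_self _
      _ ≤ ∫ p, ‖(ρ p.2 p.1 - c₀) ^ 2 * (L k p.1 * Real.exp (-V p.1))‖ ∂ν :=
          norm_integral_le_integral_norm _
      _ ≤ ∫ p, C * ((ρ p.2 p.1 - c₀) ^ 2 * Real.exp (-V p.1)) ∂ν :=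
          integral_mono_of_nonneg (Eventually.of_forall fun p ↦ norm_nonneg _) hdom
            (Eventually.of_forall (hr_bound k))
      _ = C * B := integral_const_mul _ _
  -- Step 4: `∫ η_k F ≤ (A + r k) / 2 ≤ (A + C B) / 2`
  have hI_le : ∀ k, ∫ p, η k p.1 * F p ∂ν ≤ (A + r k) / 2 := fun k ↦ by
    have e : ∫ p, η k p.1 * F p ∂ν = ∫ p, g.gradSq (ρ p.2) p.1 * (η k p.1 * Real.exp (-V p.1)) ∂ν :=
      integral_congr_ae (Eventually.of_forall fun p ↦ by simp only [hFdef]; ring)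
    rw [e]
    linarith [hid k, hE0 k, hET k]
  -- Step 5: Fatou gives the integrability of `F = |∇ρ|² e^{-V}` on the strip
  have hgradc : ContinuousOn (fun p : M × ℝ ↦ g.gradSq (ρ p.2) p.1) (univ ×ˢ O) :=
    (contMDiffOn_gradSq_family g hO.uniqueDiffOn hρ).continuousOn
  have hFm : AEStronglyMeasurable F ν :=
    aestronglyMeasurable_strip μ ((hgradc.mono (prod_mono le_rfl (Ioo_subset_Icc_self.trans hTO))).mul
      (hec.comp continuous_fst).continuousOn)
  have hF0 : ∀ p, 0 ≤ F p := fun p ↦ mul_nonneg (g.gradSq_nonneg hg _ _) (Real.exp_nonneg _)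
  have hχF : ∀ k, Integrable (fun p : M × ℝ ↦ η k p.1 * F p) ν := fun k ↦ by
    have hwk : Continuous fun x ↦ η k x * Real.exp (-V x) := (hηs k).continuous.mul hec
    have hwkc : HasCompactSupport fun x ↦ η k x * Real.exp (-V x) := (hηc k).mul_right
    have h := integrable_strip_mul_of_hasCompactSupport μ (hgradc.mono (prod_mono le_rfl hTO))
      hwk hwkc
    exact h.congr (Eventually.of_forall fun p ↦ by simp only [hFdef]; ring)
  have hFint : Integrable F ν :=
    CarrilloNi2009_shrinkerLSI.integrable_of_forall_integral_cutoff_mul_le hFm hF0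
      (fun k p ↦ (hη01 k p.1).1) hχF (fun p ↦ tendsto_cutoff hη1 p.1) (K := (A + C * B) / 2)
      fun k ↦ (hI_le k).trans (by linarith [hr_le k])
  -- Step 6: `∫ η_k F → ∫ F` (dominated convergence) and the bound
  have hI_tendsto : Tendsto (fun k ↦ ∫ p, η k p.1 * F p ∂ν) atTop (𝓝 (∫ p, F p ∂ν)) := by
    refine tendsto_integral_of_dominated_convergence F (fun k ↦ (hχF k).aestronglyMeasurable) hFint
      (fun k ↦ Eventually.of_forall fun p ↦ ?_) (Eventually.of_forall fun p ↦ ?_)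
    · rw [Real.norm_eq_abs, abs_of_nonneg (mul_nonneg (hη01 k p.1).1 (hF0 p))]
      exact mul_le_of_le_one_left (hF0 p) (hη01 k p.1).2
    · simpa using (tendsto_cutoff hη1 p.1).mul_const (F p)
  have hb_tendsto : Tendsto (fun k ↦ (A + r k) / 2) atTop (𝓝 ((A + 0) / 2)) :=
    (tendsto_const_nhds.add hr_tendsto).div_const 2
  have hfinal : ∫ p, F p ∂ν ≤ (A + 0) / 2 := le_of_tendsto_of_tendsto' hI_tendsto hb_tendsto hI_le
  refine ⟨hFint, ?_⟩
  have hgoal : ∫ p, F p ∂ν ≤ 1 / 2 * A := by linarith [hfinal]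
  simpa only [hFdef] using hgoal

end Energy

end Literature.Geometry.Riemannian.NoncompactShrinkerGapHeat

end Part12

/-!
## Part 13 — port of `Summits/SmoothPoincare4/SmoothPoincare4/Theorems/EntropyRungNoncompactShrinkerGapHeatMassConservation.lean` (1 declarations kept)

# Conservation of mass for the weighted heat flow on a complete manifold

Setting: `(M, g)` Riemannian, modelled on `ℝⁿ` (Hausdorff, second countable, NOT compact), `V`
smooth with `e^{-V}` integrable, `L = Δ_g − g⁻¹(dV, d·)`; cut-offs `η_k ∈ C_c^∞`, `0 ≤ η_k ≤ 1`,
eventually `= 1` near every point, `|Lη_k| ≤ C`; `ρ` smooth on `M × O`, `O ⊇ [0, T]` open,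
`∂ₛρ = Lρ` on `[0, T]`, `|ρ| ≤ B` there. Then `∫ ρ(s) e^{-V} = ∫ ρ(0) e^{-V}` for `s ∈ [0, T]`.

Proof (`abs_integral_cutoff_sub_le`, `helper_massConservation`): with
`F_k(s) = ∫ ρ(s) η_k e^{-V}`, the Leibniz rule against the compactly supported weight `η_k e^{-V}`
and `∫ η_k (Lρ) e^{-V} = ∫ ρ (Lη_k) e^{-V}` (`CutoffToolkit.integral_cutoff_mul_weightedLaplacian`)
give `|F_k'| ≤ B ∫ |Lη_k| e^{-V}`, hence `|F_k(s) − F_k(0)| ≤ s B ∫ |Lη_k| e^{-V} → 0` (dominated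
convergence: `|Lη_k| ≤ C`, `Lη_k → 0` pointwise, `e^{-V} ∈ L¹`), while `F_k(s) → ∫ ρ(s) e^{-V}`
(dominated by `B e^{-V}`). Closed-manifold model: `heatFlow_integral_eq`
(`WeightedHeatFlowAPriori.lean`). Source: J. A. Carrillo, L. Ni, Comm. Anal. Geom. 17 (2009),
§3 (3.1)–(3.2) and §4 (cut-off integrations by parts) [CarrilloNi2009].
-/

section Part13

open scoped _root_.Manifold _root_.ContDiff _root_.ENNReal _root_.NNReal _root_.Topology
open _root_.MeasureTheory _root_.Set _root_.Filter
open Literature.Geometry.Lorentzian Literature.Geometry.Riemannian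

namespace Literature.Geometry.Riemannian.NoncompactShrinkerGapHeat

open CutoffToolkit

section Mass

variable {n : ℕ} {M : Type*} [TopologicalSpace M] [T2Space M] [SecondCountableTopology M]
  [ChartedSpace (EuclideanSpace ℝ (Fin n)) M] [IsManifold (𝓡 n) ∞ M] [T3Space M]
  [MeasurableSpace M] [BorelSpace M]
  {g : PseudoRiemannianMetric (𝓡 n) ∞ (EuclideanSpace ℝ (Fin n)) (TangentSpace (𝓡 n) : M → Type _)}
  [g.HasLeviCivita]

/-- **Conservation of mass for the weighted heat flow on a complete manifold** (`helper_massConservation`): with `e^{-V} ∈ L¹`,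
cut-offs `η_k ∈ C_c^∞`, `0 ≤ η_k ≤ 1`, eventually `1` near every point, `|Lη_k| ≤ C`, and a
bounded solution `ρ` of `∂ₛρ = Lρ` on `[0, T]`, `∫ ρ(s) e^{-V} dV = ∫ ρ(0) e^{-V} dV` for
`s ∈ [0, T]`: `abs_integral_cutoff_sub_le` with `η = η_k`, `∫ |Lη_k| e^{-V} → 0` and
`∫ ρ(s) η_k e^{-V} → ∫ ρ(s) e^{-V}` by dominated convergence. [cite: CarrilloNi2009, §3 (3.1)–(3.2)] -/
theorem helper_massConservation : ∀ (n : ℕ) (M : Type*) [TopologicalSpace M] [T2Space M] [SecondCountableTopology M] [ChartedSpace (EuclideanSpace ℝ (Fin n)) M] [IsManifold (𝓡 n) ∞ M] [T3Space M] [MeasurableSpace M] [BorelSpace M] (g : PseudoRiemannianMetric (𝓡 n) ∞ (EuclideanSpace ℝ (Fin n)) (TangentSpace (𝓡 n) : M → Type _)) [g.HasLeviCivita] (V : M → ℝ), g.IsRiemannian → ContMDiff (𝓡 n) 𝓘(ℝ, ℝ) ∞ V → Integrable (fun x ↦ Real.exp (-V x)) g.riemVolume → ∀ (η : ℕ → M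 → ℝ) (C : ℝ), (∀ k, ContMDiff (𝓡 n) 𝓘(ℝ, ℝ) ∞ (η k)) → (∀ k, HasCompactSupport (η k)) → (∀ k x, 0 ≤ η k x ∧ η k x ≤ 1) → (∀ k x, η k x ≤ η (k + 1) x) → (∀ x, ∀ᶠ k in atTop, ∀ᶠ y in 𝓝 x, η k y = 1) → (∀ k x, |g.dalembertian (η k) x - g.innerDual x (mvfderiv (𝓡 n) V x).toLinearMap (mvfderiv (𝓡 n) (η k) x).toLinearMap| ≤ C) → ∀ (T : ℝ) (O : Set ℝ) (ρ : ℝ → M → ℝ), 0 < T → IsOpen O → Icc 0 T ⊆ O → ContMDiffOn ((𝓡 n).prod 𝓘(ℝ, ℝ)) 𝓘(ℝ, ℝ) ∞ (fun p : M × ℝ ↦ ρ p.2 p.1) (univ ×ˢ O) → (∀ s ∈ Icc 0 T, ∀ x, deriv (fun r ↦ ρ r x) s = g.dalembertian (ρ s) x - g.innerDual x (mvfderiv (𝓡 n) V x).toLinearMap (mvfderiv (𝓡 n) (ρ s) x).toLinearMap) → ∀ (B : ℝ), (∀ s ∈ Icc 0 T, ∀ x, |ρ s x| ≤ B) → ∀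 s ∈ Icc 0 T, ∫ x, ρ s x * Real.exp (-V x) ∂g.riemVolume = ∫ x, ρ 0 x * Real.exp (-V x) ∂g.riemVolume := by
  intro n M _ _ _ _ _ _ _ _ g _ V hg hV hVint η C hηs hηc hη01 _hmono hη1 hLη T O ρ hT hO hTO hρ heq
    B hB s hs
  haveI := CarrilloNi2009_shrinkerLSI.isFiniteMeasureOnCompacts_riemVolume hg
  have h1 : (1 : ℕ∞ω) ≤ (∞ : ℕ∞ω) := WithTop.coe_le_coe.mpr le_top
  have h2 : (2 : ℕ∞ω) ≤ (∞ : ℕ∞ω) := WithTop.coe_le_coe.mpr le_top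
  set μ : Measure M := g.riemVolume with hμ
  set L : ℕ → M → ℝ := fun k x ↦ g.dalembertian (η k) x
    - g.innerDual x (mvfderiv (𝓡 n) V x).toLinearMap (mvfderiv (𝓡 n) (η k) x).toLinearMap with hL
  have hec : Continuous fun x ↦ Real.exp (-V x) := Real.continuous_exp.comp hV.continuous.neg
  have hLc : ∀ k, Continuous (L k) := fun k ↦
    (continuous_dalembertian g ((hηs k).of_le h2)).sub
      (continuous_innerDual_mvfderiv g (hV.of_le h1) ((hηs k).of_le h1))
  have hslice : ∀ r ∈ O, ContMDiff (𝓡 n) 𝓘(ℝ, ℝ) ∞ (ρ r) := fun r hr ↦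
    contMDiff_slice_of_contMDiffOn hρ hr
  have h0T : (0 : ℝ) ∈ Icc 0 T := ⟨le_rfl, hT.le⟩
  -- `|Lη_k| e^{-V}` is dominated by `C e^{-V}` and tends to `0`
  have hLbd : ∀ k x, ‖|L k x| * Real.exp (-V x)‖ ≤ C * Real.exp (-V x) := fun k x ↦ by
    rw [Real.norm_eq_abs, abs_mul, abs_abs, abs_of_nonneg (Real.exp_nonneg _)]
    exact mul_le_mul_of_nonneg_right (hLη k x) (Real.exp_nonneg _)
  have hLm : ∀ k, AEStronglyMeasurable (fun x ↦ |L k x| * Real.exp (-V x)) μ := fun k ↦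
    ((continuous_abs.comp (hLc k)).mul hec).aestronglyMeasurable
  have hLi : ∀ k, Integrable (fun x ↦ |L k x| * Real.exp (-V x)) μ := fun k ↦
    (hVint.const_mul C).mono' (hLm k) (Eventually.of_forall (hLbd k))
  have hLt : Tendsto (fun k ↦ ∫ x, |L k x| * Real.exp (-V x) ∂μ) atTop (𝓝 0) := by
    have hlim : ∀ x, Tendsto (fun k ↦ |L k x| * Real.exp (-V x)) atTop (𝓝 0) := fun x ↦ by
      refine tendsto_const_nhds.congr' ?_
      filter_upwards [weightedLaplacian_cutoff_eventually_eq_zero (g := g) (V := V) hη1 x] with k hk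
      rw [show L k x = 0 from hk, abs_zero, zero_mul]
    have h := tendsto_integral_of_dominated_convergence (fun x ↦ C * Real.exp (-V x)) hLm
      (hVint.const_mul C) (fun k ↦ Eventually.of_forall (hLbd k)) (Eventually.of_forall hlim)
    simpa using h
  -- Step 1: `|F_k(s) - F_k(0)| ≤ (B ∫ |Lη_k| e^{-V}) s`
  have hstep : ∀ k, |(∫ x, ρ s x * (η k x * Real.exp (-V x)) ∂μ)
      - ∫ x, ρ 0 x * (η k x * Real.exp (-V x)) ∂μ| ≤
        (B * ∫ x, |L k x| * Real.exp (-V x) ∂μ) * s := fun k ↦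
    abs_integral_cutoff_sub_le hg hV (hηs k) (hηc k) hO hTO hρ heq hB (hLi k) hs
  -- Step 2: `F_k(r) → ∫ ρ(r) e^{-V}` for `r ∈ [0, T]`
  have hconv : ∀ r ∈ Icc 0 T, Tendsto (fun k ↦ ∫ x, ρ r x * (η k x * Real.exp (-V x)) ∂μ) atTop
      (𝓝 (∫ x, ρ r x * Real.exp (-V x) ∂μ)) := by
    intro r hr
    refine tendsto_integral_of_dominated_convergence (fun x ↦ B * Real.exp (-V x))
      (fun k ↦ ((hslice r (hTO hr)).continuous.mul ((hηs k).continuous.mul hec)).aestronglyMeasurable)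
      (hVint.const_mul B) (fun k ↦ Eventually.of_forall fun x ↦ ?_) (Eventually.of_forall fun x ↦ ?_)
    · rw [Real.norm_eq_abs, abs_mul, abs_mul, abs_of_nonneg (hη01 k x).1,
        abs_of_nonneg (Real.exp_nonneg _)]
      calc |ρ r x| * (η k x * Real.exp (-V x)) ≤ |ρ r x| * Real.exp (-V x) :=
            mul_le_mul_of_nonneg_left (mul_le_of_le_one_left (Real.exp_nonneg _) (hη01 k x).2)
              (abs_nonneg _)
        _ ≤ B * Real.exp (-V x) := mul_le_mul_of_nonneg_right (hB r hr x) (Real.exp_nonneg _)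
    · simpa using ((tendsto_cutoff hη1 x).mul_const (Real.exp (-V x))).const_mul (ρ r x)
  -- Step 3: the limit of `F_k(s) - F_k(0)` is both `∫ ρ(s) e^{-V} - ∫ ρ(0) e^{-V}` and `0`
  have ha : Tendsto (fun k ↦ (∫ x, ρ s x * (η k x * Real.exp (-V x)) ∂μ)
      - ∫ x, ρ 0 x * (η k x * Real.exp (-V x)) ∂μ) atTop
      (𝓝 ((∫ x, ρ s x * Real.exp (-V x) ∂μ) - ∫ x, ρ 0 x * Real.exp (-V x) ∂μ)) :=
    (hconv s hs).sub (hconv 0 h0T)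
  have ha0 : Tendsto (fun k ↦ (∫ x, ρ s x * (η k x * Real.exp (-V x)) ∂μ)
      - ∫ x, ρ 0 x * (η k x * Real.exp (-V x)) ∂μ) atTop (𝓝 0) := by
    refine squeeze_zero_norm (a := fun k ↦ (B * ∫ x, |L k x| * Real.exp (-V x) ∂μ) * s)
      (fun k ↦ ?_) ?_
    · rw [Real.norm_eq_abs]
      exact hstep k
    · simpa using (hLt.const_mul B).mul_const s
  exact sub_eq_zero.mp (tendsto_nhds_unique ha ha0)

end Mass

end Literature.Geometry.Riemannian.NoncompactShrinkerGapHeat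

end Part13

/-!
## Part 14 — port of `Summits/SmoothPoincare4/SmoothPoincare4/Theorems/EntropyRungNoncompactShrinkerGapCarrilloNiClauses.lean` (3 declarations kept)

# Helper `helper_carrilloNi_clauses_i_iii`: Carrillo–Ni 2009, Thm. 1.1 (i),
# the sharpness clause (iii), and `μ(g, 1) ≤ log Θ` — UNCONDITIONALLY on every complete gradient shrinker

On a complete connected gradient shrinking Ricci soliton `(Mⁿ, g, f)` of any dimension
(`Ric + Hess f = g/2`, normalised by `R + |∇f|² = f`, closed `g`-balls compact), with
`Θ = (4π)^{-n/2} ∫ e^{-f} dV`: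
* (i) `e^{-f} ∈ L¹(dV)` and the shift `f + log Θ` is compatible (`∫ (4π)^{-n/2} e^{-(f + log Θ)} = 1`);
* (iii) `𝒲(g, f + log Θ, 1) = log Θ`;
* `μ(g, 1) ≤ log Θ`.
This is VERBATIM the conclusion of the tree's
`CarrilloNi2009_shrinkerLSI.clauses_i_iii_of_proper` (`ShrinkerEntropyProofs.lean`), whose two
extra inputs are theorems of the tree:
* `R ≥ 0` on every complete connected gradient shrinker — Zhang 2009 / Chen 2009 / Haslhofer–Müller
  (2.6), DISCHARGED as `shrinkerScalarCurvature_nonneg_holds` (`ShrinkerScalarCurvatureNonnegHolds.lean`);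
* properness of `f` — from `R ≥ 0`: a minimum point `p` of `f` and the lower quadratic growth
  `¼(d(p, x) − 5n)₊² ≤ f(x)` (Haslhofer–Müller 2011, Lemma 2.1:
  `HaslhoferMuller.exists_forall_potential_le`, `HaslhoferMuller.potential_lower_of_scalarCurvature_nonneg`,
  `ShrinkerPotentialGrowthProofs.lean`; the regularity instances of the smooth Levi-Civita connection
  from `isLocallyContMDiff_leviCivita_holds`), whence `{f ≤ R}` is compact
  (`NoncompactShrinkerGapCompactSupportLSI.isCompact_sublevel_of_growth`).
Two documented entry points ride along: `carrilloNi_integrable_exp_neg` (clause (i) alone) and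
`carrilloNi_muEntropy_le_log` (`μ(g, 1) ≤ log Θ` alone). Everything here is proved; no definition
and no named fact is introduced.

## References

* [CarrilloNi2009] J. Carrillo, L. Ni, Comm. Anal. Geom. 17 (2009) 721–753, Thm. 1.1 (i), §4, Cor. 4.1.
* [HaslhoferMuller2011] R. Haslhofer, R. Müller, GAFA 21 (2011) 1091–1116, §2 (2.6), Lemma 2.1.
* [Zhang2009] Z.-H. Zhang, Proc. AMS 137 (2009) 2755–2759, Thm. 1.3 (ii).
-/

section Part14

open scoped _root_.Manifold _root_.ContDiff _root_.ENNReal _root_.NNReal _root_.Topology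
open _root_.MeasureTheory _root_.Set _root_.Filter
open Literature.Geometry.Lorentzian Literature.Geometry.Riemannian

namespace Literature.Geometry.Riemannian.NoncompactShrinkerGapCarrilloNiClauses

open Literature.Geometry.Riemannian.NoncompactShrinkerGapCompactSupportLSI

/-! ## Properness of the potential (any dimension) -/

section Shrinker

variable {n : ℕ} {M : Type} [TopologicalSpace M] [T2Space M] [SecondCountableTopology M]
  [ChartedSpace (EuclideanSpace ℝ (Fin n)) M] [IsManifold (𝓡 n) ∞ M] [ConnectedSpace M]
  [T3Space M] [MeasurableSpace M] [BorelSpace M]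

/-- **The potential of a complete gradient shrinker is proper, and `R ≥ 0`** (Haslhofer–Müller
2011, (2.6) and Lemma 2.1), any dimension `n`: on a complete connected gradient shrinker
normalised by `R + |∇f|² = f`, `R ≥ 0` (`shrinkerScalarCurvature_nonneg_holds`), `M` is nonempty
(a minimum point `p` of `f`, `HaslhoferMuller.exists_forall_potential_le`), and every sub-level set
`{f ≤ R}` is compact — by the lower growth `¼(d(p, ·) − 5n)₊² ≤ f`
(`HaslhoferMuller.potential_lower_of_scalarCurvature_nonneg`) and
`isCompact_sublevel_of_growth`. [cite: HaslhoferMuller2011, §2 (2.6) and Lemma 2.1 (p. 5)] -/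
theorem scalarCurvature_nonneg_and_isCompact_sublevel
    (g : PseudoRiemannianMetric (𝓡 n) ∞ (EuclideanSpace ℝ (Fin n)) (TangentSpace (𝓡 n) : M → Type _))
    [g.HasLeviCivita] (f : M → ℝ) (hg : g.IsRiemannian)
    (hc : ∀ (x : M) (r : NNReal), IsCompact {y : M | g.edist hg x y ≤ r})
    (hf : ContMDiff (𝓡 n) 𝓘(ℝ, ℝ) ∞ f)
    (hsol : ∀ (x : M) (X Y : TangentSpace (𝓡 n) x),
      g.ricci x X Y + g.hessian f x X Y = (1 / 2 : ℝ) * g.val x X Y)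
    (hnorm : ∀ x : M, g.scalarCurvature x + g.gradSq f x = f x) :
    (∀ x : M, 0 ≤ g.scalarCurvature x) ∧ Nonempty M ∧ ∀ R : ℝ, IsCompact {x | f x ≤ R} := by
  classical
  -- adapted from `CollapsedEndsUsc.integrable_exp_neg_of_nonneg` (line skeleton v8)
  have hS0 : ∀ x, 0 ≤ g.scalarCurvature x :=
    shrinkerScalarCurvature_nonneg_holds n M g f hg hc hf hsol hnorm
  have hk1 : ((1 : ℕ∞) : ℕ∞ω) + 1 ≤ (∞ : ℕ∞ω) := by
    rw [show ((1 : ℕ∞) : ℕ∞ω) + 1 = 2 by norm_num]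
    exact WithTop.coe_le_coe.2 le_top
  haveI : CovariantDerivative.ContMDiffCovariantDerivative g.leviCivita 1 :=
    ⟨g.isLocallyContMDiff_leviCivita_holds 1 hk1 univ isOpen_univ⟩
  haveI : CovariantDerivative.ContMDiffCovariantDerivative g.leviCivita ∞ :=
    ⟨g.isLocallyContMDiff_leviCivita_holds ⊤ (le_of_eq rfl) univ isOpen_univ⟩
  have hgrad : ∀ x, g.gradSq f x ≤ f x := fun x ↦ by linarith [hS0 x, hnorm x]
  obtain ⟨p, hp⟩ := HaslhoferMuller.exists_forall_potential_le g hg hc hf hgrad hsol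
  have hlow : ∀ (x : M) (r : NNReal), (r : ℝ≥0∞) ≤ g.edist hg p x →
      (1 / 4 : ℝ) * (max ((r : ℝ) - 5 * n) 0) ^ 2 ≤ f x := fun x r hr ↦ by
    have h := HaslhoferMuller.potential_lower_of_scalarCurvature_nonneg g hg hc hf hsol hnorm
      hS0 hp x r hr
    rwa [finrank_euclideanSpace_fin] at h
  exact ⟨hS0, ⟨p⟩, isCompact_sublevel_of_growth hg hf.continuous hc hlow⟩

/-- **Carrillo–Ni 2009, Thm. 1.1 (i), (iii) and `μ(g, 1) ≤ log Θ`, unconditionally** (any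
dimension `n`, explicit hypotheses): on a complete connected normalised gradient shrinker,
`e^{-f} ∈ L¹`, the shift `f + log Θ` is compatible, `𝒲(g, f + log Θ, 1) = log Θ`, and
`μ(g, 1) ≤ log Θ`, where `Θ = (4π)^{-n/2} ∫ e^{-f} dV`. Proof: `R ≥ 0` and properness of `f`
(`scalarCurvature_nonneg_and_isCompact_sublevel`), then
`CarrilloNi2009_shrinkerLSI.clauses_i_iii_of_proper` with `B = 0`.
[cite: CarrilloNi2009, Thm. 1.1 (i), §4 and Cor. 4.1] -/
theorem clauses_i_iii
    (g : PseudoRiemannianMetric (𝓡 n) ∞ (EuclideanSpace ℝ (Fin n)) (TangentSpace (𝓡 n) : M → Type _))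
    [g.HasLeviCivita] (f : M → ℝ) (hg : g.IsRiemannian)
    (hc : ∀ (x : M) (r : NNReal), IsCompact {y : M | g.edist hg x y ≤ r})
    (hf : ContMDiff (𝓡 n) 𝓘(ℝ, ℝ) ∞ f)
    (hsol : ∀ (x : M) (X Y : TangentSpace (𝓡 n) x),
      g.ricci x X Y + g.hessian f x X Y = (1 / 2 : ℝ) * g.val x X Y)
    (hnorm : ∀ x : M, g.scalarCurvature x + g.gradSq f x = f x) :
    Integrable (fun x ↦ Real.exp (-f x)) g.riemVolume ∧
    g.IsEntropyCompatible (fun y ↦ f y +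
        Real.log ((4 * Real.pi) ^ (-(n : ℝ) / 2) * ∫ x, Real.exp (-f x) ∂g.riemVolume)) 1 ∧
    g.wEntropy g.leviCivita (fun y ↦ f y +
        Real.log ((4 * Real.pi) ^ (-(n : ℝ) / 2) * ∫ x, Real.exp (-f x) ∂g.riemVolume)) 1 =
      Real.log ((4 * Real.pi) ^ (-(n : ℝ) / 2) * ∫ x, Real.exp (-f x) ∂g.riemVolume) ∧
    g.muEntropy g.leviCivita 1 ≤
      ((Real.log ((4 * Real.pi) ^ (-(n : ℝ) / 2) * ∫ x, Real.exp (-f x) ∂g.riemVolume) : ℝ) :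
        EReal) := by
  obtain ⟨hS0, hne, hprop⟩ := scalarCurvature_nonneg_and_isCompact_sublevel g f hg hc hf hsol hnorm
  exact CarrilloNi2009_shrinkerLSI.clauses_i_iii_of_proper hg hf hsol hnorm hprop (B := 0)
    (fun x ↦ by rw [neg_zero]; exact hS0 x)

end Shrinker

/-! ## The -/

section Corollaries

variable {n : ℕ} {M : Type} [TopologicalSpace M] [T2Space M] [SecondCountableTopology M]
  [ChartedSpace (EuclideanSpace ℝ (Fin n)) M] [IsManifold (𝓡 n) ∞ M] [ConnectedSpace M]
  [T3Space M] [MeasurableSpace M] [BorelSpace M]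

/-- **Carrillo–Ni 2009, Thm. 1.1 (i), unconditionally** (any dimension `n`): on a complete
connected gradient shrinker `Ric + Hess f = g/2` normalised by `R + |∇f|² = f` (closed `g`-balls
compact), `e^{-f}` is integrable against the Riemannian volume. [cite: CarrilloNi2009, Thm. 1.1 (i)] -/
theorem carrilloNi_integrable_exp_neg
    (g : PseudoRiemannianMetric (𝓡 n) ∞ (EuclideanSpace ℝ (Fin n)) (TangentSpace (𝓡 n) : M → Type _))
    [g.HasLeviCivita] (f : M → ℝ) (hg : g.IsRiemannian)
    (hc : ∀ (x : M) (r : NNReal), IsCompact {y : M | g.edist hg x y ≤ r})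
    (hf : ContMDiff (𝓡 n) 𝓘(ℝ, ℝ) ∞ f)
    (hsol : ∀ (x : M) (X Y : TangentSpace (𝓡 n) x),
      g.ricci x X Y + g.hessian f x X Y = (1 / 2 : ℝ) * g.val x X Y)
    (hnorm : ∀ x : M, g.scalarCurvature x + g.gradSq f x = f x) :
    Integrable (fun x ↦ Real.exp (-f x)) g.riemVolume :=
  (clauses_i_iii g f hg hc hf hsol hnorm).1

end Corollaries

end Literature.Geometry.Riemannian.NoncompactShrinkerGapCarrilloNiClauses

end Part14

/-!
## Part 15 — port of `Summits/SmoothPoincare4/SmoothPoincare4/Theorems/EntropyRungNoncompactShrinkerGapLiWangAllScales.lean` (2 declarations kept)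

# Li–Wang 2020, Thm. 1.1 — the logarithmic Sobolev constant of a complete gradient shrinker at all
# scales: discharge of the named fact `LiWang2020_shrinkerLSI_allScales`

The Literature named fact `Literature.Geometry.Riemannian.LiWang2020_shrinkerLSI_allScales`
(`ShrinkerEntropyAllScales.lean`; Y. Li, B. Wang, *Heat kernel on Ricci shrinkers*, Calc. Var. PDE 59
(2020), Thm. 1.1 = Prop. 5.9: on a complete connected normalised gradient shrinker
`log ((4π)^{-n/2} ∫ e^{-f}) ≤ 𝒲(g, ψ, τ)` for every `τ > 0` and every admissible `ψ`) is REDUCED in the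
tree (`LiWang2020_shrinkerLSI_allScales_of_heatFlow`, `ShrinkerEntropyAllScalesProofs.lean`) to the
existence, on every such shrinker and for every smooth positive datum `ρ₀` constant outside a compact
set, of the weighted heat flow `∂ₜu = Δu − g⁻¹(df, du)` jointly smooth on `M × [0, ∞)` with the linear
a-priori package (values in `[a, b]`, `|Lu|` bounded, `|∇u(t)|² ≤ e^{-t} C`, conserved `∫ u e^{-f}`).
This file supplies that flow from the heat-flow toolkit of the line (leads c8/c9, namespace
`…Theorems.NoncompactShrinkerGapHeat`) and closes the fact:

* `heatFlow_unique` — uniqueness of the energy-class flow on `[0, T]` (weak maximum principle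
  `helper_twoSidedBound` for the difference of two solutions);
* `shrinker_heatFlow` — the global flow with its package: the shrinker cut-offs `helper_shrinkerCutoff`
  (`|Δη_k|, |⟨∇f, ∇η_k⟩| ≤ C`), the coercivity `¼|∇f|² − ½Δf + 1 + n/4 ≥ 1` (`Δf = n/2 − R`, `R ≥ 0`),
  the flows `u_T` on `[0, T]` of `helper_heatFlowExistence`, glued along `T = k + 1` by
  `heatFlow_unique`; bounds `helper_twoSidedBound`, `helper_energyEstimate` + `helper_gradientDecay`
  (`Ric + Hess f = g/2`, `K = ½`), `helper_massConservation`, and the bounded generator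
  `heatFlow_weightedLaplacian_abs_le` (`EntropyRungNoncompactShrinkerGapLiWangAllScalesAux.lean`);
* `helper_liWangAllScales` — the theorem `= LiWang2020_shrinkerLSI_allScales`, by
  `LiWang2020_shrinkerLSI_allScales_of_heatFlow shrinker_heatFlow`;
* `liWang2020_shrinkerLSI_allScales_holds` — the discharge alias of the named fact.

## References

* [LiWang2020] Y. Li, B. Wang, Calc. Var. PDE 59 (2020) no. 194 (arXiv:1901.05691): Thm. 1.1 (p. 3),
  Prop. 5.9, Lemmas 5.10–5.11 (p. 20); §§2–3 (heat kernel of the shrinker).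
* [Grigoryan2009] A. Grigor'yan, *Heat Kernel and Analysis on Manifolds* (2009), §11.4, §12.1.
* [BakryGentilLedoux2014] D. Bakry, I. Gentil, M. Ledoux (2014), Thm. 3.2.3/3.2.4 (pp. 143–146).
* [CarrilloNi2009] J. A. Carrillo, L. Ni, Comm. Anal. Geom. 17 (2009), §§3–4 (the case `τ = 1`).
-/

section Part15

open scoped _root_.Manifold _root_.ContDiff _root_.ENNReal _root_.NNReal _root_.Topology
open _root_.MeasureTheory _root_.Set _root_.Filter
open Literature.Geometry.Lorentzian Literature.Geometry.Riemannian

namespace Literature.Geometry.Riemannian.NoncompactShrinkerGapLiWang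

open NoncompactShrinkerGapHeat NoncompactShrinkerGapHeat.CutoffToolkit NoncompactShrinkerGapCarrilloNiClauses

section Weighted

variable {n : ℕ} {M : Type*} [TopologicalSpace M] [T2Space M] [SecondCountableTopology M]
  [ChartedSpace (EuclideanSpace ℝ (Fin n)) M] [IsManifold (𝓡 n) ∞ M] [T3Space M]
  [MeasurableSpace M] [BorelSpace M]
  {g : PseudoRiemannianMetric (𝓡 n) ∞ (EuclideanSpace ℝ (Fin n)) (TangentSpace (𝓡 n) : M → Type _)}
  [g.HasLeviCivita]

/-- **Uniqueness of the weighted heat flow in the energy class `𝕃²(e^{-V}dV_g ⊗ dt)`**: two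
solutions of `∂ₛρ = Lρ` on `[0, T]`, smooth on `M × Oᵢ` (`Oᵢ ⊇ [0, T]` open), with the same
datum and `(ρᵢ − c)² e^{-V}` integrable on the strip, coincide on `[0, T] × M` — the weak maximum
principle (`helper_twoSidedBound` with `c₁ = C₁ = 0`) applied to the solution `ρ₁ − ρ₂`.
[cite: Grigoryan2009, §11.4 and §12.1] -/
theorem heatFlow_unique (hg : g.IsRiemannian) {V : M → ℝ} (hV : ContMDiff (𝓡 n) 𝓘(ℝ, ℝ) ∞ V)
    (hfin : Integrable (fun x ↦ Real.exp (-V x)) g.riemVolume)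
    {η : ℕ → M → ℝ} {C : ℝ} (hηs : ∀ k, ContMDiff (𝓡 n) 𝓘(ℝ, ℝ) ∞ (η k))
    (hηc : ∀ k, HasCompactSupport (η k)) (hη01 : ∀ k x, 0 ≤ η k x ∧ η k x ≤ 1)
    (hηmono : ∀ k x, η k x ≤ η (k + 1) x) (hη1 : ∀ x, ∀ᶠ k in atTop, ∀ᶠ y in 𝓝 x, η k y = 1)
    (hηL : ∀ k x, |g.dalembertian (η k) x - g.innerDual x (mvfderiv (𝓡 n) V x).toLinearMap
      (mvfderiv (𝓡 n) (η k) x).toLinearMap| ≤ C)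
    {T : ℝ} (hT : 0 < T) {O₁ O₂ : Set ℝ} {ρ₁ ρ₂ : ℝ → M → ℝ} (hO₁ : IsOpen O₁) (hO₂ : IsOpen O₂)
    (hTO₁ : Icc 0 T ⊆ O₁) (hTO₂ : Icc 0 T ⊆ O₂)
    (hρ₁ : ContMDiffOn ((𝓡 n).prod 𝓘(ℝ, ℝ)) 𝓘(ℝ, ℝ) ∞ (fun p : M × ℝ ↦ ρ₁ p.2 p.1) (univ ×ˢ O₁))
    (hρ₂ : ContMDiffOn ((𝓡 n).prod 𝓘(ℝ, ℝ)) 𝓘(ℝ, ℝ) ∞ (fun p : M × ℝ ↦ ρ₂ p.2 p.1) (univ ×ˢ O₂))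
    (heq₁ : ∀ s ∈ Icc 0 T, ∀ x, deriv (fun r ↦ ρ₁ r x) s = g.dalembertian (ρ₁ s) x
      - g.innerDual x (mvfderiv (𝓡 n) V x).toLinearMap (mvfderiv (𝓡 n) (ρ₁ s) x).toLinearMap)
    (heq₂ : ∀ s ∈ Icc 0 T, ∀ x, deriv (fun r ↦ ρ₂ r x) s = g.dalembertian (ρ₂ s) x
      - g.innerDual x (mvfderiv (𝓡 n) V x).toLinearMap (mvfderiv (𝓡 n) (ρ₂ s) x).toLinearMap)
    (h0 : ∀ x, ρ₁ 0 x = ρ₂ 0 x) {c : ℝ}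
    (hint₁ : Integrable (fun p : M × ℝ ↦ (ρ₁ p.2 p.1 - c) ^ 2 * Real.exp (-V p.1))
      ((g.riemVolume.prod (volume : Measure ℝ)).restrict (univ ×ˢ Ioo 0 T)))
    (hint₂ : Integrable (fun p : M × ℝ ↦ (ρ₂ p.2 p.1 - c) ^ 2 * Real.exp (-V p.1))
      ((g.riemVolume.prod (volume : Measure ℝ)).restrict (univ ×ˢ Ioo 0 T))) :
    ∀ s ∈ Icc 0 T, ∀ x, ρ₁ s x = ρ₂ s x := by
  intro s hs x
  have h2 : (2 : ℕ∞ω) ≤ (∞ : ℕ∞ω) := WithTop.coe_le_coe.mpr le_top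
  set O : Set ℝ := O₁ ∩ O₂ with hOdef
  have hO : IsOpen O := hO₁.inter hO₂
  have hTO : Icc 0 T ⊆ O := subset_inter hTO₁ hTO₂
  have hexpc : Continuous fun y ↦ Real.exp (-V y) := Real.continuous_exp.comp hV.continuous.neg
  set z : ℝ → M → ℝ := fun r y ↦ ρ₁ r y + (-1) * ρ₂ r y with hzdef
  have hzs : ContMDiffOn ((𝓡 n).prod 𝓘(ℝ, ℝ)) 𝓘(ℝ, ℝ) ∞ (fun p : M × ℝ ↦ z p.2 p.1) (univ ×ˢ O) :=
    (hρ₁.mono (Set.prod_mono le_rfl inter_subset_left)).add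
      (contMDiffOn_const.mul (hρ₂.mono (Set.prod_mono le_rfl inter_subset_right)))
  have heqz : ∀ r ∈ Icc 0 T, ∀ y, deriv (fun r' ↦ z r' y) r = g.dalembertian (z r) y -
      g.innerDual y (mvfderiv (𝓡 n) V y).toLinearMap (mvfderiv (𝓡 n) (z r) y).toLinearMap := by
    intro r hr y
    have hd : HasDerivAt (fun r' ↦ z r' y)
        (deriv (fun r' ↦ ρ₁ r' y) r + (-1) * deriv (fun r' ↦ ρ₂ r' y) r) r :=
      (CutoffToolkit.hasDerivAt_time hO₁ hρ₁ y (hTO₁ hr)).add ((CutoffToolkit.hasDerivAt_time hO₂ hρ₂ y (hTO₂ hr)).const_mul (-1))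
    rw [hd.deriv, heq₁ r hr y, heq₂ r hr y, show z r = fun y' ↦ ρ₁ r y' + (-1) * ρ₂ r y' from rfl,
      weightedLaplacian_add_const_mul
        (((contMDiff_slice_of_contMDiffOn hρ₁ (hTO₁ hr)).of_le h2).contMDiffAt)
        (((contMDiff_slice_of_contMDiffOn hρ₂ (hTO₂ hr)).of_le h2).contMDiffAt)]
  have hz0 : ∀ y, (0 : ℝ) ≤ z 0 y ∧ z 0 y ≤ 0 := fun y ↦ by
    simp only [hzdef, h0 y]; constructor <;> linarith
  have hbound : Integrable (fun p : M × ℝ ↦ 2 * ((ρ₁ p.2 p.1 - c) ^ 2 * Real.exp (-V p.1) +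
      (ρ₂ p.2 p.1 - c) ^ 2 * Real.exp (-V p.1)))
      ((g.riemVolume.prod (volume : Measure ℝ)).restrict (univ ×ˢ Ioo 0 T)) :=
    (hint₁.add hint₂).const_mul 2
  have hint : Integrable (fun p : M × ℝ ↦ (z p.2 p.1 - 0) ^ 2 * Real.exp (-V p.1))
      ((g.riemVolume.prod (volume : Measure ℝ)).restrict (univ ×ˢ Ioo 0 T)) := by
    refine hbound.mono' ?_ (ae_of_all _ fun p ↦ ?_)
    · have hcont : ContinuousOn (fun p : M × ℝ ↦ (z p.2 p.1 - 0) ^ 2 * Real.exp (-V p.1))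
          (univ ×ˢ O) :=
        ((hzs.continuousOn.sub continuousOn_const).pow 2).mul
          (hexpc.comp continuous_fst).continuousOn
      exact (hcont.mono (Set.prod_mono le_rfl (Ioo_subset_Icc_self.trans hTO))).aestronglyMeasurable
        (MeasurableSet.univ.prod measurableSet_Ioo)
    · have hex := Real.exp_pos (-V p.1)
      rw [Real.norm_eq_abs, abs_of_nonneg (mul_nonneg (sq_nonneg _) hex.le)]
      simp only [hzdef]
      have : (ρ₁ p.2 p.1 + (-1) * ρ₂ p.2 p.1 - 0) ^ 2 ≤
          2 * ((ρ₁ p.2 p.1 - c) ^ 2 + (ρ₂ p.2 p.1 - c) ^ 2) := by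
        nlinarith [sq_nonneg (ρ₁ p.2 p.1 + ρ₂ p.2 p.1 - 2 * c)]
      nlinarith
  have h := helper_twoSidedBound n M g V hg hV hfin η C hηs hηc hη01 hηmono hη1 hηL T O z hT hO hTO
    hzs heqz 0 0 0 le_rfl le_rfl hz0 hint s hs x
  have hz : z s x = 0 := le_antisymm h.2 h.1
  simp only [hzdef] at hz
  linarith

end Weighted

section Shrinker

variable {n : ℕ} {M : Type} [TopologicalSpace M] [T2Space M] [SecondCountableTopology M]
  [ChartedSpace (EuclideanSpace ℝ (Fin n)) M] [IsManifold (𝓡 n) ∞ M] [ConnectedSpace M] [T3Space M]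
  [MeasurableSpace M] [BorelSpace M]
  {g : PseudoRiemannianMetric (𝓡 n) ∞ (EuclideanSpace ℝ (Fin n)) (TangentSpace (𝓡 n) : M → Type _)}
  [g.HasLeviCivita] {f : M → ℝ}

/-- **The global weighted heat flow of a complete gradient shrinker with its a-priori package**
(the hypothesis `hflow` of `LiWang2020.log_le_wEntropy_of_heatFlow`): on a complete connected
normalised gradient shrinker `(M, g, f)` and for a smooth datum `ρ₀` constant outside a compact
set with values in `[a, b]`, `a > 0`, there is `u` jointly smooth on `M × [0, ∞)` with `u(0) = ρ₀`,
`∂ₜu = Δu − g⁻¹(df, du)`, `a ≤ u ≤ b`, `|Lu| ≤ C_L`, `|∇u(t)|² ≤ e^{-t} C_Γ` and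
`∫ u(t) e^{-f} = ∫ ρ₀ e^{-f}`. The flows `u_T` on `[0, T]` of `helper_heatFlowExistence` (shrinker
cut-offs `helper_shrinkerCutoff`, coercivity `¼|∇f|² − ½Δf + 1 + n/4 ≥ 1` from `Δf = n/2 − R`,
`R ≥ 0`) agree on overlaps (`heatFlow_unique`) and glue to `u`; the package is
`helper_twoSidedBound`, `helper_energyEstimate` + `helper_gradientDecay` (`K = ½`),
`helper_massConservation` and `heatFlow_weightedLaplacian_abs_le`.
[cite: LiWang2020, §§2–3 (arXiv:1901.05691)] [cite: Grigoryan2009, §11.4 and §12.1]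
[cite: BakryGentilLedoux2014, Thm. 3.2.3/3.2.4 (pp. 143–146)] -/
theorem shrinker_heatFlow (hg : g.IsRiemannian)
    (hc : ∀ (x : M) (r : NNReal), IsCompact {y : M | g.riemEDist x y ≤ r})
    (hf : ContMDiff (𝓡 n) 𝓘(ℝ, ℝ) ∞ f)
    (hsol : ∀ (x : M) (X Y : TangentSpace (𝓡 n) x),
      g.ricci x X Y + g.hessian f x X Y = (1 / 2 : ℝ) * g.val x X Y)
    (hnorm : ∀ x : M, g.scalarCurvature x + g.gradSq f x = f x)
    (ρ₀ : M → ℝ) (hρ₀ : ContMDiff (𝓡 n) 𝓘(ℝ, ℝ) ∞ ρ₀)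
    (hK : ∃ K₀ : Set M, IsCompact K₀ ∧ ∃ c₀ : ℝ, ∀ x, x ∉ K₀ → ρ₀ x = c₀)
    (a b : ℝ) (ha : 0 < a) (hab : ∀ x, a ≤ ρ₀ x ∧ ρ₀ x ≤ b) :
    ∃ u : ℝ → M → ℝ,
      ContMDiffOn ((𝓡 n).prod 𝓘(ℝ, ℝ)) 𝓘(ℝ, ℝ) ∞ (fun p : M × ℝ ↦ u p.2 p.1) (univ ×ˢ Ici 0) ∧
      u 0 = ρ₀ ∧
      (∀ t ∈ Ici (0 : ℝ), ∀ x, derivWithin (fun s ↦ u s x) (Ici 0) t =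
        g.dalembertian (u t) x
          - g.innerDual x (mvfderiv (𝓡 n) f x : TangentSpace (𝓡 n) x →ₗ[ℝ] ℝ)
              (mvfderiv (𝓡 n) (u t) x : TangentSpace (𝓡 n) x →ₗ[ℝ] ℝ)) ∧
      (∀ t ∈ Ici (0 : ℝ), ∀ x, a ≤ u t x ∧ u t x ≤ b) ∧
      (∃ CL : ℝ, ∀ t ∈ Ici (0 : ℝ), ∀ x, |g.dalembertian (u t) x
        - g.innerDual x (mvfderiv (𝓡 n) f x : TangentSpace (𝓡 n) x →ₗ[ℝ] ℝ)
            (mvfderiv (𝓡 n) (u t) x : TangentSpace (𝓡 n) x →ₗ[ℝ] ℝ)| ≤ CL) ∧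
      (∃ CΓ : ℝ, ∀ t ∈ Ici (0 : ℝ), ∀ x, g.gradSq (u t) x ≤ Real.exp (-t) * CΓ) ∧
      (∀ t ∈ Ici (0 : ℝ), ∫ x, u t x * Real.exp (-f x) ∂g.riemVolume =
        ∫ x, ρ₀ x * Real.exp (-f x) ∂g.riemVolume) := by
  classical
  haveI := CarrilloNi2009_shrinkerLSI.isFiniteMeasureOnCompacts_riemVolume hg
  have h2 : (2 : ℕ∞ω) ≤ (∞ : ℕ∞ω) := WithTop.coe_le_coe.mpr le_top
  have hc' : ∀ (x : M) (r : NNReal), IsCompact {y : M | g.edist hg x y ≤ r} := fun x r ↦ by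
    simpa only [PseudoRiemannianMetric.riemEDist_eq hg] using hc x r
  /- the shrinker toolkit: `R ≥ 0`, `M` nonempty, `e^{-f} ∈ L¹`, `CD(½, ∞)`, cut-offs, coercivity -/
  obtain ⟨hR0, hne, -⟩ := scalarCurvature_nonneg_and_isCompact_sublevel g f hg hc' hf hsol hnorm
  haveI := hne
  have hZi : Integrable (fun x ↦ Real.exp (-f x)) g.riemVolume :=
    carrilloNi_integrable_exp_neg g f hg hc' hf hsol hnorm
  have hRic : ∀ (x : M) (X : TangentSpace (𝓡 n) x),
      (1 / 2 : ℝ) * g.val x X X ≤ g.ricci x X X + g.hessian f x X X := fun x X ↦ (hsol x X X).ge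
  obtain ⟨η, C, hηs, hηc, hη01, hηmono, hη1, -, hηΔ, hηf⟩ :=
    helper_shrinkerCutoff n M g f hg hc' hf hsol hnorm
  have hη1' : ∀ x, ∀ᶠ k in atTop, ∀ᶠ y in 𝓝 x, η k y = 1 := fun x ↦ by
    filter_upwards [tendsto_natCast_atTop_atTop.eventually (eventually_gt_atTop (f x))] with k hk
    exact hη1 k x (by linarith)
  have hηL : ∀ k x, |g.dalembertian (η k) x - g.innerDual x (mvfderiv (𝓡 n) f x).toLinearMap
      (mvfderiv (𝓡 n) (η k) x).toLinearMap| ≤ C + C := fun k x ↦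
    (abs_sub _ _).trans (add_le_add (hηΔ k x) (hηf k x))
  have hlam : ∀ x, 1 ≤ g.gradSq f x / 4 - g.dalembertian f x / 2 + (1 + n / 4) := fun x ↦ by
    have h1 := CarrilloNi2009_shrinkerLSI.scalarCurvature_add_dalembertian hsol x
    have h3 := g.gradSq_nonneg hg f x
    linarith [hR0 x]
  /- the datum: `ρ₀ = c + ψ₀`, `c ∈ [a, b]`, `ψ₀ ∈ C_c^∞`; bounds `b − a`, `G₀`, `C_L` -/
  obtain ⟨K₀, hK₀, c₀, hc₀⟩ := hK
  obtain ⟨c, hac, hcb, hcK⟩ : ∃ c, a ≤ c ∧ c ≤ b ∧ ∀ x, x ∉ K₀ → ρ₀ x = c := by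
    by_cases h : ∃ x, x ∉ K₀
    · obtain ⟨x, hx⟩ := h
      exact ⟨c₀, hc₀ x hx ▸ (hab x).1, hc₀ x hx ▸ (hab x).2, hc₀⟩
    · push Not at h
      exact ⟨a, le_rfl, (hab hne.some).1.trans (hab hne.some).2, fun x hx ↦ absurd (h x) hx⟩
  set ψ₀ : M → ℝ := fun x ↦ ρ₀ x - c with hψ₀def
  have hψ : ContMDiff (𝓡 n) 𝓘(ℝ, ℝ) ∞ ψ₀ := hρ₀.sub contMDiff_const
  have hψ0 : ∀ x, x ∉ K₀ → ψ₀ x = 0 := fun x hx ↦ by simp [hψ₀def, hcK x hx]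
  have hψc : HasCompactSupport ψ₀ := HasCompactSupport.intro hK₀ hψ0
  have hρ₀eq : ∀ x, c + ψ₀ x = ρ₀ x := fun x ↦ by simp only [hψ₀def]; ring
  have hB : ∀ x, |ρ₀ x - c| ≤ b - a := fun x ↦
    abs_le.2 ⟨by linarith [(hab x).1], by linarith [(hab x).2]⟩
  obtain ⟨G₀, hG₀⟩ := exists_forall_abs_le_of_eventuallyConst (contMDiff_gradSq g hρ₀).continuous
    ⟨K₀, hK₀, 0, fun x hx ↦
      g.gradSq_eq_zero_of_mvfderiv_eq_zero (mvfderiv_eq_zero_of_eventuallyConst hK₀ hcK hx)⟩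
  have hG₀' : ∀ x, g.gradSq ρ₀ x ≤ G₀ := fun x ↦ (le_abs_self _).trans (hG₀ x)
  obtain ⟨hLc, hLcs⟩ := continuous_hasCompactSupport_weightedLaplacian (g := g) (V := f) hψ hψc hf
  obtain ⟨CL, hCL⟩ := hLc.bounded_above_of_compact_support hLcs
  have hCL' : ∀ x, |g.dalembertian ρ₀ x - g.innerDual x (mvfderiv (𝓡 n) f x).toLinearMap
      (mvfderiv (𝓡 n) ρ₀ x).toLinearMap| ≤ CL := fun x ↦ by
    have hρ₀fun : ρ₀ = fun y ↦ 1 * ψ₀ y + c := funext fun y ↦ by simp only [hψ₀def]; ring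
    rw [hρ₀fun, weightedLaplacian_affine ((hψ.of_le h2).contMDiffAt) 1 c, one_mul,
      ← Real.norm_eq_abs]
    exact hCL x
  /- the flow with horizon `T` and its a-priori package -/
  have hpack : ∀ T : ℝ, 0 < T → ∃ (O : Set ℝ) (ρ : ℝ → M → ℝ), IsOpen O ∧ Icc 0 T ⊆ O ∧
      ContMDiffOn ((𝓡 n).prod 𝓘(ℝ, ℝ)) 𝓘(ℝ, ℝ) ∞ (fun p : M × ℝ ↦ ρ p.2 p.1) (univ ×ˢ O) ∧
      ρ 0 = ρ₀ ∧
      (∀ s ∈ Icc 0 T, ∀ x, deriv (fun r ↦ ρ r x) s = g.dalembertian (ρ s) x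
        - g.innerDual x (mvfderiv (𝓡 n) f x).toLinearMap (mvfderiv (𝓡 n) (ρ s) x).toLinearMap) ∧
      Integrable (fun p : M × ℝ ↦ (ρ p.2 p.1 - c) ^ 2 * Real.exp (-f p.1))
        ((g.riemVolume.prod (volume : Measure ℝ)).restrict (univ ×ˢ Ioo 0 T)) ∧
      (∀ s ∈ Icc 0 T, ∀ x, a ≤ ρ s x ∧ ρ s x ≤ b) ∧
      (∀ s ∈ Icc 0 T, ∀ x, g.gradSq (ρ s) x ≤ Real.exp (-s) * G₀) ∧
      (∀ s ∈ Icc 0 T, ∫ x, ρ s x * Real.exp (-f x) ∂g.riemVolume =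
        ∫ x, ρ₀ x * Real.exp (-f x) ∂g.riemVolume) ∧
      (∀ s ∈ Ico 0 T, ∀ x, |g.dalembertian (ρ s) x
        - g.innerDual x (mvfderiv (𝓡 n) f x).toLinearMap (mvfderiv (𝓡 n) (ρ s) x).toLinearMap| ≤ CL) := by
    intro T hT
    obtain ⟨O, ρ, hO, hTO, hρ, hρ0, heq, hint⟩ := helper_heatFlowExistence n M g f (1 + n / 4) hg hf
      hlam η C hηs hηc hη01 hηmono hη1' hηΔ c ψ₀ hψ hψc T hT
    have hρ0' : ρ 0 = ρ₀ := funext fun x ↦ (hρ0 x).trans (hρ₀eq x)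
    have hbd : ∀ s ∈ Icc 0 T, ∀ x, a ≤ ρ s x ∧ ρ s x ≤ b :=
      helper_twoSidedBound n M g f hg hf hZi η (C + C) hηs hηc hη01 hηmono hη1' hηL T O ρ hT hO hTO
        hρ heq c a b hac hcb (fun x ↦ by rw [hρ0']; exact hab x) hint
    have hint0 : Integrable (fun x ↦ (ρ 0 x - c) ^ 2 * Real.exp (-f x)) g.riemVolume := by
      rw [hρ0']
      refine Continuous.integrable_of_hasCompactSupport
        ((hψ.continuous.pow 2).mul (Real.continuous_exp.comp hf.continuous.neg)) ?_
      exact HasCompactSupport.intro hK₀ fun x hx ↦ by simp [hcK x hx]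
    obtain ⟨hgradInt, -⟩ := helper_energyEstimate n M g f hg hf η (C + C) hηs hηc hη01 hηmono hη1'
      hηL T O ρ hT hO hTO hρ heq c hint hint0
    have hgd : ∀ s ∈ Icc 0 T, ∀ x, g.gradSq (ρ s) x ≤ Real.exp (-s) * G₀ := fun s hs x ↦ by
      have h := helper_gradientDecay n M g f (1 / 2) hg hf hRic η (C + C) hηs hηc hη01 hηmono hη1'
        hηL T O ρ hT hO hTO hρ heq hgradInt G₀ (fun x ↦ by rw [hρ0']; exact hG₀' x) s hs x
      rwa [show -2 * (1 / 2 : ℝ) * s = -s by ring] at h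
    have habs : ∀ s ∈ Icc 0 T, ∀ x, |ρ s x| ≤ b := fun s hs x ↦ by
      rw [abs_of_nonneg (ha.le.trans (hbd s hs x).1)]; exact (hbd s hs x).2
    have hmass : ∀ s ∈ Icc 0 T, ∫ x, ρ s x * Real.exp (-f x) ∂g.riemVolume =
        ∫ x, ρ₀ x * Real.exp (-f x) ∂g.riemVolume := fun s hs ↦ by
      rw [helper_massConservation n M g f hg hf hZi η (C + C) hηs hηc hη01 hηmono hη1' hηL T O ρ hT
        hO hTO hρ heq b habs s hs, hρ0']
    have hLb := heatFlow_weightedLaplacian_abs_le hg hf hZi hηs hηc hη01 hηmono hη1' hηL hT hO hTO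
      hρ heq (c := c) (B := b - a) (CL := CL) (fun x ↦ by rw [hρ0']; exact hB x)
      (fun x ↦ by rw [hρ0']; exact hCL' x) hint
    exact ⟨O, ρ, hO, hTO, hρ, hρ0', heq, hint, hbd, hgd, hmass, hLb⟩
  choose O ρ hO hTO hρ hρ0 heq hint hbd hgd hmass hLb using hpack
  /- the flows with integer horizons `k + 1` agree on overlaps and glue to `u` -/
  have hTk : ∀ k : ℕ, (0 : ℝ) < k + 1 := fun k ↦ by positivity
  set R : ℕ → ℝ → M → ℝ := fun k ↦ ρ (k + 1) (hTk k) with hRdef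
  have hcons : ∀ (j k : ℕ), ∀ s ∈ Icc (0 : ℝ) (min (j : ℝ) k + 1), ∀ x, R j s x = R k s x := by
    intro j k
    have hmin : (0 : ℝ) < min (j : ℝ) k + 1 := by positivity
    have hj : Icc (0 : ℝ) (min (j : ℝ) k + 1) ⊆ Icc 0 ((j : ℝ) + 1) :=
      Icc_subset_Icc_right (by linarith [min_le_left (j : ℝ) k])
    have hk : Icc (0 : ℝ) (min (j : ℝ) k + 1) ⊆ Icc 0 ((k : ℝ) + 1) :=
      Icc_subset_Icc_right (by linarith [min_le_right (j : ℝ) k])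
    refine heatFlow_unique hg hf hZi hηs hηc hη01 hηmono hη1' hηL hmin (hO _ _) (hO _ _)
      (hj.trans (hTO _ _)) (hk.trans (hTO _ _)) (hρ _ _) (hρ _ _)
      (fun s hs x ↦ heq _ _ s (hj hs) x) (fun s hs x ↦ heq _ _ s (hk hs) x)
      (fun x ↦ by simp only [hRdef, hρ0]) (c := c) ?_ ?_
    · exact (hint _ _).mono_measure (Measure.restrict_mono (Set.prod_mono le_rfl
        (Ioo_subset_Ioo_right (by linarith [min_le_left (j : ℝ) k]))) le_rfl)
    · exact (hint _ _).mono_measure (Measure.restrict_mono (Set.prod_mono le_rfl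
        (Ioo_subset_Ioo_right (by linarith [min_le_right (j : ℝ) k]))) le_rfl)
  set u : ℝ → M → ℝ := fun t ↦ R ⌈t⌉₊ t with hudef
  have hu : ∀ (k : ℕ) (t : ℝ), t ∈ Icc (0 : ℝ) (k + 1) → u t = R k t := by
    intro k t ht
    have h1 : t ≤ min (⌈t⌉₊ : ℝ) k + 1 := by
      rcases le_total (⌈t⌉₊ : ℝ) k with h | h
      · rw [min_eq_left h]; linarith [Nat.le_ceil t]
      · rw [min_eq_right h]; exact ht.2
    exact funext fun x ↦ hcons ⌈t⌉₊ k t ⟨ht.1, h1⟩ x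
  have hceil : ∀ t : ℝ, t < (⌈t⌉₊ : ℝ) + 1 := fun t ↦ by linarith [Nat.le_ceil t]
  refine ⟨u, ?_, ?_, ?_, ?_, ⟨CL, ?_⟩, ⟨G₀, ?_⟩, ?_⟩
  · -- joint smoothness on `M × [0, ∞)`
    rintro ⟨x, t⟩ ⟨-, ht⟩
    have ht' : (0 : ℝ) ≤ t := ht
    set k : ℕ := ⌈t⌉₊ with hkdef
    have hlt : t < (k : ℝ) + 1 := hceil t
    have hat : ContMDiffAt ((𝓡 n).prod 𝓘(ℝ, ℝ)) 𝓘(ℝ, ℝ) ∞ (fun q : M × ℝ ↦ R k q.2 q.1) (x, t) :=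
      (hρ _ _).contMDiffAt ((isOpen_univ.prod (hO _ _)).mem_nhds ⟨mem_univ _, hTO _ _ ⟨ht', hlt.le⟩⟩)
    refine hat.contMDiffWithinAt.congr_of_eventuallyEq ?_ (by simp only [hu k t ⟨ht', hlt.le⟩])
    have hN : (univ : Set M) ×ˢ Iio ((k : ℝ) + 1) ∈ 𝓝 (x, t) :=
      (isOpen_univ.prod isOpen_Iio).mem_nhds ⟨mem_univ _, hlt⟩
    filter_upwards [mem_nhdsWithin_of_mem_nhds hN, self_mem_nhdsWithin] with q hq hq'
    have hq2 : (0 : ℝ) ≤ q.2 := hq'.2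
    simp only [hu k q.2 ⟨hq2, le_of_lt hq.2⟩]
  · -- initial datum
    exact hρ0 _ _
  · -- the equation, with the one-sided derivative within `[0, ∞)`
    intro t ht x
    have ht' : (0 : ℝ) ≤ t := ht
    set k : ℕ := ⌈t⌉₊ with hkdef
    have hlt : t < (k : ℝ) + 1 := hceil t
    have htk : t ∈ Icc (0 : ℝ) (k + 1) := ⟨ht', hlt.le⟩
    have hd : HasDerivAt (fun s ↦ R k s x) (deriv (fun s ↦ R k s x) t) t :=
      CutoffToolkit.hasDerivAt_time (hO _ _) (hρ _ _) x (hTO _ _ htk)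
    have hdw : HasDerivWithinAt (fun s ↦ u s x) (deriv (fun s ↦ R k s x) t) (Ici 0) t := by
      refine hd.hasDerivWithinAt.congr_of_eventuallyEq ?_ (by rw [hu k t htk])
      filter_upwards [mem_nhdsWithin_of_mem_nhds (Iio_mem_nhds hlt), self_mem_nhdsWithin]
        with s hs hs'
      have hs0 : (0 : ℝ) ≤ s := hs'
      rw [hu k s ⟨hs0, le_of_lt hs⟩]
    rw [hdw.derivWithin (uniqueDiffOn_Ici 0 t ht), heq _ _ t htk x, hu k t htk]
  · -- two-sided bounds
    intro t ht x
    have ht' : (0 : ℝ) ≤ t := ht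
    have htk : t ∈ Icc (0 : ℝ) (⌈t⌉₊ + 1) := ⟨ht', (hceil t).le⟩
    rw [hu _ t htk]
    exact hbd _ _ t htk x
  · -- `|Lu| ≤ C_L`
    intro t ht x
    have ht' : (0 : ℝ) ≤ t := ht
    have htk : t ∈ Icc (0 : ℝ) (⌈t⌉₊ + 1) := ⟨ht', (hceil t).le⟩
    rw [hu _ t htk]
    exact hLb _ _ t ⟨ht', hceil t⟩ x
  · -- gradient decay
    intro t ht x
    have ht' : (0 : ℝ) ≤ t := ht
    have htk : t ∈ Icc (0 : ℝ) (⌈t⌉₊ + 1) := ⟨ht', (hceil t).le⟩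
    rw [hu _ t htk]
    exact hgd _ _ t htk x
  · -- conservation of mass
    intro t ht
    have ht' : (0 : ℝ) ≤ t := ht
    have htk : t ∈ Icc (0 : ℝ) (⌈t⌉₊ + 1) := ⟨ht', (hceil t).le⟩
    rw [hu _ t htk]
    exact hmass _ _ t htk

end Shrinker

end Literature.Geometry.Riemannian.NoncompactShrinkerGapLiWang

end Part15

/-! ## Part 16 — the EXACT discharge of `LiWang2020_shrinkerLSI_allScales` -/

namespace Literature.Geometry.Riemannian

open NoncompactShrinkerGapLiWang in
/-- **The named fact `LiWang2020_shrinkerLSI_allScales` HOLDS** (`ShrinkerEntropyAllScales.lean`; Y. Li, B. Wang, Calc. Var. PDE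
59 (2020), Thm. 1.1 / Prop. 5.9: the optimal logarithmic Sobolev constant of a complete connected normalised gradient shrinker is
`log((4π)^{-n/2} ∫ e^{-f})` at ALL scales `τ > 0`, for every admissible `ψ`), by the tree's reduction
`LiWang2020_shrinkerLSI_allScales_of_heatFlow` (`ShrinkerEntropyAllScalesProofs.lean`) fed with the global energy-class weighted
heat flow of the shrinker `NoncompactShrinkerGapLiWang.shrinker_heatFlow` (previous Part).  EXACT discharge, Literature-side twin of
`Summit.SmoothPoincare4.SmoothPoincare4.Theorems.NoncompactShrinkerGapLiWang.liWang2020_shrinkerLSI_allScales_holds` (same proof).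
[cite: LiWang2020, Thm. 1.1 and Prop. 5.9] -/
theorem LiWang2020_shrinkerLSI_allScales_holds : LiWang2020_shrinkerLSI_allScales :=
  LiWang2020_shrinkerLSI_allScales_of_heatFlow
    fun _n _M _ _ _ _ _ _ _ _ _ _g _ _f hg hc hf hsol hnorm ρ₀ hρ₀ hK a b ha hab ↦
      shrinker_heatFlow hg hc hf hsol hnorm ρ₀ hρ₀ hK a b ha hab

end Literature.Geometry.Riemannian

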